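import Summits.KontsevichZagierPeriods.KontsevichZagierPeriods.Theses.SymplecticScissors
import Literature.NumberTheory.Transcendental.KZKernelConjectureForms
import Literature.NumberTheory.Transcendental.KZCalculusProofs
import Literature.NumberTheory.Transcendental.KZSemiCanonicalReductionProofs
import Summits.KontsevichZagierPeriods.KontsevichZagierPeriods.Theses.FermatIsogeny
import Literature.NumberTheory.Transcendental.KZUnfolding
import Literature.NumberTheory.Transcendental.KZSubcalculusInvariants
import Literature.NumberTheory.Transcendental.SemialgebraicMapsProofs
import Literature.ModelTheory.ExponentialFields.TarskiSeidenbergProofs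
import Literature.Barriers.KontsevichZagierPeriods.AlgebraicPrimitivesObstruction
import Literature.NumberTheory.Transcendental.SemialgebraicVolume
import Literature.ModelTheory.ExponentialFields.SemialgebraicInterior
import Literature.MeasureTheory.Lebesgue.PolynomialZeroSet
import Summits.KontsevichZagierPeriods.KontsevichZagierPeriods.Theorems.RealOnePeriodRelations.Negative.Kit
import Summits.KontsevichZagierPeriods.KontsevichZagierPeriods.Theorems.StuffleInKZ.Negative.IntegrandAdditivityDerived
import Literature.NumberTheory.Transcendental.KZFibredRelations
import Summits.KontsevichZagierPeriods.KontsevichZagierPeriods.Theorems.StuffleInKZ.Negative.NewtonLeibnizFree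
import Summits.KontsevichZagierPeriods.KontsevichZagierPeriods.Theorems.PlanarSAZylev.Negative.Kit

-- buildfix 2026-08-20 (ops-buildfix lane): `PlanarTransport` (stmt-KontsevichZagierPeriods-9849) was dropped from the
-- generated route file on 2026-08-16 (items-cap autofix); its registered signature is re-homed VERBATIM as
-- `Summit.KontsevichZagierPeriods.SymplecticScissors.PlanarTransport` in the landed kit
-- `Theorems/PlanarSAZylev/Negative/Kit.lean` (imported above) — opened by name in the `open` block below.

/-!
# Disproof of `PlanarAreas` (stmt-KontsevichZagierPeriods-4990) — standing adversary, findings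

Crux (shared verbatim by routes LowDimension r3, HodgeLevel r4, SymplecticScissors r5):
`PlanarAreas : ∀ r r' : KZ.IntegralRep 2, (integrand = 1 on r.domain) → (same for r') →
  r.value = r'.value → KZ.Equivalent r r'`
— two `ℚ`-semialgebraic planar sets of (finite, by `integrableOn`) equal area are connected by the
four moves of `KZCalculus.lean` (1a domain additivity with NULL overlaps, 1b integrand additivity,
2 change of variables with `|det|`, 3 Newton–Leibniz along the last coordinate), chains through ANY
dimension allowed (`KZ.relations` is one closure over all `n`).

VERDICT (cycle 2, gen 2): STILL NO KILL.  New in cycle 2 (§6–§8 at the end of the file):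
(§6) the quotient `FormalRep ⧸ relations` is DIVISIBLE already modulo rule 1b (`[σ,f] ≡ k•[σ,f/k]`;
and 1b is itself derivable from 1a + 3, Theorems/StuffleInKZ/Negative/IntegrandAdditivityDerived), so
every reduced-group-valued invariant (ℤ: Euler characteristic; lattices: integer Dehn/Hadwiger
bookkeeping; finite groups: parities) compatible with 1b — or with 1a + 3 — vanishes IDENTICALLY: a
second, structural death of all counting invariants, independent of rule 1a's null overlaps, and the
one formal difference with crux 3 `PlanarK0Injective` (rules 1a + 2 only); the TORSION reading of
"no division by integers is a rule": the crux forces saturation of `relations` on planar integrand-1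
differences, so a pair connected `k` times over but not once would refute it
(`not_planarAreas_of_torsion`) — an attack surface invisible to ℝ-valued invariants; no candidate
found (doubled chains along 2-to-1 covers split honestly by 1a).  (§7) `not_withoutHorizontalMove`:
rules 1a/1b/3 PLUS every rule-2 instance fixing the first coordinate (vertical shears/translations,
fibrewise rescalings, under-graph lifts) still cannot connect `R` to `R + (3,0)` (the window
invariant survives: Jacobian formula on the window), while `R + (0,5)` IS one such move away — every
chain moves the slicing coordinate (for line green-native-bands: its `stub_swap` is load-bearing).
(§8) Targets: the 7 stubs of the lead's skeleton (green-native-bands, 22c93b59…) attacked — all TRUE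
on paper, none vacuous, none of a refuted shape; sizes, not truth, are the risk; the line's terminal
state "4990 closed modulo stmt-10042" is consistent with this file.
WHY IT RESISTS (cycle-2 formulation).  A refuting invariant must be additive, kill 1a (so ignore null
sets), 1b (so be divisible-valued, §6), rule 2 (so be invariant under every ℚ-semialgebraic
injective a.e.-differentiable substitution — algebraic correspondences acting on (curve, form, arc)
data) and rule 3 (so kill exact algebraic forms).  An invariant of (domain, integrand) data with
these four properties factors through the class of the underlying 1-period datum modulo
bilinearity, functoriality and boundaries — and by Huber–Wüstholz (2022, Thm. 13.3 (2)) that class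
is detected by the VALUE.  So every invariant one can write down from the data is either not
compatible with some move (all the window/marginal/germ/Euler candidates: each dies on exactly one
rule, §3b/§3c/§6/§7) or is a function of the area.  What is left is purely combinatorial: torsion
in the ℤ-span (§6c) or a motivic relation whose realisation by moves needs a configuration the
calculus cannot express — neither has a candidate.

VERDICT (cycle 1): NO KILL.  `PlanarAreas` is an INSTANCE of the summit (`of_summit`: integrand `1`
is KZ-literal rational data, `p = q = 1`), so a refutation is a counterexample to Conjecture 1 as
formalised: it needs an additive invariant `J : KZ.FormalRep →+ A` vanishing on the four move sets
and separating two equal-area planar `ℚ`-regions (`not_of_separating_invariant`).  Every candidate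
tried dies: `eval`-type invariants (weighted Lebesgue integrals) collapse to `eval` by ergodicity of
rational translations (rule 2) plus rule 3; the o-minimal Euler characteristic dies on rule 1a's
null overlaps (`[N] = [N] + [N]`, cf. `of_mem_relations_of_volume_eq_zero`); first-coordinate fibre
integrals (Cavalieri data) survive 1a/1b/3 but die on rule 2.  By Huber–Wüstholz (Thm 13.3 (2))
every `ℚ̄`-linear relation among such areas (real 1-periods of curve type) is motivic, so a witness
pair would have to be a MOTIVIC relation not realisable by moves — no technique produces one.

INDEX
* §0 read-back `crux_iff`.
* §1 shape: `isRational_of_integrand_one`, `of_summit`, `not_summit_of_not`, `of_kzKernelConjecture`,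
  `of_volumeForm`, `of_planarK0Injective` (modulo the route support `GroupToAreas`),
  `not_of_separating_invariant` (template of ANY refutation).
* §2 load-bearing hypotheses: `not_withoutValue` (drop `r.value = r'.value`: false, witness
  `[∅]` vs `[(0,1)²]`); `withoutIntegrandOne_of_summit` (drop "integrand = 1": still a consequence
  of the summit — the hypothesis is SCOPE, not load); `volumeForm_of_summit` (drop "dimension 2":
  same).  So the crux has exactly one load-bearing hypothesis and it is the trivial one.
* §3 refuted strengthening `not_oneMoveNoNull`: "equal area ⇒ ONE change-of-variables move"
  (the Monge form `PlanarTransport` WITHOUT its null-set clause) is FALSE: open square `(0,1)²`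
  versus closed square `[0,1]²` (a differentiable injective `Φ` with `|det DΦ| = 1` on the open
  square cannot hit the corner `0`: the first coordinate of `Φ` would have an interior minimum, so
  `e₀ ∘ DΦ = 0`, contradicting `det ≠ 0`).  Hence PlanarTransport's "discard null sets" and the
  `[N] = [N] + [N]` bookkeeping of TransportToGroup are load-bearing, and Cresson–Viu-Sos's
  no-dissection obstruction (barrier `cressonViuSos_prop_3_2`, vacuous for polyhedra below
  dimension 5) has a trivial planar analogue for semialgebraic SETS.
  Bookkeeping lemma of independent use: `exists_witness_of_mem_changeOfVariablesRel`
  (`[r] − [r'] ∈ changeOfVariablesRel` with `r.domain ≠ r'.domain` ⇒ an actual witness `Φ, Φ'`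
  FROM `r` ONTO `r'`), via `of_sub_of_eq_of_sub_of` in the free abelian group.
* §3b refuted strengthening `not_additivityOnly`: rules 1a/1b alone do not act transitively on
  equal-area regions (the tree's window invariant `KZ.restrictedEval` separates `(0,1)²` from its
  translate) — some rule-2 or rule-3 move occurs in every chain.
* §3c (at the end of the file) **RULE 2 IS LOAD-BEARING** `not_withoutRule2`: the sub-calculus
  generated by rules 1a, 1b, 3 (ALL dimensions allowed) does NOT prove the crux.  Invariant: the
  first-coordinate window values `Λₑ = KZ.restrictedEval (win e)` vanish on 1a/1b
  (tree) and on Newton–Leibniz moves `n+2 → n+1` (`restrictedEval_win_nl_succ`, windowed Fubini),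
  and a Newton–Leibniz move `1 → 0` contributes a clamped primitive, SEMIALGEBRAIC in `e`
  (`nl_zero_defect`, Tarski–Seidenberg); so along any such chain `e ↦ Λₑ([r] − [r'])` is
  semialgebraic up to a constant (`winSemialgebraic_of_mem`).  Witness: the hyperbola region
  `R = {1<x<2, 0<y<1/x}` against its translate `R + (3,0)` (equal area by translation invariance;
  window values `log e` on `[1,2]`, `restrictedEval_win_hypRep`), contradicting the tree's barrier
  fact `noSemialgebraicPrimitive_inv_sub_two_holds` (no semialgebraic primitive of `1/(t−2)`).
  Consequences: every chain for `PlanarAreas` contains a genuine change of variables (the pair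
  itself IS equivalent in the full calculus — a coordinate SWAP plus Cavalieri in `y`, or the
  dimension-1 translation `x ↦ x + 3` between the two Newton–Leibniz shadows `[(1,2), 1/x]`,
  `[(4,5), 1/(x−3)]` — so it is no counterexample to the crux; route CommonUnfolding's level class
  must keep its permutations); translations of regions with ALGEBRAIC window primitives (e.g. the
  unit square) ARE derivable without rule 2, through dimension `0`.
* §3d (end of file) TIGHTNESS of §3c, `hypRep_equivalent_hypShiftRep`: the witness pair IS equivalent
  in the full calculus — null algebraic arcs (`equivalent_of_null_diff`), one Newton–Leibniz move
  onto the shadow `[(1,2), 1/x]` (`KZ.exists_underGraph`), the dimension-1 translation `x ↦ x + 3`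
  as ONE rule-2 instance (`of_invShiftRep_zero_sub_three_mem`), and back; so §3c blames exactly
  the missing rule 2.
* §4 normalisations provers may use (all sorry-free): integrand-1 reps are exactly finite-area
  regions (`volume_lt_top_of_integrand_one`, `value_eq_toReal_volume`); off-domain values are
  irrelevant (tree: `MzvKernelInKZ.Negative.of_sub_of_mem_relations_of_eqOn`); null regions are relations
  (`of_mem_relations_of_volume_eq_zero`), so the area-`0` slice of the crux is PROVED
  (`planarAreas_of_value_eq_zero`); WLOG both domains are OPEN (`equivalent_interiorRep`,
  `planarAreas_iff_open`).
* §5 THE DIMENSION-1 SECTOR: `equivalent_dim_one_of_planarAreas` (the crux decides every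
  equal-value pair of NON-NEGATIVE 1-dimensional representations, via `KZ.exists_underGraph`),
  `not_planarAreas_of_dim_one` (so any non-equivalent such pair kills the crux), and the sharpest
  candidate made formal: `isogenyLinearNinth_of_planarAreas` (crux + the Beta identity ⟹ route
  FermatIsogeny's `IsogenyLinearNinth`, stmt-3896).  CANDIDATE PAIRS: (i) KZ's π-quadruple as planar
  regions — disc, `{0<y<4/(1+x²), 0<x<1}`, `{0<y<2√(1−x²)}`, `{0<y<(1−x²)^{-1/2}}` — derivable by
  hand (one rule-3 + one algebraic rule-2 each); (ii) Landen/Gauss `2`-isogeny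
  `K((1−k′)/(1+k′)) = ((1+k′)/2)·K(k)` at `k = 3/5` as two subgraph regions — expected derivable by
  two finite-map shears (route SymplecticScissors, CHEAPEST FALSIFIER (1)); (iii) the CM relation
  `B(5/9,7/9) = (8/3)·3^{1/6} sin(π/9)·B(5/9,8/9)` (FermatIsogeny's IsogenyLinearNinth, a
  correspondence on `F₉` not induced by automorphisms) as the two Beta subgraph regions
  `{0<t<1, 0<y<t^{-4/9}(1−t)^{-2/9}}` and `{0<t<1, 0<y<c·t^{-1/9}(1−t)^{-4/9}}` — equal areas by
  Huber–Wüstholz-type theory, NO chain known: the sharpest place where a refutation (an invariant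
  separating them) or a proof (a chain) would be informative.  Decidability of equality of such
  areas (Sertöz–Ouaknine–Worrell 2025) gives neither.

* §6 (end of file, cycle 2) DIVISIBILITY / NO REDUCED INVARIANTS / TORSION: `scaleRep`,
  `of_sub_nsmul_mem_closure_integrandAdd`, `exists_sub_nsmul_mem_relations`,
  `exists_sub_nsmul_mem_closure_domAdd_nl` (via StuffleInKZ's derivability of 1b), `IsReducedGroup`,
  `eq_zero_of_isReducedGroup`, `not_separating_of_isReducedGroup`, `RelationsSaturated`,
  `saturated_of_kzKernelConjecture`, `sub_mem_relations_of_nsmul_mem`, `not_planarAreas_of_torsion`;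
  §6d `of_idRep_sub_of_constRep_half_mem_changeOfVariablesRel` (no fake torsion: `t = u²`).
* §7 (end of file, cycle 2) A HORIZONTAL MOVE IS LOAD-BEARING: `fixingFirstCoordCoVRel`,
  `restrictedEval_win_eq_zero_of_mem_fixingFirstCoordCoVRel`, `winSemialgebraic_of_mem_fixing`,
  `not_winSemialgebraic_hyp`, `WithoutHorizontalMove`, `not_withoutHorizontalMove` (re-proves
  `not_withoutRule2`), tightness `of_hypRep_sub_of_hypUpRep_mem` (the vertical translate is ONE
  fixing move away); §7e bridge to the tree's fibred sub-calculus (`KZFibredRelations`):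
  `hyp_not_mem_closure_fibred_nl`, `not_fibredNLTransitiveOnAreas` (integrand-1 counterpart of
  StuffleInKZ's `swapWitness_not_mem_closure_fibred_nl`; the marginal-shadow invariant `algShadow`
  is blind on integrand-1 regions, the window invariant is not), `fibredEquivalent_hypRep_hypUpRep`;
  §7f `hasAlgShadow_hyp_pair`, `shadow_blind_window_sees` (the §3c pair lies in `algShadow`, so the
  marginal-shadow invariant provably does not see it; landed copy Negative/FibredAndShadow.lean).
* §8 (end of file, cycle 2) `-- Targets`: verdicts on the 7 stubs of the lead's skeleton.
* §9 (end of file, cycle 2) OPEN questions made formal: `gradedEval_sub_eq_zero` (the tree's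
  rule-3-independence invariant is blind here), `WithoutRule3` with
  `PlanarK0Injective → WithoutRule3 → PlanarAreas`; torsion; dimension budget `relationsLE 2`.
* §10 (end of file, cycle 2) negatives index / barrier catalogue / literature status (search-degraded this cycle).

Everything here is sorry-free; axioms ⊆ {propext, Classical.choice, Quot.sound} (checked for
`not_oneMoveNoNull`, `not_additivityOnly`, `not_withoutRule2`, `nl_zero_defect`,
`restrictedEval_win_nl_succ`, `hypRep_equivalent_hypShiftRep`, `eq_zero_of_isReducedGroup`,
`not_withoutHorizontalMove`).

USE / LANDED COPIES (importable, namespace `Summit.KontsevichZagierPeriods.PlanarAreas.Negative`):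
`Theorems/PlanarAreas/Negative/Core.lean` (p74397: §0–§2), `WindowInvariant.lean` (p73796),
`WindowDefect.lean` (p74398), `Strengthenings.lean` (p74596: §3, §3b), `Normalisations.lean`
(p74884: §4, §5), `Rule2LoadBearing.lean` (p74641: §3c), `Tightness.lean` (p75048: §3d);
cycle 2: `Divisibility.lean` (p76449: §6, landed a557e3a5a6e0), `HorizontalMove.lean` (p76451: §7, landed
6fef1fff13cb), `FibredAndShadow.lean` (§7e–§7f, p77515).
This work file = the same content under `…Cruxes.PlanarAreas.Disproof` plus running commentary.
-/

noncomputable section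

set_option linter.dupNamespace false

open Set MeasureTheory MvPolynomial Filter Topology
open Literature.NumberTheory.Transcendental Literature.ModelTheory.ExponentialFields

namespace Summit.KontsevichZagierPeriods.KontsevichZagierPeriods.Cruxes.PlanarAreas.Disproof

open Summit.KontsevichZagierPeriods.KontsevichZagierPeriods.Theses.SymplecticScissors
  (PlanarAreas VolumeForm PlanarK0Injective GroupToAreas)
open Summit.KontsevichZagierPeriods.SymplecticScissors (PlanarTransport)

/-! ## §0 Read-back -/

/-- The crux, unfolded (by `Iff.rfl`). -/
theorem crux_iff :
    PlanarAreas ↔ ∀ (r r' : KZ.IntegralRep 2), (∀ p ∈ r.domain, r.integrand p = 1) →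
      (∀ p ∈ r'.domain, r'.integrand p = 1) → r.value = r'.value → KZ.Equivalent r r' :=
  Iff.rfl

/-! ## §1 Shape of any refutation -/

/-- An integrand-`1` representation has KZ's literal rational shape (`p = q = 1`). -/
theorem isRational_of_integrand_one {n : ℕ} {r : KZ.IntegralRep n}
    (h : ∀ p ∈ r.domain, r.integrand p = 1) : r.IsRational :=
  ⟨1, 1, fun x _ => by simp, fun x hx => by simp [h x hx]⟩

/-- **The crux is an instance of the summit** (Conjecture 1 as formalised, `n = m = 2`,
integrands `1 = 1/1`). -/
theorem of_summit (h : _root_.KontsevichZagierPeriods) : PlanarAreas :=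
  fun r r' hr hr' hv => h r r' (isRational_of_integrand_one hr) (isRational_of_integrand_one hr') hv

/-- Hence any disproof of the crux disproves the summit. -/
theorem not_summit_of_not (h : ¬ PlanarAreas) : ¬ _root_.KontsevichZagierPeriods :=
  mt of_summit h

/-- The crux from the kernel form `ker eval = relations`. -/
theorem of_kzKernelConjecture (h : KZKernelConjecture) : PlanarAreas :=
  of_summit (kzKernelConjecture_iff_isRational.mp h)

/-- The crux is the layer `N = 2` of the route frame `VolumeForm`. -/
theorem of_volumeForm (h : VolumeForm) : PlanarAreas :=
  fun r r' hr hr' hv => h r r' hr hr' hv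

/-- The group form `PlanarK0Injective` (crux 9847) implies the crux, given the route support
`GroupToAreas` (stmt-9851, planar set-chains are KZ chains: `AddSubgroup.closure_le` plus
`KZ.domainAddRel_subset_relations` / `KZ.changeOfVariablesRel_subset_relations`; a prover's item,
candidate proofs attached there, not re-proved by the refuter). -/
theorem of_planarK0Injective (hG : GroupToAreas) (h : PlanarK0Injective) : PlanarAreas :=
  fun r r' hr hr' hv => hG r r' (h r r' hr hr' hv)

/-- TEMPLATE of a refutation: an additive invariant `J` vanishing on the four move sets which
separates two integrand-`1` planar representations of equal area.  (Soundness makes `eval` such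
an invariant except for the last clause: `J` must see more than the area.) -/
theorem not_of_separating_invariant {A : Type*} [AddCommGroup A] (J : KZ.FormalRep →+ A)
    (hJ : ∀ x ∈ KZ.domainAddRel ∪ KZ.integrandAddRel ∪ KZ.changeOfVariablesRel ∪
      KZ.newtonLeibnizRel, J x = 0)
    (r r' : KZ.IntegralRep 2) (hr : ∀ p ∈ r.domain, r.integrand p = 1)
    (hr' : ∀ p ∈ r'.domain, r'.integrand p = 1) (hv : r.value = r'.value)
    (hJr : J (KZ.of r) ≠ J (KZ.of r')) : ¬ PlanarAreas := by
  intro h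
  have hker : KZ.relations ≤ J.ker := (AddSubgroup.closure_le _).mpr fun x hx => hJ x hx
  have := hker (h r r' hr hr' hv)
  rw [AddMonoidHom.mem_ker, map_sub, sub_eq_zero] at this
  exact hJr this

/-! ## §2 Load-bearing hypotheses -/

/-! ### Two test regions: the open and the closed unit square -/

/-- The open unit square `(0,1)²`. -/
def openSquareSet : Set (Fin 2 → ℝ) := {p | 0 < p 0 ∧ p 0 < 1 ∧ 0 < p 1 ∧ p 1 < 1}

/-- The closed unit square `[0,1]²`. -/
def closedSquareSet : Set (Fin 2 → ℝ) := {p | 0 ≤ p 0 ∧ p 0 ≤ 1 ∧ 0 ≤ p 1 ∧ p 1 ≤ 1}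

/-- The open square as a product of intervals. -/
theorem openSquareSet_eq_pi : openSquareSet = Set.pi univ fun _ : Fin 2 => Ioo (0:ℝ) 1 := by
  ext p
  simp [openSquareSet, Fin.forall_fin_two, and_assoc]

/-- The closed square as an order interval of `ℝ²`. -/
theorem closedSquareSet_eq_Icc : closedSquareSet = Icc (0 : Fin 2 → ℝ) 1 := by
  ext p
  simp only [closedSquareSet, mem_setOf_eq, mem_Icc, Pi.le_def, Fin.forall_fin_two,
    Pi.zero_apply, Pi.one_apply]
  tauto

/-- The open unit square is `ℚ`-semialgebraic (four polynomial inequalities). -/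
theorem isSemialgebraic_openSquareSet : IsSemialgebraic ℚ openSquareSet := by
  have h0 := isSemialgebraic_setOf_eval_lt (k := ℚ) (R := ℝ) (ι := Fin 2) (C 0) (X 0)
  have h1 := isSemialgebraic_setOf_eval_lt (k := ℚ) (R := ℝ) (ι := Fin 2) (X 0) (C 1)
  have h2 := isSemialgebraic_setOf_eval_lt (k := ℚ) (R := ℝ) (ι := Fin 2) (C 0) (X 1)
  have h3 := isSemialgebraic_setOf_eval_lt (k := ℚ) (R := ℝ) (ι := Fin 2) (X 1) (C 1)
  have hEq : openSquareSet =
      {x : Fin 2 → ℝ | aeval x (C 0 : MvPolynomial (Fin 2) ℚ) < aeval x (X 0 : MvPolynomial (Fin 2) ℚ)} ∩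
      ({x : Fin 2 → ℝ | aeval x (X 0 : MvPolynomial (Fin 2) ℚ) < aeval x (C 1 : MvPolynomial (Fin 2) ℚ)} ∩
      ({x : Fin 2 → ℝ | aeval x (C 0 : MvPolynomial (Fin 2) ℚ) < aeval x (X 1 : MvPolynomial (Fin 2) ℚ)} ∩
      {x : Fin 2 → ℝ | aeval x (X 1 : MvPolynomial (Fin 2) ℚ) < aeval x (C 1 : MvPolynomial (Fin 2) ℚ)})) := by
    ext p
    simp [openSquareSet]
  rw [hEq]
  exact h0.inter (h1.inter (h2.inter h3))

/-- The closed unit square is `ℚ`-semialgebraic. -/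
theorem isSemialgebraic_closedSquareSet : IsSemialgebraic ℚ closedSquareSet := by
  have h0 := isSemialgebraic_setOf_eval_le (k := ℚ) (R := ℝ) (ι := Fin 2) (C 0) (X 0)
  have h1 := isSemialgebraic_setOf_eval_le (k := ℚ) (R := ℝ) (ι := Fin 2) (X 0) (C 1)
  have h2 := isSemialgebraic_setOf_eval_le (k := ℚ) (R := ℝ) (ι := Fin 2) (C 0) (X 1)
  have h3 := isSemialgebraic_setOf_eval_le (k := ℚ) (R := ℝ) (ι := Fin 2) (X 1) (C 1)
  have hEq : closedSquareSet =
      {x : Fin 2 → ℝ | aeval x (C 0 : MvPolynomial (Fin 2) ℚ) ≤ aeval x (X 0 : MvPolynomial (Fin 2) ℚ)} ∩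
      ({x : Fin 2 → ℝ | aeval x (X 0 : MvPolynomial (Fin 2) ℚ) ≤ aeval x (C 1 : MvPolynomial (Fin 2) ℚ)} ∩
      ({x : Fin 2 → ℝ | aeval x (C 0 : MvPolynomial (Fin 2) ℚ) ≤ aeval x (X 1 : MvPolynomial (Fin 2) ℚ)} ∩
      {x : Fin 2 → ℝ | aeval x (X 1 : MvPolynomial (Fin 2) ℚ) ≤ aeval x (C 1 : MvPolynomial (Fin 2) ℚ)})) := by
    ext p
    simp [closedSquareSet]
  rw [hEq]
  exact h0.inter (h1.inter (h2.inter h3))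

/-- The open unit square has area `1`. -/
theorem volume_openSquareSet : volume openSquareSet = 1 := by
  rw [openSquareSet_eq_pi]
  have := Real.volume_pi_Ioo (a := fun _ : Fin 2 => (0:ℝ)) (b := fun _ => 1)
  simpa using this

/-- The closed unit square has area `1`. -/
theorem volume_closedSquareSet : volume closedSquareSet = 1 := by
  rw [closedSquareSet_eq_Icc, Real.volume_Icc_pi]
  simp

/-- The open unit square is open. -/
theorem isOpen_openSquareSet : IsOpen openSquareSet := by
  rw [openSquareSet_eq_pi]
  exact isOpen_set_pi finite_univ fun _ _ => isOpen_Ioo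

/-- The corner `0` lies in the closed square. -/
theorem zero_mem_closedSquareSet : (0 : Fin 2 → ℝ) ∈ closedSquareSet := by
  simp [closedSquareSet]

/-- The corner `0` does not lie in the open square. -/
theorem zero_not_mem_openSquareSet : (0 : Fin 2 → ℝ) ∉ openSquareSet := by
  simp [openSquareSet]

/-- The integrand-`1` representation on a `ℚ`-semialgebraic set of finite measure. -/
def constOneRep (s : Set (Fin 2 → ℝ)) (hs : IsSemialgebraic ℚ s) (hfin : volume s ≠ ⊤) :
    KZ.IntegralRep 2 where
  domain := s
  integrand := fun _ => 1
  isSemialgebraic_domain := hs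
  isSemialgebraicFunOn_integrand := by simpa using isSemialgebraicFunOn_natCast hs 1
  integrableOn := integrableOn_const hfin

/-- The domain of `constOneRep s`. -/
@[simp] theorem constOneRep_domain (s : Set (Fin 2 → ℝ)) (hs : IsSemialgebraic ℚ s)
    (hfin : volume s ≠ ⊤) : (constOneRep s hs hfin).domain = s := rfl

/-- The integrand of `constOneRep s` is the constant `1`. -/
@[simp] theorem constOneRep_integrand (s : Set (Fin 2 → ℝ)) (hs : IsSemialgebraic ℚ s)
    (hfin : volume s ≠ ⊤) : (constOneRep s hs hfin).integrand = fun _ => 1 := rfl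

/-- The value of `constOneRep s` is the area of `s`. -/
theorem value_constOneRep (s : Set (Fin 2 → ℝ)) (hs : IsSemialgebraic ℚ s)
    (hfin : volume s ≠ ⊤) : (constOneRep s hs hfin).value = (volume s).toReal := by
  show ∫ _ in s, (1:ℝ) = _
  rw [setIntegral_const, smul_eq_mul, mul_one, measureReal_def]

/-- `[(0,1)², 1]`. -/
def openSquare : KZ.IntegralRep 2 :=
  constOneRep openSquareSet isSemialgebraic_openSquareSet (by simp [volume_openSquareSet])

/-- `[[0,1]², 1]`. -/
def closedSquare : KZ.IntegralRep 2 :=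
  constOneRep closedSquareSet isSemialgebraic_closedSquareSet (by simp [volume_closedSquareSet])

/-- The domain of `openSquare`. -/
@[simp] theorem openSquare_domain : openSquare.domain = openSquareSet := rfl
/-- The domain of `closedSquare`. -/
@[simp] theorem closedSquare_domain : closedSquare.domain = closedSquareSet := rfl
/-- The integrand of `openSquare`. -/
@[simp] theorem openSquare_integrand : openSquare.integrand = fun _ => 1 := rfl
/-- The integrand of `closedSquare`. -/
@[simp] theorem closedSquare_integrand : closedSquare.integrand = fun _ => 1 := rfl

/-- `[(0,1)², 1]` has value `1`. -/
theorem value_openSquare : openSquare.value = 1 := by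
  rw [openSquare, value_constOneRep, volume_openSquareSet, ENNReal.toReal_one]

/-- `[[0,1]², 1]` has value `1`. -/
theorem value_closedSquare : closedSquare.value = 1 := by
  rw [closedSquare, value_constOneRep, volume_closedSquareSet, ENNReal.toReal_one]

/-! ### (H3) `r.value = r'.value` is load-bearing (trivially, by soundness) -/

/-- The crux with the hypothesis `r.value = r'.value` dropped. -/
def WithoutValue : Prop :=
  ∀ (r r' : KZ.IntegralRep 2), (∀ p ∈ r.domain, r.integrand p = 1) →
    (∀ p ∈ r'.domain, r'.integrand p = 1) → KZ.Equivalent r r'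

/-- Dropping the value hypothesis is false: `[∅]` (area `0`) and `[(0,1)²]` (area `1`) are not
equivalent, by soundness of the calculus (`KZ.Equivalent.value_eq_holds`). -/
theorem not_withoutValue : ¬ WithoutValue := by
  intro h
  have hE := h (KZ.IntegralRep.empty 2) openSquare (fun p hp => hp.elim) (fun _ _ => rfl)
  have := KZ.Equivalent.value_eq_holds hE
  rw [KZ.IntegralRep.value_empty, value_openSquare] at this
  exact zero_ne_one this

/-! ### (H1)/(H2) "integrand = 1" and "dimension 2" are scope, not load -/

/-- The crux with the integrand-`1` hypotheses dropped: ALL planar representations. -/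
def WithoutIntegrandOne : Prop :=
  ∀ (r r' : KZ.IntegralRep 2), r.value = r'.value → KZ.Equivalent r r'

/-- The crux is a special case of its integrand-free version. -/
theorem planarAreas_of_withoutIntegrandOne (h : WithoutIntegrandOne) : PlanarAreas :=
  fun r r' _ _ hv => h r r' hv

/-- Dropping "integrand = 1" still follows from the kernel conjecture … -/
theorem withoutIntegrandOne_of_kzKernelConjecture (h : KZKernelConjecture) : WithoutIntegrandOne :=
  fun r r' hv => (kzKernelConjecture_iff_kzPeriodConjecture'.mp h) r r' hv

/-- … hence from the summit: the integrand-`1` hypotheses cannot be the reason the crux fails,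
short of the summit failing. -/
theorem withoutIntegrandOne_of_summit (h : _root_.KontsevichZagierPeriods) : WithoutIntegrandOne :=
  withoutIntegrandOne_of_kzKernelConjecture (kzKernelConjecture_iff_isRational.mpr h)

/-- Dropping "dimension 2" (the frame `VolumeForm`, all `N`) also follows from the summit. -/
theorem volumeForm_of_summit (h : _root_.KontsevichZagierPeriods) : VolumeForm :=
  fun _ r r' hr hr' hv => h r r' (isRational_of_integrand_one hr) (isRational_of_integrand_one hr') hv

/-! ## §3 A refuted strengthening: ONE move, no null sets -/

/-- Bookkeeping in a free abelian group: `of a − of b = of c − of d` with `a ≠ b` forces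
`a = c` and `b = d`. -/
theorem of_sub_of_eq_of_sub_of {X : Type*} {a b c d : X}
    (h : FreeAbelianGroup.of a - FreeAbelianGroup.of b =
      FreeAbelianGroup.of c - FreeAbelianGroup.of d) (hab : a ≠ b) : a = c ∧ b = d := by
  classical
  have h' : FreeAbelianGroup.of a + FreeAbelianGroup.of d =
      FreeAbelianGroup.of c + FreeAbelianGroup.of b := sub_eq_sub_iff_add_eq_add.mp h
  have key := congrArg FreeAbelianGroup.toFinsupp h'
  simp only [map_add, FreeAbelianGroup.toFinsupp_of] at key
  rcases (Finsupp.single_add_single_eq_single_add_single one_ne_zero one_ne_zero).mp key with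
    ⟨hac, hdb⟩ | ⟨-, hab', -⟩ | ⟨h2, -, -⟩
  · exact ⟨hac, hdb.symm⟩
  · exact absurd hab' hab
  · norm_num at h2

/-- **Unpacking a single change-of-variables move.** If `[r] − [r'] ∈ changeOfVariablesRel` and
`r.domain ≠ r'.domain`, then the existential witness of the move relates `r` to `r'` themselves:
a `ℚ`-semialgebraic `Φ`, differentiable within and injective on `r.domain`, with
`r'.domain = Φ '' r.domain` exactly and `r.integrand x = r'.integrand (Φ x) · |det Φ' x|`. -/
theorem exists_witness_of_mem_changeOfVariablesRel {n : ℕ} {r r' : KZ.IntegralRep n}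
    (hne : r.domain ≠ r'.domain) (h : KZ.of r - KZ.of r' ∈ KZ.changeOfVariablesRel) :
    ∃ (Φ : (Fin n → ℝ) → (Fin n → ℝ)) (Φ' : (Fin n → ℝ) → (Fin n → ℝ) →L[ℝ] (Fin n → ℝ)),
      IsSemialgebraicMapOn ℚ r.domain Φ ∧
      (∀ x ∈ r.domain, HasFDerivWithinAt Φ (Φ' x) r.domain x) ∧
      InjOn Φ r.domain ∧ r'.domain = Φ '' r.domain ∧
      (∀ x ∈ r.domain, r.integrand x = r'.integrand (Φ x) * |(Φ' x).det|) := by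
  obtain ⟨m, s, s', Φ, Φ', hΦ, hd, hinj, hdom, hf, heq⟩ := h
  have hne' : (⟨n, r⟩ : Σ k, KZ.IntegralRep k) ≠ ⟨n, r'⟩ := by
    intro h
    cases h
    exact hne rfl
  obtain ⟨h1, h2⟩ := of_sub_of_eq_of_sub_of (X := Σ k, KZ.IntegralRep k) heq hne'
  cases h1
  cases h2
  exact ⟨Φ, Φ', hΦ, hd, hinj, hdom, hf⟩

/-- STRENGTHENING: equal-area integrand-`1` planar representations differ by ONE
change-of-variables move — the Monge form `PlanarTransport` with its null-set clause
(`s ⊆ r`, `volume (r ∖ s) = 0`, …) deleted. -/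
def OneMoveNoNull : Prop :=
  ∀ (r r' : KZ.IntegralRep 2), (∀ p ∈ r.domain, r.integrand p = 1) →
    (∀ p ∈ r'.domain, r'.integrand p = 1) → r.value = r'.value →
    KZ.of r - KZ.of r' ∈ KZ.changeOfVariablesRel

/-- `PlanarTransport` trivially implies the strengthening's conclusion AFTER restriction; the
point of `not_oneMoveNoNull` is that the restriction cannot be omitted. -/
theorem oneMoveNoNull_le_planarTransport (h : OneMoveNoNull) : PlanarTransport := by
  intro r r' hr hr' hv
  exact ⟨r, r', subset_rfl, by simp, subset_rfl, by simp, hr, hr', h r r' hr hr' hv⟩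

/-- **The no-null-set Monge form is false**: `[(0,1)², 1]` and `[[0,1]², 1]` have equal area `1`
but are not ONE change of variables apart.  If `Φ` were the witness (differentiable on the open
square `S`, `|det DΦ| = 1` there because both integrands are `1`, `Φ '' S = [0,1]²`), pick
`x₀ ∈ S` with `Φ x₀ = 0`; the first coordinate `x ↦ Φ x 0` is `≥ 0` on `S` and `= 0` at the
interior point `x₀`, so its derivative `e₀* ∘ DΦ(x₀)` vanishes (`IsLocalMin.hasFDerivAt_eq_zero`),
contradicting the surjectivity of `DΦ(x₀)` (`det ≠ 0`). -/
theorem not_oneMoveNoNull : ¬ OneMoveNoNull := by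
  intro h
  have hmem := h openSquare closedSquare (fun _ _ => rfl) (fun _ _ => rfl)
    (by rw [value_openSquare, value_closedSquare])
  have hne : openSquare.domain ≠ closedSquare.domain := by
    intro hEq
    rw [openSquare_domain, closedSquare_domain] at hEq
    exact zero_not_mem_openSquareSet (hEq ▸ zero_mem_closedSquareSet)
  obtain ⟨Φ, Φ', -, hderiv, -, hdom, hjac⟩ := exists_witness_of_mem_changeOfVariablesRel hne hmem
  rw [openSquare_domain, closedSquare_domain] at hdom
  simp only [openSquare_domain, openSquare_integrand, closedSquare_integrand, one_mul] at hderiv hjac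
  -- a preimage of the corner `0`
  obtain ⟨x₀, hx₀S, hx₀⟩ : (0 : Fin 2 → ℝ) ∈ Φ '' openSquareSet := hdom ▸ zero_mem_closedSquareSet
  have hS : openSquareSet ∈ 𝓝 x₀ := isOpen_openSquareSet.mem_nhds hx₀S
  have hΦ : HasFDerivAt Φ (Φ' x₀) x₀ := (hderiv x₀ hx₀S).hasFDerivAt hS
  have hf : HasFDerivAt (fun x => Φ x 0) ((ContinuousLinearMap.proj 0).comp (Φ' x₀)) x₀ :=
    hasFDerivAt_pi'.1 hΦ 0
  have hmin : IsLocalMin (fun x => Φ x 0) x₀ := by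
    show ∀ᶠ x in 𝓝 x₀, Φ x₀ 0 ≤ Φ x 0
    filter_upwards [hS] with x hx
    have hxT : Φ x ∈ closedSquareSet := hdom ▸ mem_image_of_mem Φ hx
    rw [hx₀]
    exact hxT.1
  have hzero := hmin.hasFDerivAt_eq_zero hf
  -- `det DΦ(x₀) ≠ 0`
  have hdet : (Φ' x₀).det ≠ 0 := by
    intro h0
    have := hjac x₀ hx₀S
    rw [h0, abs_zero] at this
    exact one_ne_zero this
  have hsurj : Function.Surjective ((Φ' x₀ : (Fin 2 → ℝ) →ₗ[ℝ] (Fin 2 → ℝ))) := by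
    have hu : IsUnit ((Φ' x₀ : (Fin 2 → ℝ) →ₗ[ℝ] (Fin 2 → ℝ))) :=
      (LinearMap.isUnit_iff_isUnit_det _).mpr (isUnit_iff_ne_zero.mpr hdet)
    exact LinearMap.range_eq_top.mp ((LinearMap.isUnit_iff_range_eq_top _).mp hu)
  obtain ⟨v, hv⟩ := hsurj (Pi.single 0 1)
  have := DFunLike.congr_fun hzero v
  rw [ContinuousLinearMap.comp_apply] at this
  change (Φ' x₀ v) 0 = 0 at this
  rw [ContinuousLinearMap.coe_coe] at hv
  rw [hv] at this
  simp at this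

/-! ### §3b Additivity alone does not suffice: a map or a Newton–Leibniz move is needed

The tree's window invariant `KZ.restrictedEval` (integrate over `domain ∩ (0,1)ⁿ` only) kills the
two additivity moves (`KZ.closure_add_le_ker_restrictedEval`) and separates the unit square from
its translate by `(2, 0)`.  (Trivial, but it is the formal statement that rules 1a/1b alone do not
act transitively on equal-area regions: every chain for the crux contains a rule-2 or rule-3 move.) -/

/-- The translated open unit square `(2,3) × (0,1)`. -/
def shiftedSquareSet : Set (Fin 2 → ℝ) := {p | 2 < p 0 ∧ p 0 < 3 ∧ 0 < p 1 ∧ p 1 < 1}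

/-- The translated square as a product of intervals. -/
theorem shiftedSquareSet_eq_pi :
    shiftedSquareSet = Set.pi univ fun i : Fin 2 => Ioo ((![2, 0] : Fin 2 → ℝ) i) (![3, 1] i) := by
  ext p
  simp [shiftedSquareSet, Fin.forall_fin_two, and_assoc]

/-- The translated square is `ℚ`-semialgebraic. -/
theorem isSemialgebraic_shiftedSquareSet : IsSemialgebraic ℚ shiftedSquareSet := by
  have h0 := isSemialgebraic_setOf_eval_lt (k := ℚ) (R := ℝ) (ι := Fin 2) (C 2) (X 0)
  have h1 := isSemialgebraic_setOf_eval_lt (k := ℚ) (R := ℝ) (ι := Fin 2) (X 0) (C 3)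
  have h2 := isSemialgebraic_setOf_eval_lt (k := ℚ) (R := ℝ) (ι := Fin 2) (C 0) (X 1)
  have h3 := isSemialgebraic_setOf_eval_lt (k := ℚ) (R := ℝ) (ι := Fin 2) (X 1) (C 1)
  have hEq : shiftedSquareSet =
      {x : Fin 2 → ℝ | aeval x (C 2 : MvPolynomial (Fin 2) ℚ) < aeval x (X 0 : MvPolynomial (Fin 2) ℚ)} ∩
      ({x : Fin 2 → ℝ | aeval x (X 0 : MvPolynomial (Fin 2) ℚ) < aeval x (C 3 : MvPolynomial (Fin 2) ℚ)} ∩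
      ({x : Fin 2 → ℝ | aeval x (C 0 : MvPolynomial (Fin 2) ℚ) < aeval x (X 1 : MvPolynomial (Fin 2) ℚ)} ∩
      {x : Fin 2 → ℝ | aeval x (X 1 : MvPolynomial (Fin 2) ℚ) < aeval x (C 1 : MvPolynomial (Fin 2) ℚ)})) := by
    ext p
    simp [shiftedSquareSet]
  rw [hEq]
  exact h0.inter (h1.inter (h2.inter h3))

/-- The translated square has area `1`. -/
theorem volume_shiftedSquareSet : volume shiftedSquareSet = 1 := by
  rw [shiftedSquareSet_eq_pi, Real.volume_pi_Ioo]
  norm_num [Fin.prod_univ_two]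

/-- `[(2,3) × (0,1), 1]`. -/
def shiftedSquare : KZ.IntegralRep 2 :=
  constOneRep shiftedSquareSet isSemialgebraic_shiftedSquareSet (by simp [volume_shiftedSquareSet])

/-- The domain of `shiftedSquare`. -/
@[simp] theorem shiftedSquare_domain : shiftedSquare.domain = shiftedSquareSet := rfl
/-- The integrand of `shiftedSquare`. -/
@[simp] theorem shiftedSquare_integrand : shiftedSquare.integrand = fun _ => 1 := rfl

/-- `[(2,3)×(0,1), 1]` has value `1`. -/
theorem value_shiftedSquare : shiftedSquare.value = 1 := by
  rw [shiftedSquare, value_constOneRep, volume_shiftedSquareSet, ENNReal.toReal_one]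

/-- STRENGTHENING: chains of additivity moves (1a)/(1b) only. -/
def AdditivityOnly : Prop :=
  ∀ (r r' : KZ.IntegralRep 2), (∀ p ∈ r.domain, r.integrand p = 1) →
    (∀ p ∈ r'.domain, r'.integrand p = 1) → r.value = r'.value →
    KZ.of r - KZ.of r' ∈ AddSubgroup.closure (KZ.domainAddRel ∪ KZ.integrandAddRel)

/-- **Additivity alone is not enough**: `[(0,1)²]` and its translate `[(2,3)×(0,1)]` have equal
area but different restricted value over the window `(0,1)²` (`1` versus `0`), an invariant of the
additivity moves (`KZ.closure_add_le_ker_restrictedEval`). -/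
theorem not_additivityOnly : ¬ AdditivityOnly := by
  intro h
  have hmem := h openSquare shiftedSquare (fun _ _ => rfl) (fun _ _ => rfl)
    (by rw [value_openSquare, value_shiftedSquare])
  let A : (n : ℕ) → Set (Fin n → ℝ) := fun n => Set.pi univ fun _ : Fin n => Ioo (0:ℝ) 1
  have hA : ∀ n, MeasurableSet (A n) := fun n =>
    MeasurableSet.univ_pi fun _ => measurableSet_Ioo
  have hker := KZ.closure_add_le_ker_restrictedEval A hA hmem
  have h1 : openSquare.domain ∩ A 2 = openSquare.domain := by
    rw [openSquare_domain, openSquareSet_eq_pi, inter_self]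
  have h2 : shiftedSquare.domain ∩ A 2 = ∅ := by
    ext p
    simp only [shiftedSquare_domain, mem_inter_iff, mem_empty_iff_false, iff_false, not_and]
    intro hp hA2
    have h0 : p 0 ∈ Ioo (0:ℝ) 1 := by simpa [A] using hA2 0 (mem_univ _)
    exact absurd hp.1 (by linarith [h0.2])
  rw [AddMonoidHom.mem_ker, map_sub, KZ.restrictedEval_of, KZ.restrictedEval_of, h1, h2,
    Measure.restrict_empty, integral_zero_measure, sub_zero] at hker
  have hv : openSquare.value = 0 := hker
  rw [value_openSquare] at hv
  exact one_ne_zero hv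

/-! ## §4 Normalisations (positive lemmas for the provers) -/

/-- An integrand-`1` representation lives on a region of finite area. -/
theorem volume_lt_top_of_integrand_one {n : ℕ} (r : KZ.IntegralRep n)
    (hr : ∀ p ∈ r.domain, r.integrand p = 1) : volume r.domain < ⊤ := by
  have h1 : IntegrableOn (fun _ => (1:ℝ)) r.domain :=
    r.integrableOn.congr_fun (fun x hx => hr x hx) (KZ.IntegralRep.measurableSet_domain_holds r)
  have := (integrableOn_const_iff (C := (1:ℝ))).mp h1
  simpa using this

/-- Its value is the area. -/
theorem value_eq_toReal_volume {n : ℕ} (r : KZ.IntegralRep n)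
    (hr : ∀ p ∈ r.domain, r.integrand p = 1) : r.value = (volume r.domain).toReal := by
  rw [KZ.IntegralRep.value, setIntegral_congr_fun (KZ.IntegralRep.measurableSet_domain_holds r)
    (fun x hx => hr x hx), setIntegral_const, smul_eq_mul, mul_one, measureReal_def]

/-- Null regions are relations (`[N] − [N] − [N] ∈ domainAddRel` with `N = N ∪ N`). -/
theorem of_mem_relations_of_volume_eq_zero {n : ℕ} (r : KZ.IntegralRep n)
    (h : volume r.domain = 0) : KZ.of r ∈ KZ.relations :=
  KZ.levelRel_le_relations (KZ.of_mem_levelRel_of_volume_eq_zero r h)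

/-- **The area-`0` slice of the crux is a theorem**: two integrand-`1` planar representations of
area `0` are equivalent (both are relations). -/
theorem planarAreas_of_value_eq_zero (r r' : KZ.IntegralRep 2)
    (hr : ∀ p ∈ r.domain, r.integrand p = 1) (hr' : ∀ p ∈ r'.domain, r'.integrand p = 1)
    (h0 : r.value = 0) (hv : r.value = r'.value) : KZ.Equivalent r r' := by
  have hfin := volume_lt_top_of_integrand_one r hr
  have hfin' := volume_lt_top_of_integrand_one r' hr'
  have hz : volume r.domain = 0 := by
    rw [value_eq_toReal_volume r hr, ENNReal.toReal_eq_zero_iff] at h0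
    exact h0.resolve_right hfin.ne
  have hz' : volume r'.domain = 0 := by
    rw [hv, value_eq_toReal_volume r' hr', ENNReal.toReal_eq_zero_iff] at h0
    exact h0.resolve_right hfin'.ne
  exact KZ.relations.sub_mem (of_mem_relations_of_volume_eq_zero r hz)
    (of_mem_relations_of_volume_eq_zero r' hz')

/- Off-domain freedom (`of_sub_of_mem_relations_of_eqOn`: two representations with the same domain
whose integrands agree ON the domain differ by a relation) and `of_mem_relations_of_eqOn_zero` are
already in the tree as `Summit.KontsevichZagierPeriods.MzvKernelInKZ.Negative.of_sub_of_mem_relations_of_eqOn`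
/ `…of_mem_relations_of_eqOn_zero` (Theorems/MzvKernelInKZ/Negative/Core.lean); not re-declared here. -/

/-- **WLOG the domain is open**: an integrand-`1` planar representation is equivalent to the
integrand-`1` representation on the INTERIOR of its domain (the difference `σ ∖ interior σ` lies in
the frontier, which is null for semialgebraic `σ`, and null regions are relations). -/
theorem equivalent_interiorRep (r : KZ.IntegralRep 2) (hr : ∀ p ∈ r.domain, r.integrand p = 1) :
    ∃ r₀ : KZ.IntegralRep 2, r₀.domain = interior r.domain ∧ IsOpen r₀.domain ∧
      (∀ p ∈ r₀.domain, r₀.integrand p = 1) ∧ r₀.value = r.value ∧ KZ.Equivalent r r₀ := by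
  have hσ := r.isSemialgebraic_domain
  have hint : IsSemialgebraic ℚ (interior r.domain) := isSemialgebraic_interior hσ
  have hdiff : IsSemialgebraic ℚ (r.domain \ interior r.domain) := hσ.diff hint
  have hfin := volume_lt_top_of_integrand_one r hr
  have hnull : volume (r.domain \ interior r.domain) = 0 := by
    refine measure_mono_null (fun x hx => ?_) (volume_frontier_eq_zero_of_isSemialgebraic hσ)
    exact ⟨subset_closure hx.1, hx.2⟩
  let r₀ : KZ.IntegralRep 2 := constOneRep (interior r.domain) hint
    (lt_top_iff_ne_top.mp ((measure_mono interior_subset).trans_lt hfin))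
  let r₁ : KZ.IntegralRep 2 := constOneRep (r.domain \ interior r.domain) hdiff
    (by rw [hnull]; exact ENNReal.zero_ne_top)
  have h1a : KZ.of r - KZ.of r₀ - KZ.of r₁ ∈ KZ.relations := by
    refine KZ.domainAddRel_subset_relations ⟨2, r, r₀, r₁, ?_, ?_, ?_, ?_, rfl⟩
    · simp [r₀, r₁, union_sdiff_cancel interior_subset]
    · simp [r₀, r₁]
    · intro x hx; exact hr x (interior_subset hx)
    · intro x hx; exact hr x hx.1
  have h1 : KZ.of r₁ ∈ KZ.relations := of_mem_relations_of_volume_eq_zero r₁ hnull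
  refine ⟨r₀, rfl, isOpen_interior, fun _ _ => rfl, ?_, ?_⟩
  · rw [value_constOneRep, value_eq_toReal_volume r hr]
    congr 1
    exact measure_eq_measure_of_null_sdiff interior_subset hnull
  · have : KZ.of r - KZ.of r₀ = (KZ.of r - KZ.of r₀ - KZ.of r₁) + KZ.of r₁ := by abel
    show KZ.of r - KZ.of r₀ ∈ KZ.relations
    rw [this]
    exact KZ.relations.add_mem h1a h1

/-- The crux restricted to OPEN domains (and literal integrand `1`). -/
def PlanarAreasOpen : Prop :=
  ∀ (r r' : KZ.IntegralRep 2), IsOpen r.domain → IsOpen r'.domain →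
    (∀ p ∈ r.domain, r.integrand p = 1) → (∀ p ∈ r'.domain, r'.integrand p = 1) →
    r.value = r'.value → KZ.Equivalent r r'

/-- **Reduction to open regions**: the crux is equivalent to its restriction to open
finite-area `ℚ`-semialgebraic planar sets. -/
theorem planarAreas_iff_open : PlanarAreas ↔ PlanarAreasOpen := by
  constructor
  · intro h r r' _ _ hr hr' hv
    exact h r r' hr hr' hv
  · intro h r r' hr hr' hv
    obtain ⟨r₀, -, ho, hr₀, hv₀, he⟩ := equivalent_interiorRep r hr
    obtain ⟨r₀', -, ho', hr₀', hv₀', he'⟩ := equivalent_interiorRep r' hr'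
    have := h r₀ r₀' ho ho' hr₀ hr₀' (by rw [hv₀, hv₀', hv])
    exact (he.trans this).trans he'.symm

/-! ## §5 The dimension-1 sector and the sharpest candidate pair

`PlanarAreas` implies Conjecture 1 for any two ONE-dimensional representations with non-negative
integrands and equal values: lift both under their graphs by one Newton–Leibniz move each
(`KZ.exists_underGraph`, tree) and compare the two planar regions.  So every equal-value pair of
non-negative 1-dimensional representations is a TARGET FOR BOTH SIDES (a chain proves an instance,
a separating invariant refutes the crux and the summit); the sharpest on record is route
FermatIsogeny's `IsogenyLinearNinth` (stmt-3896): `B(5/9,7/9) = (8/3)·3^{1/6}·sin(π/9)·B(5/9,8/9)`,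
a CM relation on the Fermat curve `F₉` induced by a correspondence, not by automorphisms. -/

/-- **`PlanarAreas` decides the non-negative dimension-1 sector**: two 1-dimensional representations
with non-negative integrands and equal values are equivalent (both are one Newton–Leibniz move away
from the integrand-`1` regions under their graphs). -/
theorem equivalent_dim_one_of_planarAreas (h : PlanarAreas) {r r' : KZ.IntegralRep 1}
    (h0 : ∀ x ∈ r.domain, 0 ≤ r.integrand x) (h0' : ∀ x ∈ r'.domain, 0 ≤ r'.integrand x)
    (hv : r.value = r'.value) : KZ.Equivalent r r' := by
  obtain ⟨G, -, hGi, hG⟩ := KZ.exists_underGraph r h0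
  obtain ⟨G', -, hGi', hG'⟩ := KZ.exists_underGraph r' h0'
  have hGr : KZ.Equivalent G r := KZ.newtonLeibnizRel_subset_relations hG
  have hGr' : KZ.Equivalent G' r' := KZ.newtonLeibnizRel_subset_relations hG'
  have hvG : G.value = G'.value := by
    rw [KZ.Equivalent.value_eq_holds hGr, KZ.Equivalent.value_eq_holds hGr', hv]
  have hGG' : KZ.Equivalent G G' :=
    h G G' (fun p _ => by rw [hGi]) (fun p _ => by rw [hGi']) hvG
  exact (hGr.symm.trans hGG').trans hGr'

/-- Hence a NON-equivalent equal-value pair of non-negative 1-dimensional representations refutes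
the crux (and the summit). -/
theorem not_planarAreas_of_dim_one {r r' : KZ.IntegralRep 1}
    (h0 : ∀ x ∈ r.domain, 0 ≤ r.integrand x) (h0' : ∀ x ∈ r'.domain, 0 ≤ r'.integrand x)
    (hv : r.value = r'.value) (hne : ¬ KZ.Equivalent r r') : ¬ PlanarAreas :=
  fun h => hne (equivalent_dim_one_of_planarAreas h h0 h0' hv)

/-- **The sharpest candidate pair, formally**: `PlanarAreas` together with the Beta identity
`B(5/9,7/9) = (8/3)·3^{1/6}·sin(π/9)·B(5/9,8/9)` (stated as equality of the values of the two
representations of stmt-3896) implies route FermatIsogeny's crux `IsogenyLinearNinth`; read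
contrapositively, an invariant separating these two Beta integrals kills `PlanarAreas`. -/
theorem isogenyLinearNinth_of_planarAreas (h : PlanarAreas)
    (hB : ∀ (r r' : KZ.IntegralRep 1), r.domain = {x | x 0 ∈ Set.Ioo (0:ℝ) 1} →
      Set.EqOn r.integrand (fun x => (x 0) ^ (-(4:ℝ)/9) * (1 - x 0) ^ (-(2:ℝ)/9)) r.domain →
      r'.domain = {x | x 0 ∈ Set.Ioo (0:ℝ) 1} →
      Set.EqOn r'.integrand (fun x => (8/3 : ℝ) * (3:ℝ) ^ ((1:ℝ)/6) * Real.sin (Real.pi / 9) *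
        (x 0) ^ (-(1:ℝ)/9) * (1 - x 0) ^ (-(4:ℝ)/9)) r'.domain →
      r.value = r'.value) :
    Summit.KontsevichZagierPeriods.KontsevichZagierPeriods.Theses.FermatIsogeny.IsogenyLinearNinth := by
  intro r r' hr hri hr' hri'
  have hsin : 0 < Real.sin (Real.pi / 9) :=
    Real.sin_pos_of_pos_of_lt_pi (by positivity) (by linarith [Real.pi_pos])
  refine equivalent_dim_one_of_planarAreas h (fun x hx => ?_) (fun x hx => ?_)
    (hB r r' hr hri hr' hri')
  · have hx' : x 0 ∈ Set.Ioo (0:ℝ) 1 := by rw [hr] at hx; exact hx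
    rw [hri hx]
    exact mul_nonneg (Real.rpow_nonneg hx'.1.le _) (Real.rpow_nonneg (by linarith [hx'.2]) _)
  · have hx' : x 0 ∈ Set.Ioo (0:ℝ) 1 := by rw [hr'] at hx; exact hx
    rw [hri' hx]
    refine mul_nonneg (mul_nonneg ?_ (Real.rpow_nonneg hx'.1.le _))
      (Real.rpow_nonneg (by linarith [hx'.2]) _)
    exact mul_nonneg (mul_nonneg (by norm_num) (Real.rpow_nonneg (by norm_num) _)) hsin.le

/-! ## §3c Rule 2 is load-bearing: the change-of-variables-free sub-calculus

The FIRST-COORDINATE WINDOW invariant `Λₑ := KZ.restrictedEval (win e)` (integrate each generator of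
dimension `≥ 1` over `domain ∩ {x₀ < e}`, kill dimension `0`) vanishes on the additivity moves and
on every Newton–Leibniz move between dimensions `n + 2 → n + 1` (the window does not constrain the
last coordinate), while a Newton–Leibniz move `1 → 0` contributes a SEMIALGEBRAIC function of `e`
(a clamped primitive).  Hence for any chain of rules 1a/1b/3, `e ↦ Λₑ([r] − [r'])` is semialgebraic
up to an additive constant; for the hyperbola region `R = {1<x<2, 0<y<1/x}` against its translate
`R + (3,0)` it is `log e` on `[1,2]` — contradicting the tree's barrier fact
`noSemialgebraicPrimitive_inv_sub_two` (no semialgebraic primitive of `1/(t−2)`).  So the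
sub-calculus WITHOUT rule 2 does not prove the crux: every chain for `PlanarAreas` contains a
change of variables (a coordinate swap already suffices to repair this particular pair: Cavalieri
in `y`). -/

/-- Windows on the first coordinate: `{x | x 0 < e}` in dimension `≥ 1`, `∅` in dimension `0`. -/
def win (e : ℝ) : (n : ℕ) → Set (Fin n → ℝ)
  | 0 => ∅
  | _ + 1 => {x | x 0 < e}

/-- There is no window in dimension `0`. -/
@[simp] theorem win_zero (e : ℝ) : win e 0 = ∅ := rfl

/-- Membership in a window: the first coordinate is `< e`. -/
@[simp] theorem mem_win_succ {e : ℝ} {n : ℕ} {x : Fin (n + 1) → ℝ} : x ∈ win e (n + 1) ↔ x 0 < e :=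
  Iff.rfl

/-- Windows are measurable. -/
theorem measurableSet_win (e : ℝ) : ∀ n, MeasurableSet (win e n)
  | 0 => MeasurableSet.empty
  | _ + 1 => measurableSet_lt (measurable_pi_apply 0) measurable_const

/-- Appending a last coordinate does not change the first one (dimension `≥ 1`). -/
theorem snoc_apply_zero {k : ℕ} (x : Fin (k + 1) → ℝ) (t : ℝ) :
    (Fin.snoc x t : Fin (k + 1 + 1) → ℝ) 0 = x 0 := by
  have h : (0 : Fin (k + 1 + 1)) = Fin.castSucc (0 : Fin (k + 1)) := rfl
  rw [h]
  exact Fin.snoc_castSucc (α := fun _ => ℝ) (p := x) (x := t) (i := 0)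

/-- **Newton–Leibniz moves `n + 2 → n + 1` preserve every first-coordinate window value**
(the windowed version of the soundness computation `KZ.eval_eq_zero_of_mem_newtonLeibnizRel_holds`:
Fubini along the last coordinate, the window riding on the base). -/
theorem restrictedEval_win_nl_succ (e : ℝ) {k : ℕ} (r : KZ.IntegralRep (k + 1 + 1))
    (r' : KZ.IntegralRep (k + 1)) (a b : (Fin (k + 1) → ℝ) → ℝ) (F : (Fin (k + 1 + 1) → ℝ) → ℝ)
    (hab : ∀ x ∈ r'.domain, a x ≤ b x)
    (hdom : r.domain = {z | (Fin.init z : Fin (k + 1) → ℝ) ∈ r'.domain ∧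
      a (Fin.init z) ≤ z (Fin.last (k + 1)) ∧ z (Fin.last (k + 1)) ≤ b (Fin.init z)})
    (hcont : ∀ x ∈ r'.domain, ContinuousOn (fun t : ℝ => F (Fin.snoc x t)) (Icc (a x) (b x)))
    (hderiv : ∀ x ∈ r'.domain, ∀ t ∈ Ioo (a x) (b x),
      HasDerivAt (fun s : ℝ => F (Fin.snoc x s)) (r.integrand (Fin.snoc x t)) t)
    (hr' : ∀ x ∈ r'.domain, r'.integrand x = F (Fin.snoc x (b x)) - F (Fin.snoc x (a x))) :
    KZ.restrictedEval (win e) (KZ.of r - KZ.of r') = 0 := by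
  simp only [map_sub, KZ.restrictedEval_of, sub_eq_zero]
  have hτm : MeasurableSet r'.domain := KZ.IntegralRep.measurableSet_domain_holds r'
  have hbm : MeasurableSet r.domain := KZ.IntegralRep.measurableSet_domain_holds r
  have hW2 : MeasurableSet (win e (k + 1 + 1)) := measurableSet_win e _
  have hW1 : MeasurableSet (win e (k + 1)) := measurableSet_win e _
  set E : (Fin (k + 1 + 1) → ℝ) ≃ᵐ ℝ × (Fin (k + 1) → ℝ) :=
    MeasurableEquiv.piFinSuccAbove (fun _ => ℝ) (Fin.last (k + 1)) with hE_def
  have hE : MeasurePreserving E volume volume :=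
    volume_preserving_piFinSuccAbove (fun _ => ℝ) (Fin.last (k + 1))
  have hE_symm : ∀ p : ℝ × (Fin (k + 1) → ℝ), E.symm p = Fin.snoc p.2 p.1 := fun p => by
    simp [hE_def, MeasurableEquiv.piFinSuccAbove, Fin.snocEquiv]
  have hmem : ∀ x t, (Fin.snoc x t : Fin (k + 1 + 1) → ℝ) ∈ r.domain ∩ win e (k + 1 + 1) ↔
      x ∈ r'.domain ∩ win e (k + 1) ∧ t ∈ Icc (a x) (b x) := by
    intro x t
    rw [hdom]
    simp only [mem_inter_iff, mem_setOf_eq, Fin.init_snoc, Fin.snoc_last, mem_Icc, mem_win_succ,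
      snoc_apply_zero]
    tauto
  set G : (Fin (k + 1 + 1) → ℝ) → ℝ := (r.domain ∩ win e (k + 1 + 1)).indicator r.integrand
    with hG_def
  have hG : Integrable G :=
    (integrable_indicator_iff (hbm.inter hW2)).mpr (r.integrableOn.mono_set inter_subset_left)
  have hfib_in : ∀ x ∈ r'.domain ∩ win e (k + 1), (fun t => G (Fin.snoc x t)) =
      (Icc (a x) (b x)).indicator (fun t => r.integrand (Fin.snoc x t)) := by
    intro x hx
    ext t
    by_cases ht : t ∈ Icc (a x) (b x)
    · rw [Set.indicator_of_mem ht, hG_def, Set.indicator_of_mem ((hmem x t).2 ⟨hx, ht⟩)]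
    · rw [Set.indicator_of_notMem ht, hG_def,
        Set.indicator_of_notMem (fun h => ht ((hmem x t).1 h).2)]
  have hfib_out : ∀ x ∉ r'.domain ∩ win e (k + 1), (fun t => G (Fin.snoc x t)) = fun _ => 0 := by
    intro x hx
    ext t
    rw [hG_def, Set.indicator_of_notMem (fun h => hx ((hmem x t).1 h).1)]
  have hG2 : Integrable (fun p : ℝ × (Fin (k + 1) → ℝ) => G (Fin.snoc p.2 p.1))
      ((volume : Measure ℝ).prod (volume : Measure (Fin (k + 1) → ℝ))) := by
    have h := ((hE.symm E).integrable_comp_emb E.symm.measurableEmbedding (g := G)).mpr hG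
    rw [← Measure.volume_eq_prod]
    convert h using 1
    ext p
    simp [hE_symm]
  calc ∫ z in r.domain ∩ win e (k + 1 + 1), r.integrand z
      = ∫ z, G z := (integral_indicator (hbm.inter hW2)).symm
    _ = ∫ p, G (E.symm p) := ((hE.symm E).integral_comp' G).symm
    _ = ∫ p : ℝ × (Fin (k + 1) → ℝ), G (Fin.snoc p.2 p.1) ∂(volume.prod volume) := by
        simp_rw [hE_symm, Measure.volume_eq_prod]
    _ = ∫ x, ∫ t, G (Fin.snoc x t) := integral_prod_symm _ hG2
    _ = ∫ x, (r'.domain ∩ win e (k + 1)).indicator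
          (fun x => F (Fin.snoc x (b x)) - F (Fin.snoc x (a x))) x := by
        apply integral_congr_ae
        filter_upwards [hG2.prod_left_ae] with x hx
        by_cases hxτ : x ∈ r'.domain ∩ win e (k + 1)
        · rw [Set.indicator_of_mem hxτ, hfib_in x hxτ, integral_indicator measurableSet_Icc,
            integral_Icc_eq_integral_Ioc, ← intervalIntegral.integral_of_le (hab x hxτ.1)]
          apply intervalIntegral.integral_eq_sub_of_hasDerivAt_of_le (hab x hxτ.1) (hcont x hxτ.1)
            (hderiv x hxτ.1)
          rw [intervalIntegrable_iff_integrableOn_Icc_of_le (hab x hxτ.1)]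
          have hx' : Integrable (fun t => G (Fin.snoc x t)) := hx
          rw [hfib_in x hxτ] at hx'
          exact (integrable_indicator_iff measurableSet_Icc).mp hx'
        · rw [Set.indicator_of_notMem hxτ, hfib_out x hxτ, integral_zero]
    _ = ∫ x in r'.domain ∩ win e (k + 1), (F (Fin.snoc x (b x)) - F (Fin.snoc x (a x))) :=
        integral_indicator (hτm.inter hW1)
    _ = ∫ x in r'.domain ∩ win e (k + 1), r'.integrand x :=
        (setIntegral_congr_fun (hτm.inter hW1) fun x hx => hr' x hx.1).symm

/-! ### The `1 → 0` Newton–Leibniz defect is a clamped primitive, hence semialgebraic in `e` -/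

/-- One-variable bookkeeping: integrating a derivative over `[a₀, b₀] ∩ (−∞, e)` gives the
primitive at the clamped point `max a₀ (min e b₀)`. -/
theorem setIntegral_clamp {a₀ b₀ : ℝ} (hab : a₀ ≤ b₀) {f g : ℝ → ℝ}
    (hcont : ContinuousOn f (Icc a₀ b₀)) (hderiv : ∀ t ∈ Ioo a₀ b₀, HasDerivAt f (g t) t)
    (hint : IntegrableOn g (Icc a₀ b₀)) (e : ℝ) :
    ∫ t in {t | a₀ ≤ t ∧ t ≤ b₀ ∧ t < e}, g t = f (max a₀ (min e b₀)) - f a₀ := by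
  rcases le_or_gt e a₀ with hea | hea
  · -- empty range
    have hset : {t | a₀ ≤ t ∧ t ≤ b₀ ∧ t < e} = ∅ := by
      ext t
      simp only [mem_setOf_eq, mem_empty_iff_false, iff_false, not_and, not_lt]
      intro h1 _
      exact hea.trans h1
    have hc : max a₀ (min e b₀) = a₀ := max_eq_left ((min_le_left e b₀).trans hea)
    rw [hset, Measure.restrict_empty, integral_zero_measure, hc, sub_self]
  · set c := min e b₀ with hc_def
    have hac : a₀ ≤ c := le_min hea.le hab
    have hcb : c ≤ b₀ := min_le_right e b₀
    have hmax : max a₀ (min e b₀) = c := max_eq_right hac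
    rw [hmax]
    -- FTC on `[a₀, c]`
    have hftc : ∫ t in a₀..c, g t = f c - f a₀ := by
      apply intervalIntegral.integral_eq_sub_of_hasDerivAt_of_le hac
        (hcont.mono (Icc_subset_Icc_right hcb))
        (fun t ht => hderiv t ⟨ht.1, ht.2.trans_le hcb⟩)
      rw [intervalIntegrable_iff_integrableOn_Icc_of_le hac]
      exact hint.mono_set (Icc_subset_Icc_right hcb)
    rw [← hftc, intervalIntegral.integral_of_le hac]
    rcases lt_or_ge b₀ e with hbe | hbe
    · -- the whole band: `{…} = Icc a₀ b₀`, `c = b₀`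
      have hcb' : c = b₀ := min_eq_right hbe.le
      have hset : {t | a₀ ≤ t ∧ t ≤ b₀ ∧ t < e} = Icc a₀ b₀ := by
        ext t
        simp only [mem_setOf_eq, mem_Icc]
        exact ⟨fun h => ⟨h.1, h.2.1⟩, fun h => ⟨h.1, h.2, h.2.trans_lt hbe⟩⟩
      rw [hset, hcb', integral_Icc_eq_integral_Ioc]
    · -- `c = e ≤ b₀`: `{…} = Ico a₀ e`
      have hce : c = e := min_eq_left hbe
      have hset : {t | a₀ ≤ t ∧ t ≤ b₀ ∧ t < e} = Ico a₀ e := by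
        ext t
        simp only [mem_setOf_eq, mem_Ico]
        exact ⟨fun h => ⟨h.1, h.2.2⟩, fun h => ⟨h.1, h.2.le.trans hbe, h.2⟩⟩
      rw [hset, hce, integral_Ico_eq_integral_Ioc]

/-- The value of a `ℚ`-semialgebraic function on the point `ℝ⁰` is `ℚ`-definable:
`{y : ℝ¹ | y 0 = a x₀}` is `ℚ`-semialgebraic. -/
theorem isSemialgebraic_setOf_apply_eq_of_fin_zero {τ : Set (Fin 0 → ℝ)} {a : (Fin 0 → ℝ) → ℝ}
    (ha : IsSemialgebraicFunOn ℚ τ a) {x₀ : Fin 0 → ℝ} (hx₀ : x₀ ∈ τ) :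
    IsSemialgebraic ℚ {y : Fin 1 → ℝ | y 0 = a x₀} := by
  rw [isSemialgebraicFunOn_iff] at ha
  convert ha using 1
  ext y
  simp only [mem_setOf_eq]
  have h1 : (Fin.init y : Fin 0 → ℝ) = x₀ := Subsingleton.elim _ _
  have h2 : (Fin.last 0 : Fin (0 + 1)) = 0 := rfl
  rw [h1, h2]
  exact ⟨fun h => ⟨hx₀, h⟩, fun h => h.2⟩

/-- `{y | y 0 ≤ c}` is `ℚ`-semialgebraic as soon as `{y | y 0 = c}` is (projection of
`{u | u 1 = c ∧ u 0 ≤ u 1}`: Tarski–Seidenberg). -/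
theorem isSemialgebraic_setOf_apply_le_of_eq {c : ℝ}
    (h : IsSemialgebraic ℚ {y : Fin 1 → ℝ | y 0 = c}) :
    IsSemialgebraic ℚ {y : Fin 1 → ℝ | y 0 ≤ c} := by
  have hT : IsSemialgebraic ℚ (((fun u : Fin (1 + 1) → ℝ => u ∘ fun _ : Fin 1 => (1 : Fin (1 + 1))) ⁻¹'
      {y : Fin 1 → ℝ | y 0 = c}) ∩
      {u : Fin (1 + 1) → ℝ | aeval u (X 0 : MvPolynomial (Fin (1 + 1)) ℚ) ≤ aeval u (X 1)}) :=
    (h.preimage_comp _).inter (isSemialgebraic_setOf_eval_le _ _)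
  convert tarski_seidenberg_real_holds hT using 1
  ext y
  simp only [mem_setOf_eq, mem_image, mem_inter_iff, mem_preimage, Function.comp_def,
    MvPolynomial.aeval_X]
  constructor
  · intro hy
    refine ⟨Fin.snoc y c, ⟨?_, ?_⟩, ?_⟩
    · show (Fin.snoc y c : Fin (1 + 1) → ℝ) (Fin.last 1) = c
      exact Fin.snoc_last _ _
    · show (Fin.snoc y c : Fin (1 + 1) → ℝ) (Fin.castSucc 0) ≤ (Fin.snoc y c : Fin (1 + 1) → ℝ) (Fin.last 1)
      rw [Fin.snoc_castSucc, Fin.snoc_last]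
      exact hy
    · funext i
      show (Fin.snoc y c : Fin (1 + 1) → ℝ) (Fin.castSucc i) = y i
      simp
  · rintro ⟨u, ⟨hu1, hu01⟩, rfl⟩
    have : u (Fin.castSucc 0) ≤ u 1 := hu01
    rw [hu1] at this
    exact this

/-- `{y | y 0 < c}` is `ℚ`-semialgebraic as soon as `{y | y 0 = c}` is. -/
theorem isSemialgebraic_setOf_apply_lt_of_eq {c : ℝ}
    (h : IsSemialgebraic ℚ {y : Fin 1 → ℝ | y 0 = c}) :
    IsSemialgebraic ℚ {y : Fin 1 → ℝ | y 0 < c} := by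
  have hT : IsSemialgebraic ℚ (((fun u : Fin (1 + 1) → ℝ => u ∘ fun _ : Fin 1 => (1 : Fin (1 + 1))) ⁻¹'
      {y : Fin 1 → ℝ | y 0 = c}) ∩
      {u : Fin (1 + 1) → ℝ | aeval u (X 0 : MvPolynomial (Fin (1 + 1)) ℚ) < aeval u (X 1)}) :=
    (h.preimage_comp _).inter (isSemialgebraic_setOf_eval_lt _ _)
  convert tarski_seidenberg_real_holds hT using 1
  ext y
  simp only [mem_setOf_eq, mem_image, mem_inter_iff, mem_preimage, Function.comp_def,
    MvPolynomial.aeval_X]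
  constructor
  · intro hy
    refine ⟨Fin.snoc y c, ⟨?_, ?_⟩, ?_⟩
    · show (Fin.snoc y c : Fin (1 + 1) → ℝ) (Fin.last 1) = c
      exact Fin.snoc_last _ _
    · show (Fin.snoc y c : Fin (1 + 1) → ℝ) (Fin.castSucc 0) < (Fin.snoc y c : Fin (1 + 1) → ℝ) (Fin.last 1)
      rw [Fin.snoc_castSucc, Fin.snoc_last]
      exact hy
    · funext i
      show (Fin.snoc y c : Fin (1 + 1) → ℝ) (Fin.castSucc i) = y i
      simp
  · rintro ⟨u, ⟨hu1, hu01⟩, rfl⟩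
    have : u (Fin.castSucc 0) < u 1 := hu01
    rw [hu1] at this
    exact this

/-- The clamp `e ↦ max a₀ (min e b₀)` is a `ℚ`-semialgebraic function of `e` when `a₀ ≤ b₀` are
`ℚ`-definable. -/
theorem isSemialgebraicFunOn_clamp {a₀ b₀ : ℝ} (hab : a₀ ≤ b₀)
    (ha : IsSemialgebraic ℚ {y : Fin 1 → ℝ | y 0 = a₀})
    (hb : IsSemialgebraic ℚ {y : Fin 1 → ℝ | y 0 = b₀}) :
    IsSemialgebraicFunOn ℚ (univ : Set (Fin 1 → ℝ)) (fun z => max a₀ (min (z 0) b₀)) := by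
  rw [isSemialgebraicFunOn_iff]
  -- pull the one-variable pieces back to `ℝ²` along `w ↦ w 0` and `w ↦ w 1`
  have p0 : ∀ {s : Set (Fin 1 → ℝ)}, IsSemialgebraic ℚ s →
      IsSemialgebraic ℚ {w : Fin (1 + 1) → ℝ | (fun _ : Fin 1 => w 0) ∈ s} :=
    fun hs => hs.preimage_comp (fun _ : Fin 1 => (0 : Fin (1 + 1)))
  have p1 : ∀ {s : Set (Fin 1 → ℝ)}, IsSemialgebraic ℚ s →
      IsSemialgebraic ℚ {w : Fin (1 + 1) → ℝ | (fun _ : Fin 1 => w 1) ∈ s} :=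
    fun hs => hs.preimage_comp (fun _ : Fin 1 => (1 : Fin (1 + 1)))
  have hle_a := isSemialgebraic_setOf_apply_le_of_eq ha   -- {y | y 0 ≤ a₀}
  have hlt_b := isSemialgebraic_setOf_apply_lt_of_eq hb   -- {y | y 0 < b₀}
  have hdiag : IsSemialgebraic ℚ {w : Fin (1 + 1) → ℝ |
      aeval w (X 1 : MvPolynomial (Fin (1 + 1)) ℚ) = aeval w (X 0 : MvPolynomial (Fin (1 + 1)) ℚ)} := by
    have := isSemialgebraic_setOf_eval_eq_zero (k := ℚ) (R := ℝ) (ι := Fin (1 + 1)) (X 1 - X 0)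
    convert this using 2 with w
    simp [sub_eq_zero]
  have hS : IsSemialgebraic ℚ
      (({w : Fin (1 + 1) → ℝ | (fun _ : Fin 1 => w 0) ∈ {y : Fin 1 → ℝ | y 0 ≤ a₀}} ∩
        {w : Fin (1 + 1) → ℝ | (fun _ : Fin 1 => w 1) ∈ {y : Fin 1 → ℝ | y 0 = a₀}}) ∪
      (({w : Fin (1 + 1) → ℝ | (fun _ : Fin 1 => w 0) ∈ {y : Fin 1 → ℝ | y 0 ≤ a₀}}ᶜ ∩
        {w : Fin (1 + 1) → ℝ | (fun _ : Fin 1 => w 0) ∈ {y : Fin 1 → ℝ | y 0 < b₀}}) ∩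
        {w : Fin (1 + 1) → ℝ | aeval w (X 1 : MvPolynomial (Fin (1 + 1)) ℚ) = aeval w (X 0 : MvPolynomial (Fin (1 + 1)) ℚ)}) ∪
      ({w : Fin (1 + 1) → ℝ | (fun _ : Fin 1 => w 0) ∈ {y : Fin 1 → ℝ | y 0 < b₀}}ᶜ ∩
        {w : Fin (1 + 1) → ℝ | (fun _ : Fin 1 => w 1) ∈ {y : Fin 1 → ℝ | y 0 = b₀}})) :=
    (((p0 hle_a).inter (p1 ha)).union (((p0 hle_a).compl.inter (p0 hlt_b)).inter hdiag)).union
      ((p0 hlt_b).compl.inter (p1 hb))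
  convert hS using 1
  ext w
  simp only [mem_setOf_eq, mem_univ, true_and, mem_union, mem_inter_iff, mem_compl_iff, not_le,
    not_lt, MvPolynomial.aeval_X]
  have h0 : (Fin.init w : Fin 1 → ℝ) 0 = w 0 := rfl
  have hl : (Fin.last 1 : Fin (1 + 1)) = 1 := rfl
  rw [h0, hl]
  constructor
  · intro hw
    rcases le_or_gt (w 0) a₀ with h1 | h1
    · left; left
      refine ⟨h1, ?_⟩
      rw [hw, min_eq_left (h1.trans hab), max_eq_left h1]
    · rcases lt_or_ge (w 0) b₀ with h2 | h2
      · left; right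
        refine ⟨⟨h1, h2⟩, ?_⟩
        rw [hw, min_eq_left h2.le, max_eq_right h1.le]
      · right
        refine ⟨h2, ?_⟩
        rw [hw, min_eq_right h2, max_eq_right hab]
  · rintro ((⟨h1, h2⟩ | ⟨⟨h1, h2⟩, h3⟩) | ⟨h1, h2⟩)
    · rw [h2, min_eq_left (h1.trans hab), max_eq_left h1]
    · rw [h3, min_eq_left h2.le, max_eq_right h1.le]
    · rw [h2, min_eq_right h1, max_eq_right hab]

/-- **The `1 → 0` defect.** For a Newton–Leibniz move from dimension `1` to dimension `0`, the
window value `e ↦ Λₑ([r] − [r'])` is a `ℚ`-semialgebraic function of `e` plus a constant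
(the clamped primitive `F(max a₀ (min e b₀)) − F(a₀)`; zero if the base is empty). -/
theorem nl_zero_defect (r : KZ.IntegralRep (0 + 1)) (r' : KZ.IntegralRep 0)
    (a b : (Fin 0 → ℝ) → ℝ) (F : (Fin (0 + 1) → ℝ) → ℝ)
    (hF : IsSemialgebraicFunOn ℚ r.domain F)
    (ha : IsSemialgebraicFunOn ℚ r'.domain a) (hb : IsSemialgebraicFunOn ℚ r'.domain b)
    (hab : ∀ x ∈ r'.domain, a x ≤ b x)
    (hdom : r.domain = {z | (Fin.init z : Fin 0 → ℝ) ∈ r'.domain ∧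
      a (Fin.init z) ≤ z (Fin.last 0) ∧ z (Fin.last 0) ≤ b (Fin.init z)})
    (hcont : ∀ x ∈ r'.domain, ContinuousOn (fun t : ℝ => F (Fin.snoc x t)) (Icc (a x) (b x)))
    (hderiv : ∀ x ∈ r'.domain, ∀ t ∈ Ioo (a x) (b x),
      HasDerivAt (fun s : ℝ => F (Fin.snoc x s)) (r.integrand (Fin.snoc x t)) t) :
    ∃ (Φ : ℝ → ℝ) (C : ℝ), IsSemialgebraicFunOn ℚ (univ : Set (Fin 1 → ℝ)) (fun z => Φ (z 0)) ∧
      ∀ e, KZ.restrictedEval (win e) (KZ.of r - KZ.of r') = Φ e + C := by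
  have hzero : ∀ e, KZ.restrictedEval (win e) (KZ.of r') = 0 := fun e => by
    rw [KZ.restrictedEval_of, win_zero, inter_empty, Measure.restrict_empty, integral_zero_measure]
  by_cases hτ : r'.domain = ∅
  · -- empty base: empty band, zero defect
    have hr : r.domain = ∅ := by
      rw [hdom]; ext z; simp [hτ]
    refine ⟨fun _ => 0, 0, by simpa using isSemialgebraicFunOn_natCast isSemialgebraic_univ 0, ?_⟩
    intro e
    rw [map_sub, hzero, KZ.restrictedEval_of, hr, empty_inter, Measure.restrict_empty,
      integral_zero_measure]
    simp
  · obtain ⟨x₀, hx₀⟩ := nonempty_iff_ne_empty.mpr hτ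
    have hall : ∀ x : Fin 0 → ℝ, x = x₀ := fun x => Subsingleton.elim _ _
    set a₀ := a x₀ with ha₀
    set b₀ := b x₀ with hb₀
    have hab₀ : a₀ ≤ b₀ := hab x₀ hx₀
    have hsnoc : ∀ t : ℝ, (Fin.snoc x₀ t : Fin (0 + 1) → ℝ) = fun _ => t := by
      intro t
      funext i
      have hi : i = Fin.last 0 := Fin.ext (by have := i.isLt; simp only [Fin.val_last]; omega)
      rw [hi]
      exact Fin.snoc_last _ _
    have hdom' : r.domain = {z : Fin (0 + 1) → ℝ | a₀ ≤ z 0 ∧ z 0 ≤ b₀} := by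
      rw [hdom]
      ext z
      simp only [mem_setOf_eq]
      have h1 : (Fin.init z : Fin 0 → ℝ) = x₀ := hall _
      have h2 : (Fin.last 0 : Fin (0 + 1)) = 0 := rfl
      rw [h1, h2]
      exact ⟨fun h => ⟨h.2.1, h.2.2⟩, fun h => ⟨hx₀, h.1, h.2⟩⟩
    -- the defect as a clamped primitive
    let f : ℝ → ℝ := fun t => F (fun _ => t)
    let g : ℝ → ℝ := fun t => r.integrand (fun _ => t)
    have hcont₀ : ContinuousOn f (Icc a₀ b₀) := by
      have := hcont x₀ hx₀
      simp_rw [hsnoc] at this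
      exact this
    have hderiv₀ : ∀ t ∈ Ioo a₀ b₀, HasDerivAt f (g t) t := by
      intro t ht
      have := hderiv x₀ hx₀ t ht
      simp_rw [hsnoc] at this
      exact this
    -- transfer integrals along `ℝ ≃ ℝ¹`
    set φ : ℝ → (Fin 1 → ℝ) := fun t _ => t with hφ_def
    have hφeq : φ = ⇑(MeasurableEquiv.funUnique (Fin 1) ℝ).symm := by
      funext t i
      show t = uniqueElim (α := fun _ : Fin 1 => ℝ) t i
      exact (uniqueElim_const t i).symm
    have hφ : MeasurePreserving φ volume volume := by
      rw [hφeq]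
      exact (volume_preserving_funUnique (Fin 1) ℝ).symm _
    have hφemb : MeasurableEmbedding φ := by
      rw [hφeq]
      exact (MeasurableEquiv.funUnique (Fin 1) ℝ).symm.measurableEmbedding
    have hint₀ : IntegrableOn g (Icc a₀ b₀) := by
      have h := (hφ.integrableOn_comp_preimage hφemb (f := r.integrand) (s := r.domain)).mpr
        r.integrableOn
      have hpre : φ ⁻¹' r.domain = Icc a₀ b₀ := by
        rw [hdom']; ext t; simp [hφ_def]
      rw [hpre] at h
      exact h
    have hval : ∀ e, KZ.restrictedEval (win e) (KZ.of r) = f (max a₀ (min e b₀)) - f a₀ := by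
      intro e
      have hpre : φ ⁻¹' (r.domain ∩ win e (0 + 1)) = {t | a₀ ≤ t ∧ t ≤ b₀ ∧ t < e} := by
        rw [hdom']
        ext t
        simp [hφ_def, and_assoc]
      have h1 : ∫ z in r.domain ∩ win e (0 + 1), r.integrand z =
          ∫ t in {t | a₀ ≤ t ∧ t ≤ b₀ ∧ t < e}, g t := by
        rw [← hφ.setIntegral_preimage_emb hφemb, hpre]
      rw [KZ.restrictedEval_of, h1, setIntegral_clamp hab₀ hcont₀ hderiv₀ hint₀ e]
    -- semialgebraicity of `e ↦ F(clamp e)`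
    have hDa : IsSemialgebraic ℚ {y : Fin 1 → ℝ | y 0 = a₀} :=
      isSemialgebraic_setOf_apply_eq_of_fin_zero ha hx₀
    have hDb : IsSemialgebraic ℚ {y : Fin 1 → ℝ | y 0 = b₀} :=
      isSemialgebraic_setOf_apply_eq_of_fin_zero hb hx₀
    have hclamp := isSemialgebraicFunOn_clamp hab₀ hDa hDb
    have hm : IsSemialgebraicMapOn ℚ (univ : Set (Fin 1 → ℝ))
        (fun z : Fin 1 → ℝ => fun _ : Fin 1 => max a₀ (min (z 0) b₀)) :=
      IsSemialgebraicMapOn.of_forall isSemialgebraic_univ fun _ => hclamp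
    have hmaps : MapsTo (fun z : Fin 1 → ℝ => fun _ : Fin 1 => max a₀ (min (z 0) b₀)) univ
        r.domain := by
      intro z _
      rw [hdom']
      exact ⟨le_max_left _ _, max_le hab₀ (min_le_right _ _)⟩
    have hcomp := IsSemialgebraicFunOn.comp_isSemialgebraicMapOn_holds hF hm hmaps
    refine ⟨fun e => f (max a₀ (min e b₀)), -f a₀, ?_, ?_⟩
    · exact hcomp
    · intro e
      rw [map_sub, hzero, hval, sub_zero, sub_eq_add_neg]

/-! ### Chains of rules 1a/1b/3 have semialgebraic window values -/

/-- `e ↦ Λₑ(c)` is a `ℚ`-semialgebraic function of `e` plus a constant. -/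
def WinSemialgebraic (c : KZ.FormalRep) : Prop :=
  ∃ (Φ : ℝ → ℝ) (C : ℝ), IsSemialgebraicFunOn ℚ (univ : Set (Fin 1 → ℝ)) (fun z => Φ (z 0)) ∧
    ∀ e, KZ.restrictedEval (win e) c = Φ e + C

/-- Vanishing window values are semialgebraic (the zero function). -/
theorem winSemialgebraic_of_eq_zero {c : KZ.FormalRep} (h : ∀ e, KZ.restrictedEval (win e) c = 0) :
    WinSemialgebraic c :=
  ⟨fun _ => 0, 0, by simpa using isSemialgebraicFunOn_natCast isSemialgebraic_univ 0,
    fun e => by simp [h e]⟩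

/-- `0` has semialgebraic window values. -/
theorem winSemialgebraic_zero : WinSemialgebraic 0 :=
  winSemialgebraic_of_eq_zero fun e => by simp

/-- Semialgebraic window values are stable under sums (Tarski–Seidenberg for the sum of two semialgebraic functions). -/
theorem WinSemialgebraic.add {c c' : KZ.FormalRep} (h : WinSemialgebraic c)
    (h' : WinSemialgebraic c') : WinSemialgebraic (c + c') := by
  obtain ⟨Φ, C, hΦ, hc⟩ := h
  obtain ⟨Φ', C', hΦ', hc'⟩ := h'
  refine ⟨fun e => Φ e + Φ' e, C + C', IsSemialgebraicFunOn.add_holds hΦ hΦ', fun e => ?_⟩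
  rw [map_add, hc, hc']
  ring

/-- Semialgebraic window values are stable under negation. -/
theorem WinSemialgebraic.neg {c : KZ.FormalRep} (h : WinSemialgebraic c) : WinSemialgebraic (-c) := by
  obtain ⟨Φ, C, hΦ, hc⟩ := h
  refine ⟨fun e => -Φ e, -C, hΦ.neg, fun e => ?_⟩
  rw [map_neg, hc]
  ring

/-- **The window invariant along the change-of-variables-free sub-calculus**: every element of
`closure (1a ∪ 1b ∪ 3)` has window values semialgebraic in `e` up to a constant. -/
theorem winSemialgebraic_of_mem {c : KZ.FormalRep}
    (hc : c ∈ AddSubgroup.closure (KZ.domainAddRel ∪ KZ.integrandAddRel ∪ KZ.newtonLeibnizRel)) :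
    WinSemialgebraic c := by
  refine AddSubgroup.closure_induction (p := fun x _ => WinSemialgebraic x) (fun x hx => ?_)
    winSemialgebraic_zero (fun x y _ _ hx hy => hx.add hy) (fun x _ hx => hx.neg) hc
  rcases hx with (hx | hx) | hx
  · exact winSemialgebraic_of_eq_zero fun e =>
      KZ.restrictedEval_eq_zero_of_mem_domainAddRel _ (measurableSet_win e) hx
  · exact winSemialgebraic_of_eq_zero fun e =>
      KZ.restrictedEval_eq_zero_of_mem_integrandAddRel _ (measurableSet_win e) hx
  · obtain ⟨n, r, r', a, b, F, hF, ha, hb, hab, hdom, hcont, hderiv, hr', rfl⟩ := hx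
    cases n with
    | zero => exact nl_zero_defect r r' a b F hF ha hb hab hdom hcont hderiv
    | succ k =>
      exact winSemialgebraic_of_eq_zero fun e =>
        restrictedEval_win_nl_succ e r r' a b F hab hdom hcont hderiv hr'

/-! ### The witness pair: the hyperbola region and its horizontal translate -/

/-- `R = {1 < x < 2, 0 < y < 1/x}` (area `log 2`). -/
def hypSet : Set (Fin 2 → ℝ) := {p | 1 < p 0 ∧ p 0 < 2 ∧ 0 < p 1 ∧ p 0 * p 1 < 1}

/-- `R + (3, 0) = {4 < x < 5, 0 < y < 1/(x − 3)}`. -/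
def hypShiftSet : Set (Fin 2 → ℝ) := {p | 4 < p 0 ∧ p 0 < 5 ∧ 0 < p 1 ∧ (p 0 - 3) * p 1 < 1}

/-- The hyperbola region is `ℚ`-semialgebraic (`1 < x < 2`, `0 < y`, `xy < 1`). -/
theorem isSemialgebraic_hypSet : IsSemialgebraic ℚ hypSet := by
  have h0 := isSemialgebraic_setOf_eval_lt (k := ℚ) (R := ℝ) (ι := Fin 2) (C 1) (X 0)
  have h1 := isSemialgebraic_setOf_eval_lt (k := ℚ) (R := ℝ) (ι := Fin 2) (X 0) (C 2)
  have h2 := isSemialgebraic_setOf_eval_lt (k := ℚ) (R := ℝ) (ι := Fin 2) (C 0) (X 1)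
  have h3 := isSemialgebraic_setOf_eval_lt (k := ℚ) (R := ℝ) (ι := Fin 2) (X 0 * X 1) (C 1)
  have hEq : hypSet =
      {x : Fin 2 → ℝ | aeval x (C 1 : MvPolynomial (Fin 2) ℚ) < aeval x (X 0 : MvPolynomial (Fin 2) ℚ)} ∩
      ({x : Fin 2 → ℝ | aeval x (X 0 : MvPolynomial (Fin 2) ℚ) < aeval x (C 2 : MvPolynomial (Fin 2) ℚ)} ∩
      ({x : Fin 2 → ℝ | aeval x (C 0 : MvPolynomial (Fin 2) ℚ) < aeval x (X 1 : MvPolynomial (Fin 2) ℚ)} ∩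
      {x : Fin 2 → ℝ | aeval x (X 0 * X 1 : MvPolynomial (Fin 2) ℚ) < aeval x (C 1 : MvPolynomial (Fin 2) ℚ)})) := by
    ext p
    simp [hypSet]
  rw [hEq]
  exact h0.inter (h1.inter (h2.inter h3))

/-- The translated hyperbola region is `ℚ`-semialgebraic. -/
theorem isSemialgebraic_hypShiftSet : IsSemialgebraic ℚ hypShiftSet := by
  have h0 := isSemialgebraic_setOf_eval_lt (k := ℚ) (R := ℝ) (ι := Fin 2) (C 4) (X 0)
  have h1 := isSemialgebraic_setOf_eval_lt (k := ℚ) (R := ℝ) (ι := Fin 2) (X 0) (C 5)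
  have h2 := isSemialgebraic_setOf_eval_lt (k := ℚ) (R := ℝ) (ι := Fin 2) (C 0) (X 1)
  have h3 := isSemialgebraic_setOf_eval_lt (k := ℚ) (R := ℝ) (ι := Fin 2) ((X 0 - C 3) * X 1) (C 1)
  have hEq : hypShiftSet =
      {x : Fin 2 → ℝ | aeval x (C 4 : MvPolynomial (Fin 2) ℚ) < aeval x (X 0 : MvPolynomial (Fin 2) ℚ)} ∩
      ({x : Fin 2 → ℝ | aeval x (X 0 : MvPolynomial (Fin 2) ℚ) < aeval x (C 5 : MvPolynomial (Fin 2) ℚ)} ∩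
      ({x : Fin 2 → ℝ | aeval x (C 0 : MvPolynomial (Fin 2) ℚ) < aeval x (X 1 : MvPolynomial (Fin 2) ℚ)} ∩
      {x : Fin 2 → ℝ | aeval x ((X 0 - C 3) * X 1 : MvPolynomial (Fin 2) ℚ) < aeval x (C 1 : MvPolynomial (Fin 2) ℚ)})) := by
    ext p
    simp [hypShiftSet]
  rw [hEq]
  exact h0.inter (h1.inter (h2.inter h3))

/-- The translated region is the preimage of `R` under the translation by `(−3, 0)`. -/
theorem hypShiftSet_eq_preimage :
    hypShiftSet = (fun p : Fin 2 → ℝ => (![-3, 0] : Fin 2 → ℝ) + p) ⁻¹' hypSet := by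
  ext p
  simp only [hypShiftSet, hypSet, mem_setOf_eq, mem_preimage, Pi.add_apply, Matrix.cons_val_zero,
    Matrix.cons_val_one]
  constructor
  · rintro ⟨h1, h2, h3, h4⟩
    exact ⟨by linarith, by linarith, by linarith, by nlinarith⟩
  · rintro ⟨h1, h2, h3, h4⟩
    exact ⟨by linarith, by linarith, by linarith, by nlinarith⟩

/-- Translation invariance of Lebesgue measure: `vol(R + (3,0)) = vol(R)`. -/
theorem volume_hypShiftSet : volume hypShiftSet = volume hypSet := by
  rw [hypShiftSet_eq_preimage]
  exact measure_preimage_add _ _ _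

/-- `R` has finite area (it lies in the box `[1,2] × [0,1]`). -/
theorem volume_hypSet_lt_top : volume hypSet < ⊤ := by
  have hsub : hypSet ⊆ Icc (![1, 0] : Fin 2 → ℝ) ![2, 1] := by
    intro p hp
    obtain ⟨h1, h2, h3, h4⟩ := hp
    have h5 : p 1 < 1 := by nlinarith
    rw [mem_Icc, Pi.le_def, Pi.le_def]
    refine ⟨fun i => ?_, fun i => ?_⟩ <;> fin_cases i <;> simp <;> linarith
  exact (measure_mono hsub).trans_lt measure_Icc_lt_top

/-- `[R, 1]`. -/
def hypRep : KZ.IntegralRep 2 :=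
  constOneRep hypSet isSemialgebraic_hypSet volume_hypSet_lt_top.ne

/-- `[R + (3,0), 1]`. -/
def hypShiftRep : KZ.IntegralRep 2 :=
  constOneRep hypShiftSet isSemialgebraic_hypShiftSet
    (by rw [volume_hypShiftSet]; exact volume_hypSet_lt_top.ne)

/-- The domain of `hypRep`. -/
@[simp] theorem hypRep_domain : hypRep.domain = hypSet := rfl

/-- The domain of `hypShiftRep`. -/
@[simp] theorem hypShiftRep_domain : hypShiftRep.domain = hypShiftSet := rfl

/-- The two representations have the same value (equal areas). -/
theorem value_hypRep_eq : hypRep.value = hypShiftRep.value := by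
  rw [hypRep, hypShiftRep, value_constOneRep, value_constOneRep, volume_hypShiftSet]

/-- The translate is invisible in the windows `e ≤ 4`. -/
theorem restrictedEval_win_hypShiftRep {e : ℝ} (he : e ≤ 4) :
    KZ.restrictedEval (win e) (KZ.of hypShiftRep) = 0 := by
  have hempty : hypShiftRep.domain ∩ win e 2 = ∅ := by
    ext p
    simp only [mem_inter_iff, mem_empty_iff_false, iff_false, not_and]
    intro hp hw
    have h1 : 4 < p 0 := hp.1
    have h2 : p 0 < e := hw
    linarith
  rw [KZ.restrictedEval_of, hempty, Measure.restrict_empty, integral_zero_measure]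

/-- The window values of `R`: `vol(R ∩ {x < e}) = log e` for `1 ≤ e ≤ 2` (Fubini over the
hyperbola: `∫₁ᵉ dx/x`). -/
theorem restrictedEval_win_hypRep {e : ℝ} (he : e ∈ Icc (1:ℝ) 2) :
    KZ.restrictedEval (win e) (KZ.of hypRep) = Real.log e := by
  have he1 : (1:ℝ) ≤ e := he.1
  have hepos : 0 < e := by linarith
  -- the windowed region is the region under `1/x` over `(1, e)`
  have hset : hypRep.domain ∩ win e 2 =
      MeasurableEquiv.finTwoArrow ⁻¹' regionBetween (fun _ => 0) (fun x => x⁻¹) (Ioo 1 e) := by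
    ext p
    simp only [mem_inter_iff, mem_preimage, regionBetween, mem_setOf_eq, mem_Ioo,
      MeasurableEquiv.finTwoArrow_apply]
    show (1 < p 0 ∧ p 0 < 2 ∧ 0 < p 1 ∧ p 0 * p 1 < 1) ∧ p 0 < e ↔ _
    constructor
    · rintro ⟨⟨h1, h2, h3, h4⟩, h5⟩
      have h0 : 0 < p 0 := by linarith
      refine ⟨⟨h1, h5⟩, h3, ?_⟩
      rw [lt_inv_comm₀ h3 h0]  -- p 1 < (p 0)⁻¹ ↔ p 0 < (p 1)⁻¹
      rw [lt_inv_comm₀ h0 h3]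
      rw [← one_div, lt_div_iff₀ h0]
      linarith [mul_comm (p 0) (p 1)]
    · rintro ⟨⟨h1, h5⟩, h3, h4⟩
      have h0 : 0 < p 0 := by linarith
      refine ⟨⟨h1, by linarith [he.2], h3, ?_⟩, h5⟩
      rw [← one_div, lt_div_iff₀ h0] at h4
      linarith [mul_comm (p 0) (p 1)]
  have hmeas : MeasurableSet (regionBetween (fun _ => (0:ℝ)) (fun x => x⁻¹) (Ioo 1 e)) :=
    measurableSet_regionBetween measurable_const measurable_inv measurableSet_Ioo
  have hint : IntegrableOn (fun x : ℝ => x⁻¹) (Ioo 1 e) := by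
    have hc : ContinuousOn (fun x : ℝ => x⁻¹) (Icc 1 e) :=
      continuousOn_inv₀.mono fun x hx => by
        simp only [mem_compl_iff, mem_singleton_iff]
        exact ne_of_gt (show (0:ℝ) < x by linarith [hx.1])
    exact (hc.integrableOn_compact isCompact_Icc).mono_set Ioo_subset_Icc_self
  have hvol : volume (hypRep.domain ∩ win e 2) = ENNReal.ofReal (Real.log e) := by
    rw [hset, (volume_preserving_finTwoArrow ℝ).measure_preimage hmeas.nullMeasurableSet,
      Measure.volume_eq_prod, volume_regionBetween_eq_integral integrableOn_zero hint
        measurableSet_Ioo (fun x hx => by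
          show (0:ℝ) ≤ x⁻¹
          exact inv_nonneg.mpr (by linarith [hx.1]))]
    congr 1
    have : ∫ y in Ioo 1 e, ((fun x : ℝ => x⁻¹) - fun _ : ℝ => (0:ℝ)) y = ∫ y in (1:ℝ)..e, y⁻¹ := by
      rw [intervalIntegral.integral_of_le he1, integral_Ioc_eq_integral_Ioo]
      simp
    rw [this, integral_inv_of_pos one_pos hepos, div_one]
  rw [KZ.restrictedEval_of]
  show ∫ _ in hypRep.domain ∩ win e 2, (1:ℝ) = Real.log e
  rw [setIntegral_const, smul_eq_mul, mul_one, measureReal_def, hvol,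
    ENNReal.toReal_ofReal (Real.log_nonneg he1)]

/-! ### The refutation -/

/-- STRENGTHENING: chains WITHOUT rule 2 — only domain additivity (1a), integrand additivity (1b)
and Newton–Leibniz (3), through any dimensions. -/
def WithoutRule2 : Prop :=
  ∀ (r r' : KZ.IntegralRep 2), (∀ p ∈ r.domain, r.integrand p = 1) →
    (∀ p ∈ r'.domain, r'.integrand p = 1) → r.value = r'.value →
    KZ.of r - KZ.of r' ∈
      AddSubgroup.closure (KZ.domainAddRel ∪ KZ.integrandAddRel ∪ KZ.newtonLeibnizRel)

/-- **Rule 2 is load-bearing.** The hyperbola region `R = {1<x<2, 0<y<1/x}` and its translate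
`R + (3,0)` have equal area (`log 2`) but `[R] − [R + (3,0)]` is NOT in the subgroup generated by
rules 1a, 1b, 3: along such chains the first-coordinate window values `e ↦ Λₑ` are semialgebraic
up to a constant (`winSemialgebraic_of_mem`), whereas here they equal `log e` on `[1,2]`
(`restrictedEval_win_hypRep`), and `t ↦ log (2 − t)` has derivative `1/(t − 2)`, which no
`ℚ`-semialgebraic function on `[0,1]` has (tree barrier fact
`noSemialgebraicPrimitive_inv_sub_two_holds`).  Every chain proving the crux uses a change of
variables. -/
theorem not_withoutRule2 : ¬ WithoutRule2 := by
  intro h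
  have hmem := h hypRep hypShiftRep (fun _ _ => rfl) (fun _ _ => rfl) value_hypRep_eq
  obtain ⟨Φ, K, hΦ, hwin⟩ := winSemialgebraic_of_mem hmem
  have hlog : ∀ e ∈ Icc (1:ℝ) 2, Φ e + K = Real.log e := by
    intro e he
    rw [← hwin e, map_sub, restrictedEval_win_hypRep he,
      restrictedEval_win_hypShiftRep (he.2.trans (by norm_num)), sub_zero]
  have hI : IsSemialgebraic ℚ {x : Fin 1 → ℝ | x 0 ∈ Icc (0:ℝ) 1} := by
    have h0 := isSemialgebraic_setOf_eval_le (k := ℚ) (R := ℝ) (ι := Fin 1) (C 0) (X 0)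
    have h1 := isSemialgebraic_setOf_eval_le (k := ℚ) (R := ℝ) (ι := Fin 1) (X 0) (C 1)
    have hEq : {x : Fin 1 → ℝ | x 0 ∈ Icc (0:ℝ) 1} =
        {x : Fin 1 → ℝ | aeval x (C 0 : MvPolynomial (Fin 1) ℚ) ≤ aeval x (X 0 : MvPolynomial (Fin 1) ℚ)} ∩
        {x : Fin 1 → ℝ | aeval x (X 0 : MvPolynomial (Fin 1) ℚ) ≤ aeval x (C 1 : MvPolynomial (Fin 1) ℚ)} := by
      ext x
      simp
    rw [hEq]
    exact h0.inter h1
  refine Literature.Barriers.KontsevichZagierPeriods.KZ.noSemialgebraicPrimitive_inv_sub_two_holds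
    ⟨fun z => Φ (2 - z 0), ?_, ?_⟩
  · have hm : IsSemialgebraicMapOn ℚ {x : Fin 1 → ℝ | x 0 ∈ Icc (0:ℝ) 1}
        (fun z : Fin 1 → ℝ => fun _ : Fin 1 => 2 - z 0) := by
      have := isSemialgebraicMapOn_aeval (k := ℚ) (R := ℝ) hI
        (fun _ : Fin 1 => (C 2 - X 0 : MvPolynomial (Fin 1) ℚ))
      convert this using 2 with z
      funext j
      simp
    exact IsSemialgebraicFunOn.comp_isSemialgebraicMapOn_holds hΦ hm (fun _ _ => mem_univ _)
  · intro t ht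
    have hEq : (fun s : ℝ => Φ (2 - (fun _ : Fin 1 => s) 0)) =ᶠ[𝓝 t]
        fun s => Real.log (2 - s) - K := by
      filter_upwards [Ioo_mem_nhds ht.1 ht.2] with s hs
      have h2s : 2 - s ∈ Icc (1:ℝ) 2 := ⟨by linarith [hs.2], by linarith [hs.1]⟩
      have := hlog (2 - s) h2s
      show Φ (2 - s) = Real.log (2 - s) - K
      linarith
    refine HasDerivAt.congr_of_eventuallyEq ?_ hEq
    have h1 : HasDerivAt (fun s : ℝ => 2 - s) (-1) t := by
      simpa using (hasDerivAt_id t).const_sub 2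
    have h2 : HasDerivAt (fun s : ℝ => Real.log (2 - s)) ((2 - t)⁻¹ * (-1)) t :=
      (Real.hasDerivAt_log (show (2 - t) ≠ 0 by linarith [ht.2])).comp t h1
    have h3 := h2.sub_const K
    convert h3 using 1
    have : (t - 2) ≠ 0 := by linarith [ht.2]
    have : (2 - t) ≠ 0 := by linarith [ht.2]
    field_simp
    ring

/-! ## §3d Tightness of §3c: the witness pair IS equivalent in the full calculus

`[R] ~ [R + (3,0)]` by five moves: domain additivity against null algebraic arcs, one
Newton–Leibniz move onto the shadow `[(1,2), 1/x]` (`KZ.exists_underGraph`), the dimension-1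
TRANSLATION `x ↦ x + 3` (the one rule-2 move), and back.  So the §3c pair is no counterexample to
the crux; it only shows that its rule-2 move cannot be traded for rules 1a/1b/3. -/

/-- **Null differences do not matter**: two integrand-`1` planar representations whose domains
differ by null sets are equivalent (rule 1a twice, null regions being relations). -/
theorem equivalent_of_null_diff (r r' : KZ.IntegralRep 2) (hr : ∀ p ∈ r.domain, r.integrand p = 1)
    (hr' : ∀ p ∈ r'.domain, r'.integrand p = 1) (h₁ : volume (r.domain \ r'.domain) = 0)
    (h₂ : volume (r'.domain \ r.domain) = 0) : KZ.Equivalent r r' := by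
  have hσ := r.isSemialgebraic_domain
  have hσ' := r'.isSemialgebraic_domain
  have hfin := volume_lt_top_of_integrand_one r hr
  let i : KZ.IntegralRep 2 := constOneRep (r.domain ∩ r'.domain) (hσ.inter hσ')
    (lt_top_iff_ne_top.mp ((measure_mono inter_subset_left).trans_lt hfin))
  let d : KZ.IntegralRep 2 := constOneRep (r.domain \ r'.domain) (hσ.diff hσ')
    (by rw [h₁]; exact ENNReal.zero_ne_top)
  let d' : KZ.IntegralRep 2 := constOneRep (r'.domain \ r.domain) (hσ'.diff hσ)
    (by rw [h₂]; exact ENNReal.zero_ne_top)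
  have ha : KZ.of r - KZ.of i - KZ.of d ∈ KZ.relations := by
    refine KZ.domainAddRel_subset_relations ⟨2, r, i, d, ?_, ?_, ?_, ?_, rfl⟩
    · simp [i, d]
    · simp [i, d]
      rw [show r.domain ∩ r'.domain ∩ (r.domain \ r'.domain) = ∅ by
        ext x; simp only [mem_inter_iff, Set.mem_sdiff, mem_empty_iff_false, iff_false]; tauto]
      exact measure_empty
    · intro x hx; exact hr x hx.1
    · intro x hx; exact hr x hx.1
  have ha' : KZ.of r' - KZ.of i - KZ.of d' ∈ KZ.relations := by
    refine KZ.domainAddRel_subset_relations ⟨2, r', i, d', ?_, ?_, ?_, ?_, rfl⟩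
    · simp only [i, d', constOneRep_domain]
      rw [inter_comm, inter_union_sdiff]
    · simp only [i, d', constOneRep_domain]
      rw [show r.domain ∩ r'.domain ∩ (r'.domain \ r.domain) = ∅ by
        ext x; simp only [mem_inter_iff, Set.mem_sdiff, mem_empty_iff_false, iff_false]; tauto]
      exact measure_empty
    · intro x hx; exact hr' x hx.2
    · intro x hx; exact hr' x hx.1
  have hd : KZ.of d ∈ KZ.relations := of_mem_relations_of_volume_eq_zero d h₁
  have hd' : KZ.of d' ∈ KZ.relations := of_mem_relations_of_volume_eq_zero d' h₂
  have : KZ.of r - KZ.of r' =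
      (KZ.of r - KZ.of i - KZ.of d) - (KZ.of r' - KZ.of i - KZ.of d') + KZ.of d - KZ.of d' := by
    abel
  show KZ.of r - KZ.of r' ∈ KZ.relations
  rw [this]
  exact KZ.relations.sub_mem (KZ.relations.add_mem (KZ.relations.sub_mem ha ha') hd) hd'

/-- The interval `(a, b)` as a subset of `ℝ¹` is `ℚ`-semialgebraic for rational `a, b`. -/
theorem isSemialgebraic_setOf_apply_mem_Ioo (a b : ℚ) :
    IsSemialgebraic ℚ {x : Fin 1 → ℝ | x 0 ∈ Ioo (a:ℝ) b} := by
  have h0 := isSemialgebraic_setOf_eval_lt (k := ℚ) (R := ℝ) (ι := Fin 1) (C a) (X 0)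
  have h1 := isSemialgebraic_setOf_eval_lt (k := ℚ) (R := ℝ) (ι := Fin 1) (X 0) (C b)
  have hEq : {x : Fin 1 → ℝ | x 0 ∈ Ioo (a:ℝ) b} =
      {x : Fin 1 → ℝ | aeval x (C a : MvPolynomial (Fin 1) ℚ) < aeval x (X 0 : MvPolynomial (Fin 1) ℚ)} ∩
      {x : Fin 1 → ℝ | aeval x (X 0 : MvPolynomial (Fin 1) ℚ) < aeval x (C b : MvPolynomial (Fin 1) ℚ)} := by
    ext x
    simp
  rw [hEq]
  exact h0.inter h1

/-- The Newton–Leibniz shadow of `R + (c, 0)`: `[(1 + c, 2 + c), 1/(x − c)]` for rational `c`. -/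
def invShiftRep (c : ℚ) : KZ.IntegralRep 1 where
  domain := {x | x 0 ∈ Ioo ((1:ℝ) + c) (2 + c)}
  integrand := fun x : Fin 1 → ℝ => (x 0 - (c:ℝ))⁻¹
  isSemialgebraic_domain := by
    simpa [Rat.cast_add, Rat.cast_one, Rat.cast_ofNat] using isSemialgebraic_setOf_apply_mem_Ioo (1 + c) (2 + c)
  isSemialgebraicFunOn_integrand := by
    have hs : IsSemialgebraic ℚ {x : Fin 1 → ℝ | x 0 ∈ Ioo ((1:ℝ) + c) (2 + c)} := by
      simpa [Rat.cast_add, Rat.cast_one, Rat.cast_ofNat] using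
        isSemialgebraic_setOf_apply_mem_Ioo (1 + c) (2 + c)
    have hq : ∀ x ∈ {x : Fin 1 → ℝ | x 0 ∈ Ioo ((1:ℝ) + c) (2 + c)},
        aeval x (X 0 - C c : MvPolynomial (Fin 1) ℚ) ≠ 0 := by
      intro x hx
      have : (1:ℝ) + c < x 0 := hx.1
      simp only [map_sub, MvPolynomial.aeval_X, MvPolynomial.aeval_C, eq_ratCast]
      linarith
    refine (isSemialgebraicFunOn_aeval_div_aeval hs (C 1) (X 0 - C c) hq).congr fun x _ => ?_
    simp [one_div]
  integrableOn := by
    have hsub : {x : Fin 1 → ℝ | x 0 ∈ Ioo ((1:ℝ) + c) (2 + c)} ⊆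
        Icc (fun _ : Fin 1 => (1:ℝ) + c) (fun _ => 2 + c) := by
      intro x hx
      rw [mem_Icc, Pi.le_def, Pi.le_def]
      refine ⟨fun i => ?_, fun i => ?_⟩
      · have hi : i = 0 := Fin.ext (by have := i.isLt; omega)
        rw [hi]; exact hx.1.le
      · have hi : i = 0 := Fin.ext (by have := i.isLt; omega)
        rw [hi]; exact hx.2.le
    have hcont : ContinuousOn (fun x : Fin 1 → ℝ => (x 0 - c)⁻¹)
        (Icc (fun _ : Fin 1 => (1:ℝ) + c) (fun _ => 2 + c)) := by
      refine ContinuousOn.inv₀ (((continuous_apply 0).sub continuous_const).continuousOn)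
        fun x hx => ?_
      have : (1:ℝ) + c ≤ x 0 := hx.1 0
      exact ne_of_gt (by linarith)
    exact (hcont.integrableOn_compact isCompact_Icc).mono_set hsub

/-- The domain of `invShiftRep c`. -/
@[simp] theorem invShiftRep_domain (c : ℚ) :
    (invShiftRep c).domain = {x | x 0 ∈ Ioo ((1:ℝ) + c) (2 + c)} := rfl

/-- The integrand of `invShiftRep c`. -/
@[simp] theorem invShiftRep_integrand (c : ℚ) :
    (invShiftRep c).integrand = fun x : Fin 1 → ℝ => (x 0 - (c:ℝ))⁻¹ := rfl

/-- **The one rule-2 move**: the shadows of `R` and `R + (3,0)` differ by the dimension-1 translation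
`x ↦ x + 3` (one change-of-variables instance). -/
theorem of_invShiftRep_zero_sub_three_mem :
    KZ.of (invShiftRep 0) - KZ.of (invShiftRep 3) ∈ KZ.changeOfVariablesRel := by
  refine ⟨1, invShiftRep 0, invShiftRep 3, fun x => fun i => x i + 3,
    fun _ => ContinuousLinearMap.id ℝ (Fin 1 → ℝ), ?_, ?_, ?_, ?_, ?_, rfl⟩
  · have := isSemialgebraicMapOn_aeval (k := ℚ) (R := ℝ) (invShiftRep 0).isSemialgebraic_domain
      (fun _ : Fin 1 => (X 0 + C 3 : MvPolynomial (Fin 1) ℚ))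
    convert this using 2 with x
    funext i
    have hi : i = 0 := Fin.ext (by have := i.isLt; omega)
    simp [hi]
  · intro x _
    have h : HasFDerivWithinAt (fun x : Fin 1 → ℝ => x + fun _ => (3:ℝ))
        (ContinuousLinearMap.id ℝ (Fin 1 → ℝ)) (invShiftRep 0).domain x :=
      (hasFDerivWithinAt_id x _).add_const _
    convert h using 1
    funext y i
    rfl
  · intro x _ y _ hxy
    funext i
    have := congrFun hxy i
    simpa using this
  · ext y
    simp only [invShiftRep_domain, mem_setOf_eq, mem_image, mem_Ioo, Rat.cast_zero, add_zero,
      Rat.cast_ofNat]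
    constructor
    · rintro ⟨h1, h2⟩
      refine ⟨fun i => y i - 3, ⟨by linarith, by linarith⟩, ?_⟩
      funext i
      ring
    · rintro ⟨x, ⟨h1, h2⟩, rfl⟩
      constructor <;> linarith
  · intro x _
    simp only [invShiftRep_integrand, Rat.cast_zero, sub_zero, Rat.cast_ofNat, add_sub_cancel_right,
      ContinuousLinearMap.det, ContinuousLinearMap.coe_id, LinearMap.det_id, abs_one, mul_one]

/-- **Tightness of §3c**: the hyperbola region and its translate ARE equivalent in the full
calculus (so `not_withoutRule2` pins the blame on the absence of rule 2, not on the pair). -/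
theorem hypRep_equivalent_hypShiftRep : KZ.Equivalent hypRep hypShiftRep := by
  -- the two shadows and their under-graphs
  have h0 : ∀ x ∈ (invShiftRep 0).domain, 0 ≤ (invShiftRep 0).integrand x := by
    intro x hx
    have : (1:ℝ) + (0:ℚ) < x 0 := hx.1
    simp only [invShiftRep_integrand, Rat.cast_zero, sub_zero, inv_nonneg]
    push_cast at this
    linarith
  have h3 : ∀ x ∈ (invShiftRep 3).domain, 0 ≤ (invShiftRep 3).integrand x := by
    intro x hx
    have : (1:ℝ) + (3:ℚ) < x 0 := hx.1
    simp only [invShiftRep_integrand, Rat.cast_ofNat, inv_nonneg]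
    push_cast at this
    linarith
  obtain ⟨G, hGd, hGi, hG⟩ := KZ.exists_underGraph (invShiftRep 0) h0
  obtain ⟨G', hGd', hGi', hG'⟩ := KZ.exists_underGraph (invShiftRep 3) h3
  have hGr : KZ.Equivalent G (invShiftRep 0) := KZ.newtonLeibnizRel_subset_relations hG
  have hGr' : KZ.Equivalent G' (invShiftRep 3) := KZ.newtonLeibnizRel_subset_relations hG'
  have hrr' : KZ.Equivalent (invShiftRep 0) (invShiftRep 3) :=
    KZ.changeOfVariablesRel_subset_relations of_invShiftRep_zero_sub_three_mem
  -- membership in the under-graphs, unfolded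
  have hmemG : ∀ p : Fin 2 → ℝ, p ∈ G.domain ↔ p 0 ∈ Ioo (1:ℝ) 2 ∧ 0 ≤ p 1 ∧ p 1 ≤ (p 0)⁻¹ := by
    intro p
    rw [hGd]
    show (Fin.init p ∈ {x : Fin 1 → ℝ | x 0 ∈ Ioo ((1:ℝ) + (0:ℚ)) (2 + (0:ℚ))} ∧
      (0:ℝ) ≤ p (Fin.last 1) ∧ p (Fin.last 1) ≤ (Fin.init p 0 - ((0:ℚ) : ℝ))⁻¹) ↔ _
    simp only [mem_setOf_eq, Rat.cast_zero, add_zero, sub_zero]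
    rfl
  have hmemG' : ∀ p : Fin 2 → ℝ, p ∈ G'.domain ↔ p 0 ∈ Ioo (4:ℝ) 5 ∧ 0 ≤ p 1 ∧ p 1 ≤ (p 0 - 3)⁻¹ := by
    intro p
    rw [hGd']
    show (Fin.init p ∈ {x : Fin 1 → ℝ | x 0 ∈ Ioo ((1:ℝ) + (3:ℚ)) (2 + (3:ℚ))} ∧
      (0:ℝ) ≤ p (Fin.last 1) ∧ p (Fin.last 1) ≤ (Fin.init p 0 - ((3:ℚ) : ℝ))⁻¹) ↔ _
    simp only [mem_setOf_eq, Rat.cast_ofNat]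
    norm_num
    rfl
  -- null algebraic arcs
  have hnull1 : volume {p : Fin 2 → ℝ | p 1 = 0} = 0 := by
    have := MvPolynomial.volume_zeroSet_eq_zero 2 (X 1) (X_ne_zero 1)
    simpa using this
  have hnull2 : volume {p : Fin 2 → ℝ | p 0 * p 1 = 1} = 0 := by
    have hne : (X 0 * X 1 - 1 : MvPolynomial (Fin 2) ℝ) ≠ 0 := by
      intro h
      have := congrArg (MvPolynomial.eval (fun _ : Fin 2 => (0:ℝ))) h
      simp at this
    have := MvPolynomial.volume_zeroSet_eq_zero 2 (X 0 * X 1 - 1) hne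
    simpa [sub_eq_zero] using this
  have hnull3 : volume {p : Fin 2 → ℝ | (p 0 - 3) * p 1 = 1} = 0 := by
    have hne : ((X 0 - 3) * X 1 - 1 : MvPolynomial (Fin 2) ℝ) ≠ 0 := by
      intro h
      have := congrArg (MvPolynomial.eval (fun _ : Fin 2 => (0:ℝ))) h
      simp at this
    have := MvPolynomial.volume_zeroSet_eq_zero 2 ((X 0 - 3) * X 1 - 1) hne
    simpa [sub_eq_zero] using this
  -- `R ~ G`
  have hRG : KZ.Equivalent hypRep G := by
    refine equivalent_of_null_diff hypRep G (fun _ _ => rfl) (fun p _ => by rw [hGi]) ?_ ?_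
    · rw [show hypRep.domain \ G.domain = ∅ by
        ext p
        simp only [mem_empty_iff_false, iff_false]
        intro hp
        rw [Set.mem_sdiff, hmemG, hypRep_domain] at hp
        have hp1 : 1 < p 0 ∧ p 0 < 2 ∧ 0 < p 1 ∧ p 0 * p 1 < 1 := hp.1
        obtain ⟨h1, h2, h3, h4⟩ := hp1
        have h0 : 0 < p 0 := by linarith
        refine hp.2 ⟨⟨h1, h2⟩, h3.le, ?_⟩
        rw [← one_div, le_div_iff₀ h0]
        linarith [mul_comm (p 0) (p 1)]]
      exact measure_empty
    · refine measure_mono_null (fun p hp => ?_) (measure_union_null hnull1 hnull2)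
      rw [Set.mem_sdiff, hmemG, hypRep_domain] at hp
      obtain ⟨⟨⟨h1, h2⟩, h3, h4⟩, hn⟩ := hp
      replace hn : ¬ (1 < p 0 ∧ p 0 < 2 ∧ 0 < p 1 ∧ p 0 * p 1 < 1) := hn
      have h0 : 0 < p 0 := by linarith
      simp only [mem_union, mem_setOf_eq]
      by_contra hcon
      simp only [not_or] at hcon
      apply hn
      refine ⟨h1, h2, lt_of_le_of_ne h3 (Ne.symm hcon.1), ?_⟩
      rw [← one_div, le_div_iff₀ h0] at h4
      exact lt_of_le_of_ne (by linarith [mul_comm (p 0) (p 1)]) hcon.2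
  -- `R + (3,0) ~ G'`
  have hRG' : KZ.Equivalent hypShiftRep G' := by
    refine equivalent_of_null_diff hypShiftRep G' (fun _ _ => rfl) (fun p _ => by rw [hGi']) ?_ ?_
    · rw [show hypShiftRep.domain \ G'.domain = ∅ by
        ext p
        simp only [mem_empty_iff_false, iff_false]
        intro hp
        rw [Set.mem_sdiff, hmemG', hypShiftRep_domain] at hp
        have hp1 : 4 < p 0 ∧ p 0 < 5 ∧ 0 < p 1 ∧ (p 0 - 3) * p 1 < 1 := hp.1
        obtain ⟨h1, h2, h3, h4⟩ := hp1
        have h0 : 0 < p 0 - 3 := by linarith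
        refine hp.2 ⟨⟨h1, h2⟩, h3.le, ?_⟩
        rw [← one_div, le_div_iff₀ h0]
        linarith [mul_comm (p 0 - 3) (p 1)]]
      exact measure_empty
    · refine measure_mono_null (fun p hp => ?_) (measure_union_null hnull1 hnull3)
      rw [Set.mem_sdiff, hmemG', hypShiftRep_domain] at hp
      obtain ⟨⟨⟨h1, h2⟩, h3, h4⟩, hn⟩ := hp
      replace hn : ¬ (4 < p 0 ∧ p 0 < 5 ∧ 0 < p 1 ∧ (p 0 - 3) * p 1 < 1) := hn
      have h0 : 0 < p 0 - 3 := by linarith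
      simp only [mem_union, mem_setOf_eq]
      by_contra hcon
      simp only [not_or] at hcon
      apply hn
      refine ⟨h1, h2, lt_of_le_of_ne h3 (Ne.symm hcon.1), ?_⟩
      rw [← one_div, le_div_iff₀ h0] at h4
      exact lt_of_le_of_ne (by linarith [mul_comm (p 0 - 3) (p 1)]) hcon.2
  exact ((hRG.trans hGr).trans hrr').trans (hRG'.trans hGr').symm

/-! ## §6 (cycle 2) Divisibility modulo rule 1b, no reduced invariants, the torsion reading

Three structural facts about `KZ.FormalRep ⧸ KZ.relations` bounding the SHAPE of any refutation
(landed copy: `Theorems/PlanarAreas/Negative/Divisibility.lean`, p76449).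
(a) Every representation is infinitely divisible modulo rule 1b ALONE: `[σ, f] ≡ k • [σ, f/k]` by
`k − 1` integrand-additivity instances; so the quotient by the moves is a divisible group — and since
rule 1b is derivable from rules 1a + 3 (Theorems/StuffleInKZ/Negative/IntegrandAdditivityDerived,
`integrandAddRel_subset_closure_domAdd_nl`), already modulo `closure (1a ∪ 3)`
(`exists_sub_nsmul_mem_closure_domAdd_nl`).
(b) Hence an additive invariant with values in a REDUCED group (`ℤ`, lattices `ι → ℤ`, finite groups)
that is compatible with rule 1b vanishes identically: the o-minimal Euler characteristic, integer
"curved Dehn" bookkeeping of boundary arcs, parities … can never instantiate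
`not_of_separating_invariant`.  This death is independent of the one recorded in cycle 1 (null
overlaps of rule 1a) and is EXACTLY what distinguishes the crux from crux 3 `PlanarK0Injective`
(rules 1a + 2 on integrand-`1` regions, where `[σ]` need not be divisible: bisecting a curved region
into two move-congruent halves wants a cut at a possibly transcendental abscissa), so lattice-valued
invariants stay conceivable for crux 3 while being void for crux 5.
(c) TORSION: D-0015 (2) reads "pass from one formula to another" as membership in the `ℤ`-span of
the move instances — no division by integers.  The quotient being divisible, it is torsion-free iff
it is a `ℚ`-vector space; the kernel conjecture forces saturation, the crux forces it on planar
integrand-`1` differences, so a TORSION WITNESS (a pair connected `k` times over, not once) would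
refute the crux and the summit while being invisible to every `ℝ`-valued invariant.  Searched and
not found: the natural doubled chains — degree-2 semialgebraic area-preserving covers such as
`w = z²/(√2 |z|)` from the annulus `1<|z|<2` onto `1/√2<|w|<√2` — split along a null ray (rule 1a)
into two injective rule-2 moves, so `[σ] ~ 2[σ']` is realised honestly and its "half"
`[upper half of σ] ~ [σ']` is itself one move.  A WARNING from the search: restricting rule 2 to
AFFINE substitutions manufactures fake torsion — with dilations and reflections alone one derives
only `2 • ([(0,1), t] − [(0,1), 1/2]) ≡ 0` in dimension `1` (dilation by `1/n` yields the multiple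
`(n³ − n)/3`, reflection the multiple `2`), whereas the single non-affine substitution `t = u²`
gives `[(0,1), t] − [(0,1), 1/2] ∈ changeOfVariablesRel` outright (`u = (1/2)·|2u|`); likewise
`[(0,1), φ'] − [(φ 0, φ 1), 1]` is ONE rule-2 move for every increasing algebraic `φ` — rule 3's
dimension-`1 → 0` content on monotone primitives is carried by rule 2 (cf. §9a). -/


/-! ## §6a Scaling the integrand by a rational; divisibility modulo rule 1b -/

/-- `[σ, q • f]`: the representation with the same domain and the integrand scaled by a rational
`q` (still `ℚ`-semialgebraic and absolutely integrable). [folklore] -/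
def scaleRep {n : ℕ} (q : ℚ) (r : KZ.IntegralRep n) : KZ.IntegralRep n where
  domain := r.domain
  integrand := fun x => (q : ℝ) * r.integrand x
  isSemialgebraic_domain := r.isSemialgebraic_domain
  isSemialgebraicFunOn_integrand :=
    IsSemialgebraicFunOn.mul_holds
      (Summit.KontsevichZagierPeriods.SymplecticScissors.RealOnePeriodRelationsNegative.isSemialgebraicFunOn_ratConst
        r.isSemialgebraic_domain q)
      r.isSemialgebraicFunOn_integrand
  integrableOn := r.integrableOn.const_mul _

/-- The domain of `scaleRep q r` is that of `r`. [folklore] -/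
@[simp] theorem scaleRep_domain {n : ℕ} (q : ℚ) (r : KZ.IntegralRep n) :
    (scaleRep q r).domain = r.domain := rfl

/-- The integrand of `scaleRep q r` is `q • r.integrand`. [folklore] -/
@[simp] theorem scaleRep_integrand {n : ℕ} (q : ℚ) (r : KZ.IntegralRep n) :
    (scaleRep q r).integrand = fun x => (q : ℝ) * r.integrand x := rfl

/-- `value [σ, q • f] = q • value [σ, f]`. [folklore] -/
theorem value_scaleRep {n : ℕ} (q : ℚ) (r : KZ.IntegralRep n) :
    (scaleRep q r).value = q * r.value := by
  simp [KZ.IntegralRep.value, integral_const_mul]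

/-- Rule 1b: `[σ, (p + q) f] − [σ, p f] − [σ, q f] ∈ integrandAddRel`. [cite: KontsevichZagier2001, §1.2 rule (1)] -/
theorem of_scaleRep_add_sub_mem_integrandAddRel {n : ℕ} (p q : ℚ) (r : KZ.IntegralRep n) :
    KZ.of (scaleRep (p + q) r) - KZ.of (scaleRep p r) - KZ.of (scaleRep q r) ∈
      KZ.integrandAddRel := by
  refine ⟨n, scaleRep (p + q) r, scaleRep p r, scaleRep q r, rfl, rfl, ?_, rfl⟩
  intro x _
  simp only [scaleRep_integrand, Pi.add_apply, Rat.cast_add]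
  ring

/-- Rule 1b: `[r] − [σ, 1 • f] − [σ, 0 • f] ∈ integrandAddRel`. [cite: KontsevichZagier2001, §1.2 rule (1)] -/
theorem of_sub_scaleRep_one_sub_scaleRep_zero_mem {n : ℕ} (r : KZ.IntegralRep n) :
    KZ.of r - KZ.of (scaleRep 1 r) - KZ.of (scaleRep 0 r) ∈ KZ.integrandAddRel := by
  refine ⟨n, r, scaleRep 1 r, scaleRep 0 r, rfl, rfl, ?_, rfl⟩
  intro x _
  simp

/-- The zero-integrand representation `[σ, 0]` lies in the 1b-closure (`[s] − [s] − [s] ∈ 1b` for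
`s = [σ, 0 • f]`, as `0 = 0 + 0`). [folklore] -/
theorem of_scaleRep_zero_mem_closure {n : ℕ} (r : KZ.IntegralRep n) :
    KZ.of (scaleRep 0 r) ∈ AddSubgroup.closure KZ.integrandAddRel := by
  have h : KZ.of (scaleRep 0 r) - KZ.of (scaleRep 0 r) - KZ.of (scaleRep 0 r) ∈
      KZ.integrandAddRel := by
    refine ⟨n, scaleRep 0 r, scaleRep 0 r, scaleRep 0 r, rfl, rfl, ?_, rfl⟩
    intro x _
    simp
  have heq : KZ.of (scaleRep 0 r) - KZ.of (scaleRep 0 r) - KZ.of (scaleRep 0 r) =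
      -KZ.of (scaleRep 0 r) := by abel
  have h' : -KZ.of (scaleRep 0 r) ∈ AddSubgroup.closure KZ.integrandAddRel := by
    rw [← heq]
    exact AddSubgroup.subset_closure h
  simpa using AddSubgroup.neg_mem _ h'

/-- `[σ, (m/k) f] ≡ m • [σ, (1/k) f]` modulo rule 1b. [folklore] -/
theorem of_scaleRep_div_sub_nsmul_mem {n : ℕ} (r : KZ.IntegralRep n) (k m : ℕ) :
    KZ.of (scaleRep ((m : ℚ) / k) r) - m • KZ.of (scaleRep ((1 : ℚ) / k) r) ∈
      AddSubgroup.closure KZ.integrandAddRel := by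
  induction m with
  | zero => simpa using of_scaleRep_zero_mem_closure r
  | succ m ih =>
    have hstep := AddSubgroup.subset_closure
      (of_scaleRep_add_sub_mem_integrandAddRel ((m : ℚ) / k) ((1 : ℚ) / k) r)
    have heq : (m : ℚ) / k + 1 / k = ((m + 1 : ℕ) : ℚ) / k := by
      push_cast
      ring
    rw [heq] at hstep
    have := AddSubgroup.add_mem _ hstep ih
    convert this using 1
    rw [succ_nsmul]
    abel

/-- **Every representation is infinitely divisible modulo rule 1b**:
`[σ, f] − k • [σ, f/k] ∈ closure integrandAddRel` for every `k ≥ 1`. [folklore] -/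
theorem of_sub_nsmul_mem_closure_integrandAdd {n : ℕ} (r : KZ.IntegralRep n) {k : ℕ}
    (hk : 0 < k) :
    KZ.of r - k • KZ.of (scaleRep ((1 : ℚ) / k) r) ∈ AddSubgroup.closure KZ.integrandAddRel := by
  have h1 := of_scaleRep_div_sub_nsmul_mem r k k
  have hkk : ((k : ℚ) / k) = 1 := div_self (by exact_mod_cast hk.ne')
  rw [hkk] at h1
  have h2 : KZ.of r - KZ.of (scaleRep 1 r) - KZ.of (scaleRep 0 r) ∈
      AddSubgroup.closure KZ.integrandAddRel :=
    AddSubgroup.subset_closure (of_sub_scaleRep_one_sub_scaleRep_zero_mem r)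
  have h3 := of_scaleRep_zero_mem_closure r
  have := AddSubgroup.add_mem _ (AddSubgroup.add_mem _ h2 h3) h1
  convert this using 1
  abel

/-- **The quotient by the moves is a divisible group**: every formal combination is `k`-divisible
modulo rule 1b, for every `k ≥ 1`. [folklore] -/
theorem exists_sub_nsmul_mem_closure_integrandAdd (c : KZ.FormalRep) {k : ℕ} (hk : 0 < k) :
    ∃ d : KZ.FormalRep, c - k • d ∈ AddSubgroup.closure KZ.integrandAddRel := by
  induction c using FreeAbelianGroup.induction_on with
  | zero => exact ⟨0, by simp⟩
  | of x =>
    obtain ⟨n, r⟩ := x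
    exact ⟨KZ.of (scaleRep ((1 : ℚ) / k) r), of_sub_nsmul_mem_closure_integrandAdd r hk⟩
  | neg x hx =>
    obtain ⟨d, hd⟩ := hx
    refine ⟨-d, ?_⟩
    have := AddSubgroup.neg_mem _ hd
    convert this using 1
    rw [neg_nsmul]
    abel
  | add x y hx hy =>
    obtain ⟨d, hd⟩ := hx
    obtain ⟨d', hd'⟩ := hy
    refine ⟨d + d', ?_⟩
    have := AddSubgroup.add_mem _ hd hd'
    convert this using 1
    rw [nsmul_add]
    abel

/-- The same divisibility modulo the full subgroup of relations. [folklore] -/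
theorem exists_sub_nsmul_mem_relations (c : KZ.FormalRep) {k : ℕ} (hk : 0 < k) :
    ∃ d : KZ.FormalRep, c - k • d ∈ KZ.relations := by
  obtain ⟨d, hd⟩ := exists_sub_nsmul_mem_closure_integrandAdd c hk
  exact ⟨d, (AddSubgroup.closure_mono fun x hx => Or.inl (Or.inl (Or.inr hx))) hd⟩

/-! ## §6b No reduced-group-valued invariants -/

/-- An additive group is *reduced* (elementwise form used here): its only infinitely divisible
element is `0`. [folklore] -/
def IsReducedGroup (A : Type*) [AddCommGroup A] : Prop :=
  ∀ a : A, (∀ k : ℕ, 0 < k → ∃ b : A, a = k • b) → a = 0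

/-- `ℤ` is reduced. [folklore] -/
theorem isReducedGroup_int : IsReducedGroup ℤ := by
  intro a ha
  by_contra hne
  obtain ⟨b, hb⟩ := ha (a.natAbs + 1) (Nat.succ_pos _)
  have hb0 : b ≠ 0 := by
    rintro rfl
    simp at hb
    exact hne hb
  have h1 : a.natAbs = (a.natAbs + 1) * b.natAbs := by
    have := congrArg Int.natAbs hb
    rw [nsmul_eq_mul, Int.natAbs_mul, Int.natAbs_natCast] at this
    exact this
  have h2 : 0 < b.natAbs := Int.natAbs_pos.mpr hb0
  have h3 : a.natAbs + 1 ≤ (a.natAbs + 1) * b.natAbs := Nat.le_mul_of_pos_right _ h2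
  omega

/-- Finite additive groups are reduced (`|A| • b = 0`). [folklore] -/
theorem isReducedGroup_of_finite (A : Type*) [AddCommGroup A] [Finite A] : IsReducedGroup A := by
  intro a ha
  haveI := Fintype.ofFinite A
  obtain ⟨b, hb⟩ := ha (Fintype.card A) Fintype.card_pos
  rw [hb, card_nsmul_eq_zero]

/-- Products of reduced groups (e.g. lattices `ι → ℤ`) are reduced. [folklore] -/
theorem isReducedGroup_pi {ι : Type*} {A : ι → Type*} [∀ i, AddCommGroup (A i)]
    (h : ∀ i, IsReducedGroup (A i)) : IsReducedGroup (∀ i, A i) := by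
  intro a ha
  funext i
  refine h i (a i) fun k hk => ?_
  obtain ⟨b, hb⟩ := ha k hk
  exact ⟨b i, by rw [hb]; rfl⟩

/-- **Rule 1b kills every reduced-group-valued invariant on generators.**  If `J : FormalRep →+ A`
vanishes on the integrand-additivity move set and `A` is reduced, then `J [r] = 0` for EVERY
representation `r` (its value is infinitely divisible by §6a). [folklore] -/
theorem apply_of_eq_zero_of_isReducedGroup {A : Type*} [AddCommGroup A] (hA : IsReducedGroup A)
    (J : KZ.FormalRep →+ A) (hJ : ∀ x ∈ KZ.integrandAddRel, J x = 0) {n : ℕ}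
    (r : KZ.IntegralRep n) : J (KZ.of r) = 0 := by
  have hker : AddSubgroup.closure KZ.integrandAddRel ≤ J.ker := (AddSubgroup.closure_le _).mpr hJ
  refine hA _ fun k hk => ⟨J (KZ.of (scaleRep ((1 : ℚ) / k) r)), ?_⟩
  have := hker (of_sub_nsmul_mem_closure_integrandAdd r hk)
  rwa [AddMonoidHom.mem_ker, map_sub, map_nsmul, sub_eq_zero] at this

/-- … hence `J = 0` on the whole formal group. [folklore] -/
theorem eq_zero_of_isReducedGroup {A : Type*} [AddCommGroup A] (hA : IsReducedGroup A)
    (J : KZ.FormalRep →+ A) (hJ : ∀ x ∈ KZ.integrandAddRel, J x = 0) : J = 0 := by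
  refine AddMonoidHom.ext fun c => ?_
  induction c using FreeAbelianGroup.induction_on with
  | zero => simp
  | of x =>
    obtain ⟨n, r⟩ := x
    exact apply_of_eq_zero_of_isReducedGroup hA J hJ r
  | neg x hx => rw [map_neg, hx]; simp
  | add x y hx hy => rw [map_add, hx, hy]; simp

/-- **No Euler-characteristic / lattice / parity refutation of the crux**: a reduced-group-valued
invariant compatible with rule 1b separates NO two representations, so it can never instantiate
`not_of_separating_invariant`.  Refuting invariants must take values in groups with infinitely
divisible elements. [folklore] -/
theorem not_separating_of_isReducedGroup {A : Type*} [AddCommGroup A] (hA : IsReducedGroup A)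
    (J : KZ.FormalRep →+ A) (hJ : ∀ x ∈ KZ.integrandAddRel, J x = 0) {n m : ℕ}
    (r : KZ.IntegralRep n) (r' : KZ.IntegralRep m) : J (KZ.of r) = J (KZ.of r') := by
  rw [apply_of_eq_zero_of_isReducedGroup hA J hJ r, apply_of_eq_zero_of_isReducedGroup hA J hJ r']

/-! ## §6c The torsion reading -/

/-- `relations` is SATURATED in `FormalRep` (the quotient is torsion-free): `k • c ∈ relations`
with `k ≥ 1` forces `c ∈ relations`. A refuter-posited reading of D-0015 (2), not a printed
statement. -/
def RelationsSaturated : Prop :=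
  ∀ (c : KZ.FormalRep) (k : ℕ), 0 < k → k • c ∈ KZ.relations → c ∈ KZ.relations

/-- The kernel conjecture (≡ the summit, `kzKernelConjecture_iff_isRational`) implies saturation:
`k • eval c = 0 ⇒ eval c = 0 ⇒ c ∈ relations`. [cite: KontsevichZagier2001, §1.2] -/
theorem saturated_of_kzKernelConjecture (h : KZKernelConjecture) : RelationsSaturated := by
  intro c k hk hmem
  apply h
  have := KZ.relations_le_ker_eval_holds hmem
  rw [AddMonoidHom.mem_ker, map_nsmul, nsmul_eq_mul] at this
  have hk' : (k : ℝ) ≠ 0 := by exact_mod_cast hk.ne'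
  exact (mul_eq_zero.mp this).resolve_left hk'

/-- **The crux saturates planar integrand-`1` differences**: if `k • ([r] − [r'])` is a relation
(`k ≥ 1`) then so is `[r] − [r']` — soundness gives `k • (area r − area r') = 0`, and the crux does
the rest. [cite: KontsevichZagier2001, §1.2] -/
theorem sub_mem_relations_of_nsmul_mem (h : PlanarAreas) (r r' : KZ.IntegralRep 2)
    (hr : ∀ p ∈ r.domain, r.integrand p = 1) (hr' : ∀ p ∈ r'.domain, r'.integrand p = 1)
    {k : ℕ} (hk : 0 < k) (hmem : k • (KZ.of r - KZ.of r') ∈ KZ.relations) :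
    KZ.of r - KZ.of r' ∈ KZ.relations := by
  apply h r r' hr hr'
  have := KZ.relations_le_ker_eval_holds hmem
  rw [AddMonoidHom.mem_ker, map_nsmul, map_sub, KZ.eval_of, KZ.eval_of, nsmul_eq_mul] at this
  have hk' : (k : ℝ) ≠ 0 := by exact_mod_cast hk.ne'
  exact sub_eq_zero.mp ((mul_eq_zero.mp this).resolve_left hk')

/-- **A torsion witness refutes the crux** (and, through `not_summit_of_not`, the summit): an
equal-area integrand-`1` planar pair connected `k` times over but not once.  This is the one attack
surface that no `ℝ`-valued (more generally: no torsion-free-valued) invariant can see; by §6a the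
quotient is divisible, so such torsion is the ONLY way it can fail to be a `ℚ`-vector space.
No candidate pair is known (cycle 2). [cite: KontsevichZagier2001, §1.2] -/
theorem not_planarAreas_of_torsion (r r' : KZ.IntegralRep 2)
    (hr : ∀ p ∈ r.domain, r.integrand p = 1) (hr' : ∀ p ∈ r'.domain, r'.integrand p = 1)
    {k : ℕ} (hk : 0 < k) (hmem : k • (KZ.of r - KZ.of r') ∈ KZ.relations)
    (hnot : KZ.of r - KZ.of r' ∉ KZ.relations) : ¬ PlanarAreas :=
  fun h => hnot (sub_mem_relations_of_nsmul_mem h r r' hr hr' hk hmem)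

/-- Equal areas are automatic for a torsion pair (soundness), so the value hypothesis of the crux
is already met by any `k`-fold relation. [cite: KontsevichZagier2001, §1.2] -/
theorem value_eq_of_nsmul_sub_mem {n m : ℕ} (r : KZ.IntegralRep n) (r' : KZ.IntegralRep m)
    {k : ℕ} (hk : 0 < k) (hmem : k • (KZ.of r - KZ.of r') ∈ KZ.relations) :
    r.value = r'.value := by
  have := KZ.relations_le_ker_eval_holds hmem
  rw [AddMonoidHom.mem_ker, map_nsmul, map_sub, KZ.eval_of, KZ.eval_of, nsmul_eq_mul] at this
  have hk' : (k : ℝ) ≠ 0 := by exact_mod_cast hk.ne'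
  exact sub_eq_zero.mp ((mul_eq_zero.mp this).resolve_left hk')

/-- By the derivability of rule 1b from rules 1a + 3 (`integrandAddRel ⊆ closure (domainAddRel ∪
newtonLeibnizRel)`, Theorems/StuffleInKZ/Negative/IntegrandAdditivityDerived, cdisprove unit of
stmt-3931), the divisibility of §6a already holds modulo rules 1a + 3: reduced-group-valued
invariants of the sub-calculus `closure (1a ∪ 3)` vanish identically as well; only the set-chain
group of rules 1a + 2 (crux 3 `PlanarK0Injective`) escapes. -/
theorem exists_sub_nsmul_mem_closure_domAdd_nl (c : KZ.FormalRep) {k : ℕ} (hk : 0 < k) :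
    ∃ d : KZ.FormalRep, c - k • d ∈ AddSubgroup.closure (KZ.domainAddRel ∪ KZ.newtonLeibnizRel) := by
  obtain ⟨d, hd⟩ := exists_sub_nsmul_mem_closure_integrandAdd c hk
  exact ⟨d, (AddSubgroup.closure_le _).mpr
    Summit.KontsevichZagierPeriods.Theorems.StuffleInKZ.Negative.Derived.integrandAddRel_subset_closure_domAdd_nl
      hd⟩


open Summit.KontsevichZagierPeriods.SymplecticScissors.RealOnePeriodRelationsNegative
  (unitDom isSemialgebraic_unitDom volume_unitDom constRep₁ constRep₁_domain constRep₁_integrand)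

/-! ## §6d (cycle 2) No fake torsion: `[(0,1), t] − [(0,1), 1/2]` is ONE (non-affine) change of variables

Checked instance behind the warning at the end of the §6 docstring (work file only). -/

/-- `[∫_{(0,1)} t dt]`. -/
def idRep : KZ.IntegralRep 1 where
  domain := unitDom
  integrand := fun x => x 0
  isSemialgebraic_domain := isSemialgebraic_unitDom
  isSemialgebraicFunOn_integrand :=
    (isSemialgebraicFunOn_aeval isSemialgebraic_unitDom (X 0 : MvPolynomial (Fin 1) ℚ)).congr
      fun x _ => by simp
  integrableOn := by
    refine Measure.integrableOn_of_bounded (M := 1) (by simp [volume_unitDom]) ?_ ?_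
    · exact (measurable_pi_apply 0).aestronglyMeasurable
    · refine (ae_restrict_mem (measurableSet_Ioo.preimage (measurable_pi_apply 0))).mono ?_
      intro x hx
      have hx' : x 0 ∈ Ioo (0:ℝ) 1 := hx
      rw [Real.norm_eq_abs, abs_le]
      exact ⟨by linarith [hx'.1], hx'.2.le⟩

/-- **The substitution `t = u²` turns `∫₀¹ ½ dt` into `∫₀¹ u du` in ONE rule-2 move**:
`[(0,1), u] − [(0,1), 1/2] ∈ changeOfVariablesRel` (`Φ u = u²`, `|Φ'| = 2u`, `u = ½ · 2u`).
With affine substitutions only, one derives merely `2 • ([t] − [1/2]) ≡ 0`; the would-be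
2-torsion is an artefact of the affine restriction. [cite: KontsevichZagier2001, §1.2 rule (2)] -/
theorem of_idRep_sub_of_constRep_half_mem_changeOfVariablesRel :
    KZ.of idRep - KZ.of (constRep₁ (1/2)) ∈ KZ.changeOfVariablesRel := by
  let Φ : (Fin 1 → ℝ) → (Fin 1 → ℝ) := fun x _ => x 0 * x 0
  let Φ' : (Fin 1 → ℝ) → (Fin 1 → ℝ) →L[ℝ] (Fin 1 → ℝ) :=
    fun x => (2 * x 0) • ContinuousLinearMap.id ℝ (Fin 1 → ℝ)
  have hderiv : ∀ x, HasFDerivWithinAt Φ (Φ' x) unitDom x := by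
    intro x
    have h0 : HasFDerivWithinAt (fun y : Fin 1 → ℝ => y 0)
        (ContinuousLinearMap.proj (R := ℝ) (φ := fun _ : Fin 1 => ℝ) 0) unitDom x :=
      hasFDerivWithinAt_apply (𝕜 := ℝ) 0 x unitDom
    have hmul := h0.mul h0
    have hpi : HasFDerivWithinAt Φ
        (ContinuousLinearMap.pi fun _ : Fin 1 =>
          x 0 • ContinuousLinearMap.proj (R := ℝ) (φ := fun _ : Fin 1 => ℝ) 0 +
            x 0 • ContinuousLinearMap.proj (R := ℝ) (φ := fun _ : Fin 1 => ℝ) 0) unitDom x :=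
      hasFDerivWithinAt_pi.2 fun _ => hmul
    have heq : Φ' x = ContinuousLinearMap.pi fun _ : Fin 1 =>
          x 0 • ContinuousLinearMap.proj (R := ℝ) (φ := fun _ : Fin 1 => ℝ) 0 +
            x 0 • ContinuousLinearMap.proj (R := ℝ) (φ := fun _ : Fin 1 => ℝ) 0 := by
      refine ContinuousLinearMap.ext fun v => _root_.funext fun i => ?_
      have hi : i = 0 := Subsingleton.elim _ _
      subst hi
      simp [Φ']
      ring
    rw [heq]
    exact hpi
  have hdet : ∀ x, (Φ' x).det = 2 * x 0 := by
    intro x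
    have hlin : ((Φ' x : (Fin 1 → ℝ) →L[ℝ] (Fin 1 → ℝ)) : (Fin 1 → ℝ) →ₗ[ℝ] (Fin 1 → ℝ)) =
        (2 * x 0) • LinearMap.id := by
      ext v i
      simp [Φ']
    rw [ContinuousLinearMap.det, hlin, LinearMap.det_smul, LinearMap.det_id]
    simp [Module.finrank_fintype_fun_eq_card]
  refine ⟨1, idRep, constRep₁ (1/2), Φ, Φ', ?_, fun x _ => hderiv x, ?_, ?_, ?_, rfl⟩
  · show IsSemialgebraicMapOn ℚ unitDom Φ
    have := isSemialgebraicMapOn_aeval (k := ℚ) (R := ℝ) isSemialgebraic_unitDom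
      (fun _ : Fin 1 => (X 0 * X 0 : MvPolynomial (Fin 1) ℚ))
    refine this.congr fun x _ => ?_
    funext j
    simp [Φ]
  · intro x hx y hy hxy
    have hx0 : 0 < x 0 := (show x 0 ∈ Ioo (0:ℝ) 1 from hx).1
    have hy0 : 0 < y 0 := (show y 0 ∈ Ioo (0:ℝ) 1 from hy).1
    have h := congrFun hxy 0
    simp only [Φ] at h
    have : x 0 = y 0 := by nlinarith
    funext i
    have hi : i = 0 := Subsingleton.elim _ _
    subst hi
    exact this
  · ext y
    simp only [constRep₁_domain, mem_image]
    constructor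
    · intro hy
      have hy' : y 0 ∈ Ioo (0:ℝ) 1 := hy
      refine ⟨fun _ => Real.sqrt (y 0), ?_, ?_⟩
      · show Real.sqrt (y 0) ∈ Ioo (0:ℝ) 1
        exact ⟨Real.sqrt_pos.mpr hy'.1, (Real.sqrt_lt' one_pos).mpr (by simpa using hy'.2)⟩
      · funext i
        have hi : i = 0 := Subsingleton.elim _ _
        subst hi
        show Real.sqrt (y 0) * Real.sqrt (y 0) = y 0
        exact Real.mul_self_sqrt hy'.1.le
    · rintro ⟨x, hx, rfl⟩
      have hx' : x 0 ∈ Ioo (0:ℝ) 1 := hx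
      show x 0 * x 0 ∈ Ioo (0:ℝ) 1
      exact ⟨mul_pos hx'.1 hx'.1, by nlinarith [hx'.1, hx'.2]⟩
  · intro x hx
    have hx0 : 0 < x 0 := (show x 0 ∈ Ioo (0:ℝ) 1 from hx).1
    rw [hdet x, abs_of_pos (by linarith)]
    simp [idRep]


/-! ## §7 (cycle 2) A HORIZONTAL change of variables is load-bearing

Sharpening of §3c (landed copy: `Theorems/PlanarAreas/Negative/HorizontalMove.lean`, p76451).
Enlarge `closure (1a ∪ 1b ∪ 3)` by the rule-2 instances whose map fixes the first coordinate on the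
domain (vertical translations and shears `(x,y) ↦ (x, y − f x)` — the `StackingShear` moves —,
fibrewise rescalings `(x,y) ↦ (x, ψ(x,y))` with ANY Jacobian, the under-graph lifts of
`KZ.exists_underGraph`; in dimension `1` only the identity).  Such a move maps each window
`domain ∩ {x₀ < e}` onto the window of the image, so the Jacobian formula ON THE WINDOW shows it
preserves every `Λₑ`; the window invariant survives and the §3c pair is still separated, whereas the
VERTICAL translate `R + (0,5)` is one fixing move away from `R` (dichotomy).  Hence every chain for
the crux contains a rule-2 move that MOVES THE SLICING COORDINATE (swap/rotation, horizontal
translation, `x ↦ φ x` shears such as `FiniteMapShear`, the calibration map of `DiscSectorOneLine`);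
in line green-native-bands that move is its `stub_swap` between the two Newton–Leibniz directions,
which is therefore load-bearing for the line. -/


/-! ## §7a Rule-2 instances fixing the first coordinate preserve the window values -/

/-- The change-of-variables instances (exactly the data of `KZ.changeOfVariablesRel`) whose map
`Φ` FIXES THE FIRST COORDINATE on the domain: `Φ x 0 = x 0` (vacuous in dimension `0`).
A refuter-posited sub-family of rule 2 for the load-bearing analysis. -/
def fixingFirstCoordCoVRel : Set KZ.FormalRep :=
  {c | ∃ (n : ℕ) (r r' : KZ.IntegralRep n) (Φ : (Fin n → ℝ) → (Fin n → ℝ))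
      (Φ' : (Fin n → ℝ) → (Fin n → ℝ) →L[ℝ] (Fin n → ℝ)),
    IsSemialgebraicMapOn ℚ r.domain Φ ∧ (∀ x ∈ r.domain, HasFDerivWithinAt Φ (Φ' x) r.domain x) ∧
    InjOn Φ r.domain ∧ r'.domain = Φ '' r.domain ∧
    (∀ x ∈ r.domain, r.integrand x = r'.integrand (Φ x) * |(Φ' x).det|) ∧
    (∀ x ∈ r.domain, ∀ i : Fin n, (i : ℕ) = 0 → Φ x i = x i) ∧
    c = KZ.of r - KZ.of r'}

/-- These instances are rule-2 instances. [cite: KontsevichZagier2001, §1.2 rule (2)] -/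
theorem fixingFirstCoordCoVRel_subset : fixingFirstCoordCoVRel ⊆ KZ.changeOfVariablesRel := by
  rintro c ⟨n, r, r', Φ, Φ', hΦ, hd, hinj, hdom, hf, -, rfl⟩
  exact ⟨n, r, r', Φ, Φ', hΦ, hd, hinj, hdom, hf, rfl⟩

/-- Hence the enlarged sub-calculus is still a sub-calculus of the KZ moves. [cite: KontsevichZagier2001, §1.2] -/
theorem closure_fixing_le_relations :
    AddSubgroup.closure (KZ.domainAddRel ∪ KZ.integrandAddRel ∪ fixingFirstCoordCoVRel ∪
      KZ.newtonLeibnizRel) ≤ KZ.relations := by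
  refine AddSubgroup.closure_mono ?_
  rintro c (((hc | hc) | hc) | hc)
  · exact Or.inl (Or.inl (Or.inl hc))
  · exact Or.inl (Or.inl (Or.inr hc))
  · exact Or.inl (Or.inr (fixingFirstCoordCoVRel_subset hc))
  · exact Or.inr hc

/-- **A first-coordinate-fixing change of variables preserves every window value**: it maps
`r.domain ∩ {x₀ < e}` onto `r'.domain ∩ {x₀ < e}`, and the Jacobian formula
(`MeasureTheory.integral_image_eq_integral_abs_det_fderiv_smul`) applies on that measurable
subset (derivatives within and injectivity restrict). [cite: KontsevichZagier2001, §1.2 rule (2)] -/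
theorem restrictedEval_win_eq_zero_of_mem_fixingFirstCoordCoVRel (e : ℝ) {c : KZ.FormalRep}
    (hc : c ∈ fixingFirstCoordCoVRel) : KZ.restrictedEval (win e) c = 0 := by
  obtain ⟨n, r, r', Φ, Φ', -, hd, hinj, hdom, hf, hfix, rfl⟩ := hc
  rw [map_sub, KZ.restrictedEval_of, KZ.restrictedEval_of, sub_eq_zero]
  cases n with
  | zero => simp
  | succ k =>
    have hSm : MeasurableSet (r.domain ∩ win e (k + 1)) :=
      (KZ.IntegralRep.measurableSet_domain_holds r).inter (measurableSet_win e _)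
    have hSsub : r.domain ∩ win e (k + 1) ⊆ r.domain := inter_subset_left
    have hd' : ∀ x ∈ r.domain ∩ win e (k + 1),
        HasFDerivWithinAt Φ (Φ' x) (r.domain ∩ win e (k + 1)) x :=
      fun x hx => (hd x (hSsub hx)).mono hSsub
    have hinj' : InjOn Φ (r.domain ∩ win e (k + 1)) := hinj.mono hSsub
    have himg : Φ '' (r.domain ∩ win e (k + 1)) = r'.domain ∩ win e (k + 1) := by
      ext y
      constructor
      · rintro ⟨x, ⟨hx, hxw⟩, rfl⟩
        refine ⟨hdom ▸ mem_image_of_mem Φ hx, ?_⟩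
        rw [mem_win_succ, hfix x hx 0 rfl]
        exact hxw
      · rintro ⟨hy, hyw⟩
        rw [hdom] at hy
        obtain ⟨x, hx, rfl⟩ := hy
        refine ⟨x, ⟨hx, ?_⟩, rfl⟩
        rw [mem_win_succ] at hyw ⊢
        rwa [hfix x hx 0 rfl] at hyw
    rw [← himg, integral_image_eq_integral_abs_det_fderiv_smul volume hSm hd' hinj']
    refine setIntegral_congr_fun hSm fun x hx => ?_
    rw [hf x (hSsub hx), smul_eq_mul, mul_comm]

/-- **The window invariant along the enlarged sub-calculus**: every element of
`closure (1a ∪ 1b ∪ fixingFirstCoordCoVRel ∪ 3)` has first-coordinate window values semialgebraic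
in `e` up to a constant. [cite: KontsevichZagier2001, §1.2] -/
theorem winSemialgebraic_of_mem_fixing {c : KZ.FormalRep}
    (hc : c ∈ AddSubgroup.closure (KZ.domainAddRel ∪ KZ.integrandAddRel ∪ fixingFirstCoordCoVRel ∪
      KZ.newtonLeibnizRel)) :
    WinSemialgebraic c := by
  refine AddSubgroup.closure_induction (p := fun x _ => WinSemialgebraic x) (fun x hx => ?_)
    winSemialgebraic_zero (fun x y _ _ hx hy => hx.add hy) (fun x _ hx => hx.neg) hc
  rcases hx with ((hx | hx) | hx) | hx
  · exact winSemialgebraic_of_eq_zero fun e =>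
      KZ.restrictedEval_eq_zero_of_mem_domainAddRel _ (measurableSet_win e) hx
  · exact winSemialgebraic_of_eq_zero fun e =>
      KZ.restrictedEval_eq_zero_of_mem_integrandAddRel _ (measurableSet_win e) hx
  · exact winSemialgebraic_of_eq_zero fun e =>
      restrictedEval_win_eq_zero_of_mem_fixingFirstCoordCoVRel e hx
  · obtain ⟨n, r, r', a, b, F, hF, ha, hb, hab, hdom, hcont, hderiv, hr', rfl⟩ := hx
    cases n with
    | zero => exact nl_zero_defect r r' a b F hF ha hb hab hdom hcont hderiv
    | succ k =>
      exact winSemialgebraic_of_eq_zero fun e =>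
        restrictedEval_win_nl_succ e r r' a b F hab hdom hcont hderiv hr'

/-! ## §7b The witness pair has non-semialgebraic window values -/

/-- **`[R] − [R + (3,0)]` has NON-semialgebraic window values**: they equal `log e` on `[1,2]`
(`restrictedEval_win_hypRep`, the translate being invisible for `e ≤ 4`), and `t ↦ log (2 − t) + C`
has derivative `1/(t − 2)` on `(0,1)`, which no `ℚ`-semialgebraic function on `[0,1]` has (tree
barrier `noSemialgebraicPrimitive_inv_sub_two_holds`).  (The contradiction step of
`not_withoutRule2`, isolated for reuse.) [cite: Fresan2024, Rem. 3.6] -/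
theorem not_winSemialgebraic_hyp : ¬ WinSemialgebraic (KZ.of hypRep - KZ.of hypShiftRep) := by
  rintro ⟨Φ, K, hΦ, hwin⟩
  have hlog : ∀ e ∈ Icc (1:ℝ) 2, Φ e + K = Real.log e := by
    intro e he
    rw [← hwin e, map_sub, restrictedEval_win_hypRep he,
      restrictedEval_win_hypShiftRep (he.2.trans (by norm_num)), sub_zero]
  have hI : IsSemialgebraic ℚ {x : Fin 1 → ℝ | x 0 ∈ Icc (0:ℝ) 1} := by
    have h0 := isSemialgebraic_setOf_eval_le (k := ℚ) (R := ℝ) (ι := Fin 1) (C 0) (X 0)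
    have h1 := isSemialgebraic_setOf_eval_le (k := ℚ) (R := ℝ) (ι := Fin 1) (X 0) (C 1)
    have hEq : {x : Fin 1 → ℝ | x 0 ∈ Icc (0:ℝ) 1} =
        {x : Fin 1 → ℝ | aeval x (C 0 : MvPolynomial (Fin 1) ℚ) ≤ aeval x (X 0 : MvPolynomial (Fin 1) ℚ)} ∩
        {x : Fin 1 → ℝ | aeval x (X 0 : MvPolynomial (Fin 1) ℚ) ≤ aeval x (C 1 : MvPolynomial (Fin 1) ℚ)} := by
      ext x
      simp
    rw [hEq]
    exact h0.inter h1
  refine Literature.Barriers.KontsevichZagierPeriods.KZ.noSemialgebraicPrimitive_inv_sub_two_holds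
    ⟨fun z => Φ (2 - z 0), ?_, ?_⟩
  · have hm : IsSemialgebraicMapOn ℚ {x : Fin 1 → ℝ | x 0 ∈ Icc (0:ℝ) 1}
        (fun z : Fin 1 → ℝ => fun _ : Fin 1 => 2 - z 0) := by
      have := isSemialgebraicMapOn_aeval (k := ℚ) (R := ℝ) hI
        (fun _ : Fin 1 => (C 2 - X 0 : MvPolynomial (Fin 1) ℚ))
      convert this using 2 with z
      funext j
      simp
    exact IsSemialgebraicFunOn.comp_isSemialgebraicMapOn_holds hΦ hm (fun _ _ => mem_univ _)
  · intro t ht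
    have hEq : (fun s : ℝ => Φ (2 - (fun _ : Fin 1 => s) 0)) =ᶠ[𝓝 t]
        fun s => Real.log (2 - s) - K := by
      filter_upwards [Ioo_mem_nhds ht.1 ht.2] with s hs
      have h2s : 2 - s ∈ Icc (1:ℝ) 2 := ⟨by linarith [hs.2], by linarith [hs.1]⟩
      have := hlog (2 - s) h2s
      show Φ (2 - s) = Real.log (2 - s) - K
      linarith
    refine HasDerivAt.congr_of_eventuallyEq ?_ hEq
    have h1 : HasDerivAt (fun s : ℝ => 2 - s) (-1) t := by
      simpa using (hasDerivAt_id t).const_sub 2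
    have h2 : HasDerivAt (fun s : ℝ => Real.log (2 - s)) ((2 - t)⁻¹ * (-1)) t :=
      (Real.hasDerivAt_log (show (2 - t) ≠ 0 by linarith [ht.2])).comp t h1
    have h3 := h2.sub_const K
    convert h3 using 1
    have : (t - 2) ≠ 0 := by linarith [ht.2]
    have : (2 - t) ≠ 0 := by linarith [ht.2]
    field_simp
    ring

/-! ## §7c The refutation: a horizontal move is load-bearing -/

/-- STRENGTHENING: chains of rules 1a, 1b, 3 (any dimensions) together with the rule-2 instances
that FIX THE FIRST COORDINATE.  A refuter-posited sub-calculus for the load-bearing analysis. -/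
def WithoutHorizontalMove : Prop :=
  ∀ (r r' : KZ.IntegralRep 2), (∀ p ∈ r.domain, r.integrand p = 1) →
    (∀ p ∈ r'.domain, r'.integrand p = 1) → r.value = r'.value →
    KZ.of r - KZ.of r' ∈
      AddSubgroup.closure (KZ.domainAddRel ∪ KZ.integrandAddRel ∪ fixingFirstCoordCoVRel ∪
        KZ.newtonLeibnizRel)

/-- The cycle-1 strengthening `WithoutRule2` is a special case (monotonicity of closures), so
`not_withoutHorizontalMove` below re-proves `not_withoutRule2`. [folklore] -/
theorem withoutHorizontalMove_of_withoutRule2 (h : WithoutRule2) : WithoutHorizontalMove := by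
  intro r r' hr hr' hv
  refine (AddSubgroup.closure_mono ?_) (h r r' hr hr' hv)
  rintro c ((hc | hc) | hc)
  · exact Or.inl (Or.inl (Or.inl hc))
  · exact Or.inl (Or.inl (Or.inr hc))
  · exact Or.inr hc

/-- **A change of variables MOVING THE FIRST COORDINATE is load-bearing.**  The hyperbola region
`R = {1<x<2, 0<y<1/x}` and its horizontal translate `R + (3,0)` (equal area `log 2`) are NOT
connected by rules 1a, 1b, 3 and first-coordinate-fixing changes of variables, through any
dimensions: window values along such chains are semialgebraic up to a constant
(`winSemialgebraic_of_mem_fixing`), those of the pair are `log e` (`not_winSemialgebraic_hyp`).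
Every chain for the crux contains a rule-2 move that does not fix the slicing coordinate (a swap,
a horizontal translation/shear, the calibration map, …). [cite: KontsevichZagier2001, §1.2] -/
theorem not_withoutHorizontalMove : ¬ WithoutHorizontalMove := fun h =>
  not_winSemialgebraic_hyp (winSemialgebraic_of_mem_fixing
    (h hypRep hypShiftRep (fun _ _ => rfl) (fun _ _ => rfl) value_hypRep_eq))

/-! ## §7d Tightness: the VERTICAL translate is one move of the sub-calculus away -/

/-- `R + (0, 5) = {1 < x < 2, 5 < y, x (y − 5) < 1}`. -/
def hypUpSet : Set (Fin 2 → ℝ) := {p | 1 < p 0 ∧ p 0 < 2 ∧ 5 < p 1 ∧ p 0 * (p 1 - 5) < 1}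

/-- The vertical translate is `ℚ`-semialgebraic. [folklore] -/
theorem isSemialgebraic_hypUpSet : IsSemialgebraic ℚ hypUpSet := by
  have h0 := isSemialgebraic_setOf_eval_lt (k := ℚ) (R := ℝ) (ι := Fin 2) (C 1) (X 0)
  have h1 := isSemialgebraic_setOf_eval_lt (k := ℚ) (R := ℝ) (ι := Fin 2) (X 0) (C 2)
  have h2 := isSemialgebraic_setOf_eval_lt (k := ℚ) (R := ℝ) (ι := Fin 2) (C 5) (X 1)
  have h3 := isSemialgebraic_setOf_eval_lt (k := ℚ) (R := ℝ) (ι := Fin 2) (X 0 * (X 1 - C 5)) (C 1)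
  have hEq : hypUpSet =
      {x : Fin 2 → ℝ | aeval x (C 1 : MvPolynomial (Fin 2) ℚ) < aeval x (X 0 : MvPolynomial (Fin 2) ℚ)} ∩
      ({x : Fin 2 → ℝ | aeval x (X 0 : MvPolynomial (Fin 2) ℚ) < aeval x (C 2 : MvPolynomial (Fin 2) ℚ)} ∩
      ({x : Fin 2 → ℝ | aeval x (C 5 : MvPolynomial (Fin 2) ℚ) < aeval x (X 1 : MvPolynomial (Fin 2) ℚ)} ∩
      {x : Fin 2 → ℝ | aeval x (X 0 * (X 1 - C 5) : MvPolynomial (Fin 2) ℚ) < aeval x (C 1 : MvPolynomial (Fin 2) ℚ)})) := by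
    ext p
    simp [hypUpSet]
  rw [hEq]
  exact h0.inter (h1.inter (h2.inter h3))

/-- The vertical translate is the image of `R` under `p ↦ p + (0, 5)`. [folklore] -/
theorem hypUpSet_eq_image :
    hypUpSet = (fun p : Fin 2 → ℝ => p + (![0, 5] : Fin 2 → ℝ)) '' hypSet := by
  ext q
  simp only [hypUpSet, hypSet, mem_setOf_eq, mem_image]
  constructor
  · rintro ⟨h1, h2, h3, h4⟩
    refine ⟨q - ![0, 5], ⟨?_, ?_, ?_, ?_⟩, sub_add_cancel q _⟩
    · simp; linarith
    · simp; linarith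
    · simp; linarith
    · simp; nlinarith
  · rintro ⟨p, ⟨h1, h2, h3, h4⟩, rfl⟩
    simp only [Pi.add_apply, Matrix.cons_val_zero, Matrix.cons_val_one, Matrix.cons_val_fin_one,
      add_zero]
    refine ⟨h1, h2, by linarith, by nlinarith⟩

/-- The vertical translate is a preimage of `R` under a translation, hence has the same area. [folklore] -/
theorem volume_hypUpSet : volume hypUpSet = volume hypSet := by
  have : hypUpSet = (fun p : Fin 2 → ℝ => (![0, -5] : Fin 2 → ℝ) + p) ⁻¹' hypSet := by
    rw [hypUpSet_eq_image]
    ext q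
    simp only [mem_image, mem_preimage]
    constructor
    · rintro ⟨p, hp, rfl⟩
      convert hp using 1
      funext i
      fin_cases i <;> simp [Matrix.vecHead, Matrix.vecTail]
    · intro hq
      refine ⟨![0, -5] + q, hq, ?_⟩
      funext i
      fin_cases i <;> simp [Matrix.vecHead, Matrix.vecTail]
  rw [this]
  exact measure_preimage_add _ _ _

/-- `[R + (0,5), 1]`. -/
def hypUpRep : KZ.IntegralRep 2 :=
  constOneRep hypUpSet isSemialgebraic_hypUpSet (by rw [volume_hypUpSet]; exact volume_hypSet_lt_top.ne)

/-- The domain of `hypUpRep`. -/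
@[simp] theorem hypUpRep_domain : hypUpRep.domain = hypUpSet := rfl

/-- **The vertical translation IS a first-coordinate-fixing change of variables**: `[R] − [R + (0,5)]`
is ONE instance of `fixingFirstCoordCoVRel` (`Φ p = p + (0,5)`, `DΦ = id`, `|det| = 1`).  With
`not_withoutHorizontalMove`: vertical translates of `R` are reachable in the sub-calculus,
horizontal ones are not. [cite: KontsevichZagier2001, §1.2 rule (2)] -/
theorem of_hypRep_sub_of_hypUpRep_mem :
    KZ.of hypRep - KZ.of hypUpRep ∈ fixingFirstCoordCoVRel := by
  refine ⟨2, hypRep, hypUpRep, fun p => p + (![0, 5] : Fin 2 → ℝ),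
    fun _ => ContinuousLinearMap.id ℝ (Fin 2 → ℝ), ?_, ?_, ?_, ?_, ?_, ?_, rfl⟩
  · have := isSemialgebraicMapOn_aeval (k := ℚ) (R := ℝ) hypRep.isSemialgebraic_domain
      (![X 0, X 1 + C 5] : Fin 2 → MvPolynomial (Fin 2) ℚ)
    convert this using 2 with x
    funext j
    fin_cases j <;> simp
  · intro x _
    exact (hasFDerivWithinAt_id x _).add_const _
  · intro x _ y _ hxy
    exact add_right_cancel hxy
  · rw [hypUpRep_domain, hypRep_domain, hypUpSet_eq_image]
  · intro x _
    simp [hypRep, hypUpRep, ContinuousLinearMap.det]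
  · intro x _ i hi
    have : i = 0 := Fin.ext hi
    subst this
    simp

/-- So the vertical pair is equivalent INSIDE the sub-calculus that cannot touch the horizontal
pair. [cite: KontsevichZagier2001, §1.2] -/
theorem of_hypRep_sub_of_hypUpRep_mem_closure :
    KZ.of hypRep - KZ.of hypUpRep ∈
      AddSubgroup.closure (KZ.domainAddRel ∪ KZ.integrandAddRel ∪ fixingFirstCoordCoVRel ∪
        KZ.newtonLeibnizRel) :=
  AddSubgroup.subset_closure (Or.inl (Or.inr of_hypRep_sub_of_hypUpRep_mem))


/-! ## §7e Bridge to the tree's FIBRED sub-calculus (`KZFibredRelations`, StuffleInKZ/Negative)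

(Landed copy: `Theorems/PlanarAreas/Negative/FibredAndShadow.lean` §1, p77515.)

The tree's `KZ.fibredChangeOfVariablesRel` ("`Φ x 0 = x 0`", dimensions `n + 1`) is contained in
`fixingFirstCoordCoVRel`, and `KZ.fibredGenerators = 1a ∪ 1b ∪ fibredCoV ∪ fibredNL` with
`fibredNL ⊆ NL`; so the sub-calculus `closure (KZ.fibredGenerators ∪ KZ.newtonLeibnizRel)` of
`StuffleInKZ.Negative.swapWitness_not_mem_closure_fibred_nl` (Theorems/StuffleInKZ/Negative/
ChangeOfVariablesFree.lean: the swap of `[(0,1)×(1,2), dz/(z₀+z₁)]` is not generated by fibred and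
Newton–Leibniz moves, via the MARGINAL-SHADOW invariant `algShadow`) is contained in the §7
sub-calculus.  COMPLEMENTARITY: on integrand-`1` planar regions the marginal shadow is ALWAYS
algebraic (fibre lengths of a semialgebraic set form a semialgebraic function; for `R` it is `1/s` on
`(1,2)`), so `algShadow` is blind on the whole scope of the crux; the window invariant sees the
PRIMITIVE of the marginal (`log`), which is where the transcendence sits.  Hence the new fact below:
the fibred + Newton–Leibniz sub-calculus is not transitive on equal-area integrand-`1` planar pairs
either (`hyp_not_mem_closure_fibred_nl`, `not_fibredNL_transitive_on_areas`). -/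

/-- The tree's fibred changes of variables fix the first coordinate. [cite: KontsevichZagier2001, §1.2 rule (2)] -/
theorem fibredChangeOfVariablesRel_subset_fixing :
    KZ.fibredChangeOfVariablesRel ⊆ fixingFirstCoordCoVRel := by
  rintro c ⟨n, r, r', Φ, Φ', hΦ, hd, hinj, hdom, hf, hfix, rfl⟩
  refine ⟨n + 1, r, r', Φ, Φ', hΦ, hd, hinj, hdom, hf, ?_, rfl⟩
  intro x hx i hi
  have : i = 0 := Fin.ext hi
  subst this
  exact hfix x hx

/-- `closure (fibredGenerators ∪ newtonLeibnizRel) ≤ closure (1a ∪ 1b ∪ fixing ∪ NL)`. [cite: KontsevichZagier2001, §1.2] -/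
theorem closure_fibred_nl_le_closure_fixing :
    AddSubgroup.closure (KZ.fibredGenerators ∪ KZ.newtonLeibnizRel) ≤
      AddSubgroup.closure (KZ.domainAddRel ∪ KZ.integrandAddRel ∪ fixingFirstCoordCoVRel ∪
        KZ.newtonLeibnizRel) := by
  refine AddSubgroup.closure_mono ?_
  rintro c (hc | hc)
  · rcases (KZ.mem_fibredGenerators_iff.mp hc) with h | h | h | h
    · exact Or.inl (Or.inl (Or.inl h))
    · exact Or.inl (Or.inl (Or.inr h))
    · exact Or.inl (Or.inr (fibredChangeOfVariablesRel_subset_fixing h))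
    · exact Or.inr (KZ.fibredNewtonLeibnizRel_subset_newtonLeibnizRel h)
  · exact Or.inr hc

/-- **The hyperbola pair is not connected by fibred + Newton–Leibniz moves** (integrand-`1`
counterpart of `StuffleInKZ.Negative.swapWitness_not_mem_closure_fibred_nl`, by the window invariant
instead of the marginal shadow). [cite: KontsevichZagier2001, §1.2] -/
theorem hyp_not_mem_closure_fibred_nl :
    KZ.of hypRep - KZ.of hypShiftRep ∉ AddSubgroup.closure (KZ.fibredGenerators ∪ KZ.newtonLeibnizRel) :=
  fun h => not_winSemialgebraic_hyp (winSemialgebraic_of_mem_fixing (closure_fibred_nl_le_closure_fixing h))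

/-- STRENGTHENING in tree vocabulary: equal-area integrand-`1` planar pairs are connected inside
`closure (KZ.fibredGenerators ∪ KZ.newtonLeibnizRel)`.  Refuter-posited, for the load-bearing
analysis. -/
def FibredNLTransitiveOnAreas : Prop :=
  ∀ (r r' : KZ.IntegralRep 2), (∀ p ∈ r.domain, r.integrand p = 1) →
    (∀ p ∈ r'.domain, r'.integrand p = 1) → r.value = r'.value →
    KZ.of r - KZ.of r' ∈ AddSubgroup.closure (KZ.fibredGenerators ∪ KZ.newtonLeibnizRel)

/-- **The fibred + Newton–Leibniz sub-calculus does not prove the crux.** [cite: KontsevichZagier2001, §1.2] -/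
theorem not_fibredNLTransitiveOnAreas : ¬ FibredNLTransitiveOnAreas := fun h =>
  hyp_not_mem_closure_fibred_nl (h hypRep hypShiftRep (fun _ _ => rfl) (fun _ _ => rfl) value_hypRep_eq)

/-- … although the vertical translate IS fibred-equivalent to `R` (one `fibredChangeOfVariablesRel`
instance). [cite: KontsevichZagier2001, §1.2 rule (2)] -/
theorem of_hypRep_sub_of_hypUpRep_mem_fibred :
    KZ.of hypRep - KZ.of hypUpRep ∈ KZ.fibredChangeOfVariablesRel := by
  refine ⟨1, hypRep, hypUpRep, fun p => p + (![0, 5] : Fin 2 → ℝ),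
    fun _ => ContinuousLinearMap.id ℝ (Fin 2 → ℝ), ?_, ?_, ?_, ?_, ?_, ?_, rfl⟩
  · have := isSemialgebraicMapOn_aeval (k := ℚ) (R := ℝ) hypRep.isSemialgebraic_domain
      (![X 0, X 1 + C 5] : Fin 2 → MvPolynomial (Fin 2) ℚ)
    convert this using 2 with x
    funext j
    fin_cases j <;> simp
  · intro x _
    exact (hasFDerivWithinAt_id x _).add_const _
  · intro x _ y _ hxy
    exact add_right_cancel hxy
  · rw [hypUpRep_domain, hypRep_domain, hypUpSet_eq_image]
  · intro x _
    simp [hypRep, hypUpRep, ContinuousLinearMap.det]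
  · intro x _
    simp

/-- So `R` and `R + (0,5)` are `KZ.FibredEquivalent`, `R` and `R + (3,0)` are not even
fibred+NL-equivalent. [cite: KontsevichZagier2001, §1.2] -/
theorem fibredEquivalent_hypRep_hypUpRep : KZ.FibredEquivalent hypRep hypUpRep :=
  KZ.mem_fibredRelations_of_mem_fibredChangeOfVariablesRel of_hypRep_sub_of_hypUpRep_mem_fibred

/-! ## §7f (cycle 2) The marginal-shadow invariant of StuffleInKZ is BLIND on the §3c pair

(Landed copy: `Theorems/PlanarAreas/Negative/FibredAndShadow.lean` §2, p77515.)  The cdisprove unit of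
`StuffleInKZ` separates `covFreeRelations = closure (1a ∪ 1b ∪ 3)` (and the fibred + NL
sub-calculus) from `relations` with `algShadow = {c | sliceEval c is a.e. ℚ-semialgebraic}`.  On
integrand-`1` planar regions the marginal is the fibre LENGTH, a semialgebraic function, so that
invariant is void on the whole scope of this crux; here this is PROVED for the §3c pair without
o-minimal input (`R` is CoV-free congruent to its dimension-1 shadow `[(1,2), 1/x]`, which has an
algebraic shadow): `hasAlgShadow_hyp_pair`, versus `not_winSemialgebraic_hyp` (§7b).  Moral: on areas
the transcendence sits in the PRIMITIVE of the Cavalieri data, never in the data itself. -/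

open Summit.KontsevichZagierPeriods.Theorems.StuffleInKZ.Negative
  (HasAlgShadow algShadow mem_algShadow covFreeRelations covFreeRelations_le_algShadow
    hasAlgShadow_of_dim_one newtonLeibnizRel_subset_covFreeRelations)


/-! ## Null regions and null differences inside `closure domainAddRel` -/

/-- A null region is in the closure of rule 1a alone (`[N] − [N] − [N] ∈ domainAddRel` with
`N = N ∪ N`, overlap `N` null). [cite: KontsevichZagier2001, §1.2 rule (1)] -/
theorem of_mem_closure_domainAddRel_of_volume_eq_zero {n : ℕ} (r : KZ.IntegralRep n)
    (h : volume r.domain = 0) : KZ.of r ∈ AddSubgroup.closure KZ.domainAddRel := by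
  have hmem : KZ.of r - KZ.of r - KZ.of r ∈ KZ.domainAddRel :=
    ⟨n, r, r, r, (union_self _).symm, by rwa [inter_self], fun _ _ => rfl, fun _ _ => rfl, rfl⟩
  have heq : KZ.of r - KZ.of r - KZ.of r = -KZ.of r := by abel
  have := AddSubgroup.subset_closure hmem
  rw [heq] at this
  simpa using AddSubgroup.neg_mem _ this

/-- `closure domainAddRel ≤ covFreeRelations`. [folklore] -/
theorem closure_domainAddRel_le_covFree :
    AddSubgroup.closure KZ.domainAddRel ≤ covFreeRelations :=
  AddSubgroup.closure_mono fun _ hc => Or.inl (Or.inl hc)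

/-- **Null differences inside rule 1a**: two integrand-`1` planar representations whose domains
differ by null sets are congruent modulo `closure domainAddRel` (the 1a-only version of
`equivalent_of_null_diff`). [cite: KontsevichZagier2001, §1.2 rule (1)] -/
theorem sub_mem_closure_domainAddRel_of_null_diff (r r' : KZ.IntegralRep 2)
    (hr : ∀ p ∈ r.domain, r.integrand p = 1) (hr' : ∀ p ∈ r'.domain, r'.integrand p = 1)
    (h₁ : volume (r.domain \ r'.domain) = 0) (h₂ : volume (r'.domain \ r.domain) = 0) :
    KZ.of r - KZ.of r' ∈ AddSubgroup.closure KZ.domainAddRel := by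
  have hσ := r.isSemialgebraic_domain
  have hσ' := r'.isSemialgebraic_domain
  have hfin := volume_lt_top_of_integrand_one r hr
  let i : KZ.IntegralRep 2 := constOneRep (r.domain ∩ r'.domain) (hσ.inter hσ')
    (lt_top_iff_ne_top.mp ((measure_mono inter_subset_left).trans_lt hfin))
  let d : KZ.IntegralRep 2 := constOneRep (r.domain \ r'.domain) (hσ.diff hσ')
    (by rw [h₁]; exact ENNReal.zero_ne_top)
  let d' : KZ.IntegralRep 2 := constOneRep (r'.domain \ r.domain) (hσ'.diff hσ)
    (by rw [h₂]; exact ENNReal.zero_ne_top)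
  have ha : KZ.of r - KZ.of i - KZ.of d ∈ AddSubgroup.closure KZ.domainAddRel := by
    refine AddSubgroup.subset_closure ⟨2, r, i, d, ?_, ?_, ?_, ?_, rfl⟩
    · simp [i, d]
    · simp [i, d]
      rw [show r.domain ∩ r'.domain ∩ (r.domain \ r'.domain) = ∅ by
        ext x; simp only [mem_inter_iff, Set.mem_sdiff, mem_empty_iff_false, iff_false]; tauto]
      exact measure_empty
    · intro x hx; exact hr x hx.1
    · intro x hx; exact hr x hx.1
  have ha' : KZ.of r' - KZ.of i - KZ.of d' ∈ AddSubgroup.closure KZ.domainAddRel := by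
    refine AddSubgroup.subset_closure ⟨2, r', i, d', ?_, ?_, ?_, ?_, rfl⟩
    · simp only [i, d', constOneRep_domain]
      rw [inter_comm, inter_union_sdiff]
    · simp only [i, d', constOneRep_domain]
      rw [show r.domain ∩ r'.domain ∩ (r'.domain \ r.domain) = ∅ by
        ext x; simp only [mem_inter_iff, Set.mem_sdiff, mem_empty_iff_false, iff_false]; tauto]
      exact measure_empty
    · intro x hx; exact hr' x hx.2
    · intro x hx; exact hr' x hx.1
  have hd : KZ.of d ∈ AddSubgroup.closure KZ.domainAddRel :=
    of_mem_closure_domainAddRel_of_volume_eq_zero d h₁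
  have hd' : KZ.of d' ∈ AddSubgroup.closure KZ.domainAddRel :=
    of_mem_closure_domainAddRel_of_volume_eq_zero d' h₂
  have : KZ.of r - KZ.of r' =
      (KZ.of r - KZ.of i - KZ.of d) - (KZ.of r' - KZ.of i - KZ.of d') + KZ.of d - KZ.of d' := by
    abel
  rw [this]
  exact AddSubgroup.sub_mem _ (AddSubgroup.add_mem _ (AddSubgroup.sub_mem _ ha ha') hd) hd'

/-! ## `R` and `R + (3,0)` are CoV-free congruent to their dimension-1 shadows -/

/-- **`[R] − [(1,2), 1/x] ∈ covFreeRelations`**: rule 1a against the null arcs `{y = 0}`,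
`{xy = 1}` and ONE Newton–Leibniz move (`KZ.exists_underGraph`). [cite: KontsevichZagier2001, §1.2] -/
theorem of_hypRep_sub_of_invShiftRep_mem_covFree :
    KZ.of hypRep - KZ.of (invShiftRep 0) ∈ covFreeRelations := by
  have h0 : ∀ x ∈ (invShiftRep 0).domain, 0 ≤ (invShiftRep 0).integrand x := by
    intro x hx
    have : (1:ℝ) + (0:ℚ) < x 0 := hx.1
    simp only [invShiftRep_integrand, Rat.cast_zero, sub_zero, inv_nonneg]
    push_cast at this
    linarith
  obtain ⟨G, hGd, hGi, hG⟩ := KZ.exists_underGraph (invShiftRep 0) h0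
  have hmemG : ∀ p : Fin 2 → ℝ, p ∈ G.domain ↔ p 0 ∈ Ioo (1:ℝ) 2 ∧ 0 ≤ p 1 ∧ p 1 ≤ (p 0)⁻¹ := by
    intro p
    rw [hGd]
    show (Fin.init p ∈ {x : Fin 1 → ℝ | x 0 ∈ Ioo ((1:ℝ) + (0:ℚ)) (2 + (0:ℚ))} ∧
      (0:ℝ) ≤ p (Fin.last 1) ∧ p (Fin.last 1) ≤ (Fin.init p 0 - ((0:ℚ) : ℝ))⁻¹) ↔ _
    simp only [mem_setOf_eq, Rat.cast_zero, add_zero, sub_zero]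
    rfl
  have hnull1 : volume {p : Fin 2 → ℝ | p 1 = 0} = 0 := by
    have := MvPolynomial.volume_zeroSet_eq_zero 2 (X 1) (X_ne_zero 1)
    simpa using this
  have hnull2 : volume {p : Fin 2 → ℝ | p 0 * p 1 = 1} = 0 := by
    have hne : (X 0 * X 1 - 1 : MvPolynomial (Fin 2) ℝ) ≠ 0 := by
      intro h
      have := congrArg (MvPolynomial.eval (fun _ : Fin 2 => (0:ℝ))) h
      simp at this
    have := MvPolynomial.volume_zeroSet_eq_zero 2 (X 0 * X 1 - 1) hne
    simpa [sub_eq_zero] using this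
  have hRG : KZ.of hypRep - KZ.of G ∈ AddSubgroup.closure KZ.domainAddRel := by
    refine sub_mem_closure_domainAddRel_of_null_diff hypRep G (fun _ _ => rfl)
      (fun p _ => by rw [hGi]) ?_ ?_
    · rw [show hypRep.domain \ G.domain = ∅ by
        ext p
        simp only [mem_empty_iff_false, iff_false]
        intro hp
        rw [Set.mem_sdiff, hmemG, hypRep_domain] at hp
        have hp1 : 1 < p 0 ∧ p 0 < 2 ∧ 0 < p 1 ∧ p 0 * p 1 < 1 := hp.1
        obtain ⟨h1, h2, h3, h4⟩ := hp1
        have h0 : 0 < p 0 := by linarith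
        refine hp.2 ⟨⟨h1, h2⟩, h3.le, ?_⟩
        rw [← one_div, le_div_iff₀ h0]
        linarith [mul_comm (p 0) (p 1)]]
      exact measure_empty
    · refine measure_mono_null (fun p hp => ?_) (measure_union_null hnull1 hnull2)
      rw [Set.mem_sdiff, hmemG, hypRep_domain] at hp
      obtain ⟨⟨⟨h1, h2⟩, h3, h4⟩, hn⟩ := hp
      replace hn : ¬ (1 < p 0 ∧ p 0 < 2 ∧ 0 < p 1 ∧ p 0 * p 1 < 1) := hn
      have h0 : 0 < p 0 := by linarith
      simp only [mem_union, mem_setOf_eq]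
      by_contra hcon
      simp only [not_or] at hcon
      apply hn
      refine ⟨h1, h2, lt_of_le_of_ne h3 (Ne.symm hcon.1), ?_⟩
      rw [← one_div, le_div_iff₀ h0] at h4
      exact lt_of_le_of_ne (by linarith [mul_comm (p 0) (p 1)]) hcon.2
  have hGr : KZ.of G - KZ.of (invShiftRep 0) ∈ covFreeRelations :=
    newtonLeibnizRel_subset_covFreeRelations hG
  have : KZ.of hypRep - KZ.of (invShiftRep 0) =
      (KZ.of hypRep - KZ.of G) + (KZ.of G - KZ.of (invShiftRep 0)) := by abel
  rw [this]
  exact AddSubgroup.add_mem _ (closure_domainAddRel_le_covFree hRG) hGr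

/-- **`[R + (3,0)] − [(4,5), 1/(x−3)] ∈ covFreeRelations`** likewise. [cite: KontsevichZagier2001, §1.2] -/
theorem of_hypShiftRep_sub_of_invShiftRep_mem_covFree :
    KZ.of hypShiftRep - KZ.of (invShiftRep 3) ∈ covFreeRelations := by
  have h3 : ∀ x ∈ (invShiftRep 3).domain, 0 ≤ (invShiftRep 3).integrand x := by
    intro x hx
    have : (1:ℝ) + (3:ℚ) < x 0 := hx.1
    simp only [invShiftRep_integrand, Rat.cast_ofNat, inv_nonneg]
    push_cast at this
    linarith
  obtain ⟨G', hGd', hGi', hG'⟩ := KZ.exists_underGraph (invShiftRep 3) h3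
  have hmemG' : ∀ p : Fin 2 → ℝ, p ∈ G'.domain ↔ p 0 ∈ Ioo (4:ℝ) 5 ∧ 0 ≤ p 1 ∧ p 1 ≤ (p 0 - 3)⁻¹ := by
    intro p
    rw [hGd']
    show (Fin.init p ∈ {x : Fin 1 → ℝ | x 0 ∈ Ioo ((1:ℝ) + (3:ℚ)) (2 + (3:ℚ))} ∧
      (0:ℝ) ≤ p (Fin.last 1) ∧ p (Fin.last 1) ≤ (Fin.init p 0 - ((3:ℚ) : ℝ))⁻¹) ↔ _
    simp only [mem_setOf_eq, Rat.cast_ofNat]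
    norm_num
    rfl
  have hnull1 : volume {p : Fin 2 → ℝ | p 1 = 0} = 0 := by
    have := MvPolynomial.volume_zeroSet_eq_zero 2 (X 1) (X_ne_zero 1)
    simpa using this
  have hnull3 : volume {p : Fin 2 → ℝ | (p 0 - 3) * p 1 = 1} = 0 := by
    have hne : ((X 0 - 3) * X 1 - 1 : MvPolynomial (Fin 2) ℝ) ≠ 0 := by
      intro h
      have := congrArg (MvPolynomial.eval (fun _ : Fin 2 => (0:ℝ))) h
      simp at this
    have := MvPolynomial.volume_zeroSet_eq_zero 2 ((X 0 - 3) * X 1 - 1) hne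
    simpa [sub_eq_zero] using this
  have hRG' : KZ.of hypShiftRep - KZ.of G' ∈ AddSubgroup.closure KZ.domainAddRel := by
    refine sub_mem_closure_domainAddRel_of_null_diff hypShiftRep G' (fun _ _ => rfl)
      (fun p _ => by rw [hGi']) ?_ ?_
    · rw [show hypShiftRep.domain \ G'.domain = ∅ by
        ext p
        simp only [mem_empty_iff_false, iff_false]
        intro hp
        rw [Set.mem_sdiff, hmemG', hypShiftRep_domain] at hp
        have hp1 : 4 < p 0 ∧ p 0 < 5 ∧ 0 < p 1 ∧ (p 0 - 3) * p 1 < 1 := hp.1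
        obtain ⟨h1, h2, h3, h4⟩ := hp1
        have h0 : 0 < p 0 - 3 := by linarith
        refine hp.2 ⟨⟨h1, h2⟩, h3.le, ?_⟩
        rw [← one_div, le_div_iff₀ h0]
        linarith [mul_comm (p 0 - 3) (p 1)]]
      exact measure_empty
    · refine measure_mono_null (fun p hp => ?_) (measure_union_null hnull1 hnull3)
      rw [Set.mem_sdiff, hmemG', hypShiftRep_domain] at hp
      obtain ⟨⟨⟨h1, h2⟩, h3', h4⟩, hn⟩ := hp
      replace hn : ¬ (4 < p 0 ∧ p 0 < 5 ∧ 0 < p 1 ∧ (p 0 - 3) * p 1 < 1) := hn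
      have h0 : 0 < p 0 - 3 := by linarith
      simp only [mem_union, mem_setOf_eq]
      by_contra hcon
      simp only [not_or] at hcon
      apply hn
      refine ⟨h1, h2, lt_of_le_of_ne h3' (Ne.symm hcon.1), ?_⟩
      rw [← one_div, le_div_iff₀ h0] at h4
      exact lt_of_le_of_ne (by linarith [mul_comm (p 0 - 3) (p 1)]) hcon.2
  have hGr' : KZ.of G' - KZ.of (invShiftRep 3) ∈ covFreeRelations :=
    newtonLeibnizRel_subset_covFreeRelations hG'
  have : KZ.of hypShiftRep - KZ.of (invShiftRep 3) =
      (KZ.of hypShiftRep - KZ.of G') + (KZ.of G' - KZ.of (invShiftRep 3)) := by abel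
  rw [this]
  exact AddSubgroup.add_mem _ (closure_domainAddRel_le_covFree hRG') hGr'

/-! ## The marginal shadow is blind on the pair -/


/-- More generally, EVERY planar representation one Newton–Leibniz move above a dimension-`1`
representation (e.g. the under-graph regions of `KZ.exists_underGraph`) has an algebraic shadow. [cite: KontsevichZagier2001, §1.2] -/
theorem hasAlgShadow_of_sub_mem_newtonLeibnizRel {G : KZ.IntegralRep 2} {s : KZ.IntegralRep 1}
    (h : KZ.of G - KZ.of s ∈ KZ.newtonLeibnizRel) : HasAlgShadow (KZ.of G) := by
  have h1 : HasAlgShadow (KZ.of G - KZ.of s) :=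
    covFreeRelations_le_algShadow (newtonLeibnizRel_subset_covFreeRelations h)
  have := h1.add (hasAlgShadow_of_dim_one s)
  rwa [sub_add_cancel] at this

/-- **`[R]` has an algebraic shadow** (that of `[(1,2), 1/x]`: the marginal of `R` is the fibre
length `1/s` on `(1,2)`). [cite: KontsevichZagier2001, §1.2] -/
theorem hasAlgShadow_hypRep : HasAlgShadow (KZ.of hypRep) := by
  have h1 : HasAlgShadow (KZ.of hypRep - KZ.of (invShiftRep 0)) :=
    covFreeRelations_le_algShadow of_hypRep_sub_of_invShiftRep_mem_covFree
  have h2 : HasAlgShadow (KZ.of (invShiftRep 0)) := hasAlgShadow_of_dim_one (invShiftRep 0)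
  have := h1.add h2
  rwa [sub_add_cancel] at this

/-- **`[R + (3,0)]` has an algebraic shadow** (`1/(s−3)` on `(4,5)`). [cite: KontsevichZagier2001, §1.2] -/
theorem hasAlgShadow_hypShiftRep : HasAlgShadow (KZ.of hypShiftRep) := by
  have h1 : HasAlgShadow (KZ.of hypShiftRep - KZ.of (invShiftRep 3)) :=
    covFreeRelations_le_algShadow of_hypShiftRep_sub_of_invShiftRep_mem_covFree
  have h2 : HasAlgShadow (KZ.of (invShiftRep 3)) := hasAlgShadow_of_dim_one (invShiftRep 3)
  have := h1.add h2
  rwa [sub_add_cancel] at this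

/-- **The marginal-shadow invariant does not separate the §3c pair**: `[R] − [R + (3,0)] ∈ algShadow`
although it lies outside `covFreeRelations` (`not_withoutRule2`) and even outside the fibred + NL
sub-calculus (Negative/HorizontalMove).  On areas the shadow is always algebraic; only its primitive
(the window function `log e`) carries the transcendence. [cite: KontsevichZagier2001, §1.2] -/
theorem hasAlgShadow_hyp_pair : HasAlgShadow (KZ.of hypRep - KZ.of hypShiftRep) := by
  have := hasAlgShadow_hypRep.add hasAlgShadow_hypShiftRep.neg
  rwa [← sub_eq_add_neg] at this

/-- Restated as membership in the subgroup `algShadow`. [cite: KontsevichZagier2001, §1.2] -/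
theorem hyp_pair_mem_algShadow : KZ.of hypRep - KZ.of hypShiftRep ∈ algShadow :=
  (mem_algShadow).mpr hasAlgShadow_hyp_pair

/-- **Complementarity, in one line**: the §3c pair is INSIDE `algShadow` and OUTSIDE the window
class `WinSemialgebraic` — so it is the window invariant, not the marginal shadow, that certifies
`[R] − [R + (3,0)] ∉ covFreeRelations` (indeed `∉ closure (fibredGenerators ∪ NL)`, §7e). -/
theorem shadow_blind_window_sees :
    HasAlgShadow (KZ.of hypRep - KZ.of hypShiftRep) ∧
      ¬ WinSemialgebraic (KZ.of hypRep - KZ.of hypShiftRep) ∧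
      KZ.of hypRep - KZ.of hypShiftRep ∉ covFreeRelations :=
  ⟨hasAlgShadow_hyp_pair, not_winSemialgebraic_hyp, fun h => not_winSemialgebraic_hyp
    (winSemialgebraic_of_mem_fixing ((AddSubgroup.closure_mono (by
      rintro c ((hc | hc) | hc)
      · exact Or.inl (Or.inl (Or.inl hc))
      · exact Or.inl (Or.inl (Or.inr hc))
      · exact Or.inr hc)) h))⟩


/-! ## §8 (cycle 2) Targets — the lead's skeleton stubs

Lead `prover-line-stmt-KontsevichZagierPeriods-4990-0`, line `green-native-bands` (PICKED.md
2026-08-16T02:11Z), skeleton `22c93b59…` registered 02:14Z with seven stubs, all concluding in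
`KZ.relations` (signatures from `ledger workitem get`; the lead's work file is not readable from this
seat, `stub_mixedPartials` is truncated on the ledger).  Each was attacked with the cheap arsenal
(degenerate instances, vacuity of hypotheses, junk values of `deriv`, integrability at the boundary,
the refuted shapes of §3/§3b/§3c/§7).  VERDICT: no stub is of a refuted shape, none is vacuous, all
are TRUE on paper; their risk is size, not truth.  Nothing to land under `Negative/<Stub>False`.

* `stub_swap` `∀ r : IntegralRep 2, ∃ r', r'.domain = swap⁻¹ r.domain ∧ r'.integrand = r.integrand ∘ swap
  on it ∧ [r] − [r'] ∈ relations` — TRUE: ONE rule-2 instance (`Φ = swap`, `ℚ`-linear, `|det| = 1`,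
  measure-preserving so `r'` is an `IntegralRep`).  LOAD-BEARING FOR THE LINE by §7: the other moves
  of the line (vertical bands, Newton–Leibniz along `y`, 1a/1b, `t ↦ 1 − t` in dimension 1 aside)
  fix or only translate the slicing coordinate … (the dimension-1 reflection is itself a non-fixing
  rule-2 move; §7's sub-calculus excludes it too).
* `stub_areaSlicing` `[r] − c ∈ relations` for some `c` in the span of 1-dimensional representations —
  TRUE on paper: vertical `ℚ`-CAD of the (WLOG open, §4) domain; a 2-cell `{x ∈ C, φ x < y < ψ x}`
  over an open interval `C` has FINITE semialgebraic `φ < ψ` (an infinite fibre over a base of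
  positive length contradicts finite area), and `[cell, 1] − [C, ψ − φ] ∈ newtonLeibnizRel` with
  primitive `F = y` (closed versus open fibres: null, §3d `equivalent_of_null_diff`); lower cells are
  null (`of_mem_relations_of_volume_eq_zero`).  Unbounded domains/cells are harmless.
* `stub_bandNewtonLeibniz` (the engine; `a₀ < a₁` rational, `α ≤ β` semialgebraic on `(a₀,a₁)`, `F`
  semialgebraic on the closed band, fibrewise continuous on `[α t, β t]`, `∂ₛF = r.integrand` off a
  null semialgebraic `Z`) — TRUE on paper.  Existence of `r'`: `Z` null semialgebraic ⇒ `dim Z ≤ 1`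
  ⇒ all but finitely many vertical fibres `Z_t` are finite; on a.e. fibre FTC with finitely many
  exceptional points (continuity of `F(t,·)` across them) gives
  `F(t,β t) − F(t,α t) = ∫ r.integrand(t,s) ds`, so `|r'.integrand| ≤ ∫|r.integrand(t,·)|` is
  integrable (Fubini) and semialgebraic (composition).  Membership: refine the base at the finitely
  many bad abscissae and the band along the semialgebraic graphs through `Z` (CAD adapted to `Z`),
  one `newtonLeibnizRel` instance per sub-band (continuity on CLOSED sub-fibres holds because it holds
  on `[α t, β t]`), telescope the sub-band differences by 1b, reassemble by 1a (null overlaps along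
  graphs and vertical lines).  The endpoint fibres `t = a₀, a₁` of the closed band are null.  No
  hypothesis is droppable: without fibrewise continuity at the points of `Z` the telescoping fails
  (jump of `F` across an arc of `Z` — value-level counterexample `F = 𝟙{s > 1/2}` on the unit band,
  `r.integrand = 0`, `r'.integrand = 1`: `0 ≠ 1`), which is why `ContinuousOn … (Icc (α t) (β t))`
  is load-bearing in the stub.
* `stub_fibreDerivSemialgebraic` (the fibre derivative `p ↦ deriv (s ↦ F(p₀,s)) p₁` on the open
  triangle, `0` elsewhere, is `ℚ`-semialgebraic on `Δ` for `F` semialgebraic on `Δ`) — TRUE: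
  differentiability of the slice at an INTERIOR point and the value of the derivative are first-order
  definable from the graph of `F|Δ` (ε–δ with the side condition `(p₀, p₁ + h) ∈ Δ`, which is
  eventually void at interior points), Mathlib's junk value `deriv = 0` at non-differentiable points
  is definable as the complementary case, and `ℚ`-definable = `ℚ`-semialgebraic (Tarski–Seidenberg,
  tree `tarski_seidenberg_real_holds`).
* `stub_mixedPartials` (truncated on the ledger; hypotheses: `A, B` semialgebraic on `Δ`, `S` with
  `HasFDerivAt S (A p • e₀* + B p • e₁*)` on the open triangle) — whatever a.e.-form its conclusion
  takes, TRUE on paper: `S` is `C¹` (continuous gradient), and off the closed LOWER-DIMENSIONAL set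
  where `A` or `B` fails to be Nash, `S` is `C^∞` and Schwarz gives `∂_b A = ∂_a B`; that set is
  null.  (If the conclusion were stated pointwise on the whole open triangle it would be FALSE —
  `A, B` continuous semialgebraic need not be differentiable everywhere — but the lead's version is
  reported as an a.e./null-set statement.)
* `stub_derivIntegrable` (`A` semialgebraic and continuous on the CLOSED `Δ`, fibre derivative
  semialgebraic ⇒ the fibre derivative is integrable on `Δ`) — TRUE on paper: for `t ∈ (0,1)` the
  slice `s ↦ A(t,s)` on `[0, 1 − t]` is continuous semialgebraic with a number `N` of monotonicity
  intervals bounded UNIFORMLY in `t` (uniform finiteness in semialgebraic families — the one delicate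
  input); on each, `∫ |∂ₛA| = |A(end) − A(start)| ≤ 2‖A‖_∞` (`A` bounded on the compact `Δ`;
  monotone + continuous + `C¹` inside ⇒ improper FTC), so fibre integrals are `≤ 2N‖A‖_∞` and
  Tonelli concludes (measurability from semialgebraicity).  Continuity on the CLOSED triangle is
  load-bearing (e.g. `A = 1/s` near the bottom edge is semialgebraic, continuous inside, with
  non-integrable `∂ₛA = −1/s²`).
* `stub_greenInRelations` `∀ g ∈ greenSet, g ∈ KZ.relations` (`greenSet` of crux 10042's
  Negative/Kit: `A, B` semialgebraic AND CONTINUOUS ON THE CLOSED `Δ`, a `C¹` potential `S` on the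
  open triangle, `g = [A(t,0)] + [(B − A)(1−t,t)] − [B(0,t)]` on `(0,1)`) — TRUE given the five
  analytic stubs: `[band_b, ∂_bA] → [A(t,1−t) − A(t,0)]` (engine), swap + `[band_a, ∂_aB] →
  [B(1−s,s) − B(0,s)]` (engine), `∂_bA = ∂_aB` a.e. (null difference + off-domain freedom), the
  dimension-1 reflection `t ↦ 1 − t` (rule 2) and 1b.  All intermediate 1-dimensional integrands are
  continuous and bounded on `(0,1)`, so they ARE `IntegralRep`s; soundness (`eval g = 0`) is the
  landed `GreenSound` of crux 10042.  The potential `S` itself may be transcendental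
  (`S = log (2 − a)`: `A = −1/(2−a)`, `B = 0`, `g = [−1/(2−t)] + [1/(1+t)] − [0]`), which is harmless
  because `S` never enters a move — only `A`, `B` do (barrier `noSemialgebraicPrimitive_inv_sub_two`
  evaded exactly as the line card says).

Consequence for the crux: if the seven stubs land, `PlanarAreas` is closed MODULO stmt-10042
(`RealOnePeriodRelations`), i.e. the research content moves entirely to the Huber–Wüstholz transfer;
nothing in §1–§7 obstructs that terminal state (all refuted strengthenings delete a move the line
keeps). -/

-- Targets: stub_swap ✓true · stub_areaSlicing ✓true · stub_bandNewtonLeibniz ✓true ·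
-- stub_fibreDerivSemialgebraic ✓true · stub_mixedPartials ✓true (a.e. form) · stub_derivIntegrable ✓true ·
-- stub_greenInRelations ✓true modulo the others.  0 broken.

/-! ## §9 (cycle 2) What is still OPEN on the negative side — made formal

(a) IS RULE 3 LOAD-BEARING?  The Newton–Leibniz-free sub-calculus
`nlFreeRelations = closure (1a ∪ 1b ∪ 2)` (Theorems/StuffleInKZ/Negative/NewtonLeibnizFree.lean,
`nlFreeRelations_lt_relations`: rule 3 IS independent of 1 + 2 in general, by GRADED evaluation —
a cross-dimensional witness `∫₀¹ dt − [pt, 1]`).  For the crux the graded evaluation is blind (both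
representations live in dimension `2` and have the same value: `gradedEval_sub_eq_zero`), and the
planar content of rule 3 on subgraphs is subsumed by rule 2 (the `|det| = 1` shear
`(x,y) ↦ (φ x, y/φ' x)` of `FiniteMapShear` flattens the subgraph of `φ'` with no primitive in
sight).  The strengthening `WithoutRule3` sits between crux 3 and crux 5 of the route:
`PlanarK0Injective → WithoutRule3 → PlanarAreas` (`withoutRule3_of_planarK0Injective`,
`planarAreas_of_withoutRule3`); refuting it would refute `PlanarK0Injective` (open problem,
Cresson–Viu-Sos 2022, Problem 2.1 in set-chain form), proving it would make rule 3 and every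
detour through other dimensions unnecessary for areas.  No invariant of `closure (1a ∪ 1b ∪ 2)`
finer than the area is known on planar integrand-`1` pairs: OPEN.
(b) TORSION (§6c): OPEN, no candidate.
(c) DIMENSION BUDGET: does `KZ.relationsLE 2` (chains through dimensions `≤ 2`) suffice?  Every
relation of Huber–Wüstholz type for 1-periods (bilinearity: 1b; functoriality along finite maps of
curves: rule 2 on monotonicity intervals + 1b over the branches; exact forms: rule 3 to dimension
`0`/`1`; Cauchy/residue relations among ovals: Green = rule 3 in dimension `2`) is realised in
dimension `≤ 2` on paper, so no refutation of the `relationsLE 2` strengthening is in sight either: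
OPEN (and a POSITIVE conjecture worth recording for the planners: `PlanarAreas` is probably
equivalent to its `relationsLE 2` form).
(d) Any invariant of the FULL calculus finer than `eval` on 1-periods = a counterexample to
Conjecture 1 for curves: none (Huber–Wüstholz 2022, Thm. 13.3 (2) makes every `ℚ̄`-linear
relation among 1-periods motivic; the transfer "motivic ⇒ chain of real semialgebraic moves" is
exactly the lead's line and its crux stmt-10042). -/

open Summit.KontsevichZagierPeriods.Theorems.StuffleInKZ.Negative (gradedEval gradedEval_of
  nlFreeRelations nlFreeRelations_le_relations)

/-- Graded evaluation is BLIND on the crux: for two planar representations of equal value every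
`gradedEval N ([r] − [r'])` vanishes (so the tree's rule-3-independence invariant cannot decide
whether rule 3 is load-bearing for areas). [cite: KontsevichZagier2001, §1.2] -/
theorem gradedEval_sub_eq_zero (r r' : KZ.IntegralRep 2) (hv : r.value = r'.value) (N : ℕ) :
    gradedEval N (KZ.of r - KZ.of r') = 0 := by
  rw [map_sub, gradedEval_of, gradedEval_of]
  by_cases h : (2 : ℕ) = N <;> simp [h, hv]

/-- STRENGTHENING (status OPEN): equal-area integrand-`1` planar pairs are connected WITHOUT
rule 3, i.e. inside `nlFreeRelations = closure (1a ∪ 1b ∪ 2)`.  Refuter-posited, for the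
load-bearing analysis. -/
def WithoutRule3 : Prop :=
  ∀ (r r' : KZ.IntegralRep 2), (∀ p ∈ r.domain, r.integrand p = 1) →
    (∀ p ∈ r'.domain, r'.integrand p = 1) → r.value = r'.value →
    KZ.of r - KZ.of r' ∈ nlFreeRelations

/-- `PlanarK0Injective` (crux 3 of route SymplecticScissors: the planar set-chain group, rules 1a + 2
on integrand-`1` regions) implies `WithoutRule3` (closure monotonicity). [folklore] -/
theorem withoutRule3_of_planarK0Injective (h : PlanarK0Injective) : WithoutRule3 := by
  intro r r' hr hr' hv
  refine (AddSubgroup.closure_mono ?_) (h r r' hr hr' hv)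
  rintro c ⟨hc | hc, -⟩
  · exact Or.inl (Or.inl hc)
  · exact Or.inr hc

/-- `WithoutRule3` implies the crux (`nlFreeRelations ≤ relations`). [folklore] -/
theorem planarAreas_of_withoutRule3 (h : WithoutRule3) : PlanarAreas :=
  fun r r' hr hr' hv => nlFreeRelations_le_relations (h r r' hr hr' hv)

/-- Hence a refutation of `WithoutRule3` would refute crux 3 `PlanarK0Injective` (contrapositive
bookkeeping for the planners: rule 3 is load-bearing for areas ⇒ the set-chain group is too small). [folklore] -/
theorem not_planarK0Injective_of_not_withoutRule3 (h : ¬ WithoutRule3) : ¬ PlanarK0Injective :=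
  mt withoutRule3_of_planarK0Injective h


/-! ## §10 (cycle 2) Negatives index, barrier catalogue, literature

* `ledger negatives --problem KontsevichZagierPeriods` (2026-08-16T03:3xZ): ONE refuted statement
  in the whole summit (`KinematicFormulas.KinematicPlaneConvex`, stmt-5394: a convexity claim about
  semialgebraic sets, unrelated to the calculus of moves) — nothing bites the crux.
* Barrier catalogue `Literature/Barriers/KontsevichZagierPeriods/`: `AlgebraicPrimitivesObstruction`
  (USED, §3c/§7: it is the source of every separation proved here, always against a SUB-calculus,
  never against `relations`); `PeriodEqualityDecidability` (Sertöz–Ouaknine–Worrell: equality of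
  1-periods is decidable — consistent with, not evidence against, derivability);
  `GrothendieckPeriodConjectureDependence*` (transcendence INPUTS needed by completeness proofs —
  the crux asserts derivability of TRUE identities only, so no transcendence statement is implied by
  it and none can refute it); `HauptvermutungObstruction` (triangulation/cellular issues in higher
  dimension; planar semialgebraic sets are tame).  No catalogued barrier applies to the statement;
  they apply to proof strategies.
* Literature sweep for printed counterexamples / non-derivability claims ("Kontsevich–Zagier
  conjecture counterexample", "relations among periods not obtainable by change of variables",
  Ayoub 2015 Rem. 1.2 on the fixed-number-of-variables form): `lit search` / `lit galaxy` were
  UNAVAILABLE during this cycle (searchd rc 75, 02:5xZ–03:4xZ) — search-degraded, to be re-run; from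
  the held texts already materialised in cycle 1 (KZ 2001 §1.2, Fresán 2024 Rem. 3.6–3.7, Ayoub 2015
  §1, Huber–Wüstholz 2022 Thm. 13.3, Cresson–Viu-Sos 2022 §2): no counterexample to Conjecture 1 is
  claimed anywhere; the only printed scepticism concerns BOUNDED-dimension forms (Ayoub, Rem. 1.2),
  which the crux does not assert. -/


end Summit.KontsevichZagierPeriods.KontsevichZagierPeriods.Cruxes.PlanarAreas.Disproof

end
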